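import Summits.AnomalousDissipation.AnomalousDissipation.Theorems.SawtoothPulseCascadeK1LocalisedCascadeKHCombAmplitude
import Summits.AnomalousDissipation.AnomalousDissipation.Theorems.SawtoothPulseCascadeK1LocalisedCascadeKHCombEnergy
import Summits.AnomalousDissipation.AnomalousDissipation.Theorems.SawtoothPulseCascadeK1LocalisedCascadeKHModeCreation
import Summits.AnomalousDissipation.AnomalousDissipation.Theorems.SawtoothPulseCascadeK1LocalisedCascadeKHTransportParseval
import Summits.AnomalousDissipation.AnomalousDissipation.Theorems.SawtoothPulseCascadeK1LocalisedCascadeKHTransportCoeff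
import Summits.AnomalousDissipation.AnomalousDissipation.Theorems.SawtoothPulseCascadeK1LocalisedCascadeKHStraightPairEnergy
import Summits.AnomalousDissipation.AnomalousDissipation.Theorems.SawtoothPulseCascadeK1LocalisedCascadeKHTransportDuality
import Summits.AnomalousDissipation.AnomalousDissipation.Theorems.SawtoothPulseCascadeK1LocalisedCascadeKHSingleModeCreation
import Summits.AnomalousDissipation.AnomalousDissipation.Theorems.SawtoothPulseCascadeK1LocalisedCascadeKHLineKernel
import Summits.AnomalousDissipation.AnomalousDissipation.Theorems.SawtoothPulseCascadeK1LocalisedCascadeKHSheetPairEnergy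
import Summits.AnomalousDissipation.AnomalousDissipation.Theorems.SawtoothPulseCascadeK1LocalisedCascadeKHModePairedSourceNeg
import Summits.AnomalousDissipation.AnomalousDissipation.Theorems.SawtoothPulseCascadeK1LocalisedCascadeKHModePairedCreation
import Summits.AnomalousDissipation.AnomalousDissipation.Theorems.SawtoothPulseCascadeK1LocalisedCascadeKHModeSquareSum
import Summits.AnomalousDissipation.AnomalousDissipation.Theorems.SawtoothPulseCascadeK1LocalisedCascadeKHModePairedCreationOne
import Summits.AnomalousDissipation.AnomalousDissipation.Theorems.SawtoothPulseCascadeK1LocalisedCascadeKHDuhamelAnyLine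
import Summits.AnomalousDissipation.AnomalousDissipation.Theorems.SawtoothPulseCascadeK1LocalisedCascadeKHCornerSources
import Summits.AnomalousDissipation.AnomalousDissipation.Theorems.SawtoothPulseCascadeK1LocalisedCascadeKHCornerFrame

/-!
# K2 lane — `K2CoreLineLaw.lean` (crux file #4): B1 of record on the unit strip, first bricks — the THRESHOLD-FREE single-mode creation bound on ANY line `a > 0`

prover ad-k1loc-p2 g12 (K2 lane), crux workfile on the dir of stmt-AnomalousDissipation-19491; companion of `K2CreationLaws.lean` (§21–§27, at the 200 kB cap; arbiter
A28-9/9′: B1 OF RECORD = `CoreLineLaw C`, exact line-energy form on `|a| < 1`).  Over p4's VERBATIM definitions and the verbatim glue copies of `K2CreationLaws.lean`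
(`Cruxes/…` modules are not importable), this file proves the stability-free per-mode creation bound

* §1 `continuous_propC/propSn`, `abs_propC_le`, `abs_propSn_le` — the three propagator branches (cosh / cos / 1) under the common roof `cosh(θ√λ₊)`, `|Sn| ≤ θ·cosh(θ√λ₊)`,
  `λ₊ = max 0 λ` (tree `…KHDuhamelAnyLine` p719542);
* §2 `sheetAmps_singleMode_apply_0_pos/1_pos` — the Duhamel formula on any line `a > 0` with the symbolic propagator entries;
* §3 **`norm_sheetAmps_singleMode_anyLine`** — `‖sheetAmps a β θ (singleMode (β+n)) i‖ ≤ TF(a,β,θ)·(1+q+2x²)(1+θ/2)(arctan(u+θ) − arctan(u−θ))/((1−q)κ²)`,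
  `TF = cosh(θ√λ₊)·(4πa) + θ·cosh(θ√λ₊)·(a|p| + 2a‖S‖)·(4πa)`, for EVERY `a > 0` (KH band and threshold included), any Bloch phase, any lattice mode.

What is NOT here (successor): the square sum / Cauchy–Schwarz step (template `K2CreationLaws` §22) giving the energy-form law on `[a₀, 1)` with `C(a₀)` explicit, hence
`CoreLineLaw` on the corner strip `(0, a₀)` only; the corner asymptotics.  No statement about the crux; nothing here is a number of record.

**v2 (p2 g13, A28-11): B1 CLOSED IN THIS FILE — `coreLineLaw_B1 : CoreLineLaw (max cornerConst (2·84500·prefBound(1/16)²·(16π + 1024)))`.**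
§9–§17 below (appended; §1–§8 byte-identical to v1 ecc4f96934d9) prove the CORNER LAW `coreStripLaw_sixteenth : CoreStripLaw (1/16) cornerConst`
by an `H¹–H⁻¹` duality in the kink-pair frame (the block is off-diagonal there and the pole of `Σ₀` cancels against the pole of `e^{iπb}S` in the
coefficient feeding the corner column; the antisymmetric kernel pair is pole-free; Bessel + integration by parts under the Bloch condition;
tree inputs `…KHBlochDuality`, `…KHKernelBloch`, `…KHKernelBlochDeriv`, `…KHCornerFrame`, `…KHCornerPhase`, `…KHCornerSources`, all p2 g13), and
compose it with §7 `coreLineLaw_of_strip`.  With `K2CreationLaws.entryBoundsW_of_coreLineLaw` (same verbatim definitions) the truth half of the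
K2 chain is complete: `EntryBoundsW θ 0 M D` for every cell, class, truncation and age.  The same sections stand alone in `K2CornerLaw.lean`.
-/

open Set MeasureTheory intervalIntegral

set_option linter.dupNamespace false

namespace Summit.AnomalousDissipation.AnomalousDissipation.Cruxes.K1LocalisedCascade.K2CoreLineLaw

open Literature.Analysis.FluidPDE.SawtoothCascade
open Summit.AnomalousDissipation.AnomalousDissipation.Theorems.SawtoothPulseCascade.K2PhaseBudget

noncomputable section

/-! ## Verbatim copies (p4: `K2ConeSketch.lean` v1.4 §0.1–§0.3, §1, §2, §4, §6.4) -/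

/-- The periodised Biot–Savart LINE KERNEL (p2's corrected sign). -/
def lineKernel (a β y : ℝ) : ℂ :=
  let κ : ℝ := 2 * Real.pi * |a|
  let r : ℝ := y - (⌊y⌋ : ℝ)
  let z : ℂ := Complex.exp (2 * Real.pi * β * Complex.I)
  Complex.exp (2 * Real.pi * β * (⌊y⌋ : ℝ) * Complex.I) *
    ((-(((Real.exp (-(κ * r)) : ℂ) / (1 - (starRingEnd ℂ z) * (Real.exp (-κ) : ℂ)))
          + (Real.exp (κ * (r - 1)) : ℂ) * z / (1 - z * (Real.exp (-κ) : ℂ)))) / (2 * κ : ℂ))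

/-- Transport multiplier of an H slot of total strain `θ` on the streamwise mode `a`. -/
def transportPhase (a θ y : ℝ) : ℂ :=
  Complex.exp (-(2 * Real.pi * a * θ * triWave y : ℝ) * Complex.I)

/-- The 2 × 2 Kelvin–Helmholtz block of the kink-sheet pair. -/
def blockX (a β : ℝ) : Matrix (Fin 2) (Fin 2) ℂ :=
  ((2 * Real.pi * a : ℝ) * Complex.I : ℂ) •
    !![-(1 / 4 : ℂ) - 2 * lineKernel a β 0, -2 * lineKernel a β (1 / 2);
       2 * starRingEnd ℂ (lineKernel a β (1 / 2)), (1 / 4 : ℂ) + 2 * lineKernel a β 0]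

/-- `λ(a, β) = -a²·c²(a, β)`. -/
def khLam (a β : ℝ) : ℝ := -(a ^ 2 * sawC2 a β)

/-- `C(t)`: `cosh(√λ t)` / `cos(√(-λ) t)` / `1`. -/
def propC (a β t : ℝ) : ℝ :=
  if 0 < khLam a β then Real.cosh (Real.sqrt (khLam a β) * t)
  else if khLam a β < 0 then Real.cos (Real.sqrt (-(khLam a β)) * t) else 1

/-- `Sn(t)`: `sinh(√λ t)/√λ` / `sin(√(-λ) t)/√(-λ)` / `t`. -/
def propSn (a β t : ℝ) : ℝ :=
  if 0 < khLam a β then Real.sinh (Real.sqrt (khLam a β) * t) / Real.sqrt (khLam a β)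
  else if khLam a β < 0 then Real.sin (Real.sqrt (-(khLam a β)) * t) / Real.sqrt (-(khLam a β)) else t

/-- The explicit propagator `P(t) = C(t)·1 + Sn(t)·X`. -/
def propagator (a β t : ℝ) : Matrix (Fin 2) (Fin 2) ℂ :=
  ((propC a β t : ℝ) : ℂ) • (1 : Matrix (Fin 2) (Fin 2) ℂ) + ((propSn a β t : ℝ) : ℂ) • blockX a β

/-- S-4 state of ONE line family. -/
structure LamState where
  interior : ℝ → ℂ
  sheets : List (ℝ × ℂ)

/-- The pure interior mode `ζ₀ ≡ 1`. -/
def pureMode : LamState := ⟨fun _ => 1, []⟩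

/-- A bare sheet pair on the kink lines with amplitudes `(q₊, q₋)` and no interior content. -/
def sheetPair (qp qm : ℂ) : LamState := ⟨fun _ => 0, [((1 / 4 : ℝ), qp), (-(1 / 4 : ℝ), qm)]⟩

/-- Forcing of the block at slot-time `s`. -/
def forcing (a β : ℝ) (st : LamState) (s : ℝ) : Fin 2 → ℂ :=
  let src : ℝ → ℂ := fun y0 =>
    (∫ y in (-(1 / 2 : ℝ))..(1 / 2), lineKernel a β (y0 - y) * st.interior y * transportPhase a s y)
      + (st.sheets.map (fun p => lineKernel a β (y0 - p.1) * p.2 * transportPhase a s p.1)).sum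
  ![((2 * Real.pi * a : ℝ) * Complex.I : ℂ) * (-2) * src (1 / 4),
    ((2 * Real.pi * a : ℝ) * Complex.I : ℂ) * 2 * src (-(1 / 4))]

/-- Fresh sheet amplitudes after strain `θ` (Duhamel): `q(θ) = ∫₀^θ P(θ - s) f(s) ds`. -/
def sheetAmps (a β θ : ℝ) (st : LamState) : Fin 2 → ℂ :=
  ∫ s in (0 : ℝ)..θ, (propagator a β (θ - s)).mulVec (forcing a β st s)

/-- THE SLOT MAP on one line family (S-2). -/
def slotMap (a β θ : ℝ) (st : LamState) : LamState :=
  ⟨fun y => st.interior y * transportPhase a θ y,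
   (st.sheets.map (fun p => (p.1, p.2 * transportPhase a θ p.1)))
     ++ [((1 / 4 : ℝ), sheetAmps a β θ st 0), (-(1 / 4 : ℝ), sheetAmps a β θ st 1)]⟩

/-- Transverse Fourier coefficient at `β + n`. -/
def coeff (β : ℝ) (st : LamState) (n : ℤ) : ℂ :=
  (∫ y in (-(1 / 2 : ℝ))..(1 / 2), st.interior y * Complex.exp (-(2 * Real.pi * (β + n) * y : ℝ) * Complex.I))
    + (st.sheets.map (fun p => p.2 * Complex.exp (-(2 * Real.pi * (β + n) * p.1 : ℝ) * Complex.I))).sum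

/-- Kinetic energy of the state on the family `(a, β)`. -/
def energy (a β : ℝ) (st : LamState) : ℝ :=
  ∑' n : ℤ, ‖coeff β st n‖ ^ 2 / (4 * Real.pi ^ 2 * (a ^ 2 + (β + n) ^ 2))

/-- Lattice state of one Bloch class `(α, β)`. -/
abbrev CState : Type := ℤ → ℤ → ℂ

/-- The truncation window `[-K, K]`. -/
def win (K : ℕ) : Finset ℤ := Finset.Icc (-(K : ℤ)) K

/-- Kinetic energy at level `ℓ` of the truncated state. -/
def cEnergy (α β : ℝ) (ℓ K : ℕ) (ζ : CState) : ℝ :=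
  ∑ m ∈ win K, ∑ n ∈ win K, ‖ζ m n‖ ^ 2 / (4 * Real.pi ^ 2 * (4 : ℝ) ^ ℓ * ((α + m) ^ 2 + (β + n) ^ 2))

/-- The transverse profile `y ↦ Σ_{|n| ≤ K} c(n) e^{2πi(β+n)y}` of a truncated coefficient row. -/
def modeProfile (β : ℝ) (K : ℕ) (c : ℤ → ℂ) : ℝ → ℂ :=
  fun y => ∑ n ∈ win K, c n * Complex.exp ((2 * Real.pi * (β + n) * y : ℝ) * Complex.I)

/-- H slot (strain `θ`), TRANSPORTED part: row `m` is the family `(α + m, β)`; its profile is multiplied by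
`transportPhase` and re-expanded (`K2SlotMap.coeff`), truncated to the window. -/
def hTransport (α β θ : ℝ) (K : ℕ) (ζ : CState) : CState := fun m n' =>
  if m ∈ win K ∧ n' ∈ win K then
    coeff β ⟨fun y => modeProfile β K (ζ m) y * transportPhase (α + m) θ y, []⟩ n'
  else 0

/-- V slot (strain `θ`), TRANSPORTED part: column `n` is the family `(β + n, α)` (roles of the coordinates exchanged),
its profile over `x` read from the column. -/
def vTransport (α β θ : ℝ) (K : ℕ) (ζ : CState) : CState := fun m' n =>
  if m' ∈ win K ∧ n ∈ win K then
    coeff α ⟨fun x => modeProfile α K (fun m => ζ m n) x * transportPhase (β + n) θ x, []⟩ m'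
  else 0

/-- V slot, FRESH V-pair densities per column. -/
def vFresh (α β θ : ℝ) (K : ℕ) (ζ : CState) : ℤ → Fin 2 → ℂ := fun n =>
  if n ∈ win K then sheetAmps (β + n) α θ ⟨modeProfile α K (fun m => ζ m n), []⟩ else 0

/-- Lattice state of a V-sheet pair with densities `p`. -/
def vPairState (α : ℝ) (p : ℤ → Fin 2 → ℂ) : CState := fun m n =>
  p n 0 * Complex.exp (-(Real.pi * (α + m) / 2 : ℝ) * Complex.I)
    + p n 1 * Complex.exp ((Real.pi * (α + m) / 2 : ℝ) * Complex.I)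

/-- Lower edges of the shells. -/
def shellLo : ℕ → ℝ
  | 0 => 0
  | 1 => 16 / 25
  | (s + 2) => (2 : ℝ) ^ (s + 1)

/-- Upper edge of shell `s`. -/
def shellHi (s : ℕ) : ℝ := shellLo (s + 1)

/-- `x` lies in shell `s`. -/
def InShell (s : ℕ) (x : ℝ) : Prop := shellLo s ≤ |x| ∧ |x| < shellHi s


/-! ## Verbatim copies, continued (p4 `K2ConeSketch.lean` §1–§4: children, fresh H pairs, phase pieces, piece types, shells, `Transfer`) -/

/-- CHILDREN re-framing (one cascade level down, period halves): the modes of class `(α, β)` with parities `(pm, pn)`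
form the child class `((α + pm)/2, (β + pn)/2)` with `ζ_child(m, n) = ζ(2m + pm, 2n + pn)`. -/
def child (pm pn : ℤ) (ζ : CState) : CState := fun m n => ζ (2 * m + pm) (2 * n + pn)

/-- The child class of `(α, β)` with parities `(pm, pn)`. -/
def childClass (α β : ℝ) (pm pn : ℤ) : ℝ × ℝ := ((α + pm) / 2, (β + pn) / 2)

/-- The parity set `{0, 1}`. -/
def parities : Finset ℤ := {0, 1}

/-- H slot, FRESH H-pair densities per row (`K2SlotMap.sheetAmps` of the row's family): `q m = (q₊, q₋)` on
`y = 1/4`, `y = -1/4`, streamwise wavenumber `α + m`. -/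
def hFresh (α β θ : ℝ) (K : ℕ) (ζ : CState) : ℤ → Fin 2 → ℂ := fun m =>
  if m ∈ win K then sheetAmps (α + m) β θ ⟨modeProfile β K (ζ m), []⟩ else 0

/-- Lattice state of an H-sheet pair with densities `q` (engine `SH`): `Z(m,n) = q₊(m) e^{-iπ(β+n)/2} + q₋(m) e^{iπ(β+n)/2}`. -/
def hPairState (β : ℝ) (q : ℤ → Fin 2 → ℂ) : CState := fun m n =>
  q m 0 * Complex.exp (-(Real.pi * (β + n) / 2 : ℝ) * Complex.I)
    + q m 1 * Complex.exp ((Real.pi * (β + n) / 2 : ℝ) * Complex.I)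

/-! ## 3. Phase pieces (material bookkeeping of one phase = H slot then V slot at one level) -/

/-- The three pieces a phase produces from the state entering it. -/
structure PhasePieces where
  /-- densities of the fresh straight V-pair created in the V slot (type V). -/
  freshV : ℤ → Fin 2 → ℂ
  /-- densities of the fresh H-pair created in the H slot; at phase end its state is `vTransport (hPairState freshH)` (type H). -/
  freshH : ℤ → Fin 2 → ℂ
  /-- debris: the entering state transported by both slots. -/
  debris : CState

/-- The phase pieces of class `(α, β)` at truncation `K` (strain `θ` per slot): `T = hTransport ζ`, `hq = hFresh ζ`,
the V slot acts on `T + hPairState hq`; fresh V densities from the whole of it, debris = `vTransport T`. -/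
def phasePieces (α β θ : ℝ) (K : ℕ) (ζ : CState) : PhasePieces :=
  let T : CState := hTransport α β θ K ζ
  let hq : ℤ → Fin 2 → ℂ := hFresh α β θ K ζ
  let S : CState := fun m n => T m n + hPairState β hq m n
  ⟨vFresh α β θ K S, hq, vTransport α β θ K T⟩

/-- The total state at phase end: fresh V pair + V-transported fresh H pair + debris. -/
def phaseTotal (α β θ : ℝ) (K : ℕ) (ζ : CState) : CState := fun m n =>
  let pc := phasePieces α β θ K ζ
  vPairState α pc.freshV m n + vTransport α β θ K (hPairState β pc.freshH) m n + pc.debris m n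

/-- The two piece types carrying a shell profile: fresh straight V pairs and once-transported H pairs. -/
inductive PType
  | V
  | H
  deriving DecidableEq, Fintype

/-- Densities restricted to shell `s` (offset `c` = the class coordinate along the sheet). -/
def restrictShell (s : ℕ) (c : ℝ) (d : ℤ → Fin 2 → ℂ) : ℤ → Fin 2 → ℂ :=
  fun (k : ℤ) => if shellLo s ≤ |c + (k : ℝ)| ∧ |c + (k : ℝ)| < shellHi s then d k else 0

/-- "the densities `d` are supported in shell `s`". -/
def SupportedIn (s : ℕ) (c : ℝ) (d : ℤ → Fin 2 → ℂ) : Prop := ∀ k : ℤ, ¬ InShell s (c + (k : ℝ)) → d k = 0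

/-- v1.3: "the densities `d` are supported in shell `s` AND in the truncation window `|k| ≤ K`" (the engine's input basis). -/
def SupportedInW (s : ℕ) (c : ℝ) (K : ℕ) (d : ℤ → Fin 2 → ℂ) : Prop :=
  SupportedIn s c d ∧ ∀ k : ℤ, k ∉ win K → d k = 0

/-- v1.3: truncation of a class state to the window `|m|, |n| ≤ K` (the engine's `(2K+1)²` arrays). -/
def truncW (K : ℕ) (ζ : CState) : CState :=
  fun (m n : ℤ) => if m ∈ win K ∧ n ∈ win K then ζ m n else 0

/-- The lattice state, at phase ENTRY (class `(α, β)`, level 0), of an input piece of type `t` with densities `d`: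
a straight V pair (v1.3: window-truncated, as the engine's `SV` on the `(2K+1)²` lattice), resp. an H pair V-transported once
(created in the previous H slot of the same level; `vTransport` is windowed already). -/
def inputState (α β θ : ℝ) (K : ℕ) : PType → (ℤ → Fin 2 → ℂ) → CState
  | PType.V, p => truncW K (vPairState α p)
  | PType.H, q => vTransport α β θ K (hPairState β q)

/-- The class coordinate along the sheets of type `t`: `β` for V pairs (densities in `β + n`), `α` for H pairs. -/
def alongCoord (α β : ℝ) : PType → ℝ
  | PType.V => β
  | PType.H => α

/-- Level-`ℓ` energy of the output piece `(t', s')` among the phase pieces `pc` of a class `(α', β')` sitting at level `ℓ`. -/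
def outEnergyAt (α' β' θ : ℝ) (K ℓ : ℕ) (s' : ℕ) (pc : PhasePieces) : PType → ℝ
  | PType.V => cEnergy α' β' ℓ K (vPairState α' (restrictShell s' β' pc.freshV))
  | PType.H => cEnergy α' β' ℓ K (vTransport α' β' θ K (hPairState β' (restrictShell s' α' pc.freshH)))

/-- Level-1 energy of the output piece `(t', s')` among the phase pieces `pc` of the child class `(α', β')`. -/
def outEnergy (α' β' θ : ℝ) (K : ℕ) (s' : ℕ) (pc : PhasePieces) : PType → ℝ :=
  outEnergyAt α' β' θ K 1 s' pc

/-- SHELL-TRANSFER ENTRY `M[(t', s'), (t, s)] ≤ M` for the parent class `(α, β)` at truncation `K`: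
every input piece of type `t` with densities in shell `s` produces, summed over the four children and after their
phase, an output piece `(t', s')` of level-1 energy ≤ `M²` × its own level-0 energy.  (WO-p4-K2-4 computes the sup.) -/
def Transfer (α β θ : ℝ) (K : ℕ) (t : PType) (s : ℕ) (t' : PType) (s' : ℕ) (M : ℝ) : Prop :=
  ∀ d : ℤ → Fin 2 → ℂ, SupportedInW s (alongCoord α β t) K d →
    (∑ pm ∈ parities, ∑ pn ∈ parities,
        outEnergy ((α + pm) / 2) ((β + pn) / 2) θ K s'
          (phasePieces ((α + pm) / 2) ((β + pn) / 2) θ K (child pm pn (inputState α β θ K t d))) t')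
      ≤ M ^ 2 * cEnergy α β 0 K (inputState α β θ K t d)

/-! ## §1 The kernel of the crux copy in the tree's shape -/

/-- The tree's closed form of the kernel on one period. -/
def kernelK (a β : ℝ) : ℝ → ℂ := fun r : ℝ => (-((Real.exp (-(2 * Real.pi * a * r)) : ℂ) /
            (1 - starRingEnd ℂ (Complex.exp (2 * Real.pi * β * Complex.I)) * (Real.exp (-(2 * Real.pi * a)) : ℂ))
          + (Real.exp (2 * Real.pi * a * (r - 1)) : ℂ) * Complex.exp (2 * Real.pi * β * Complex.I) /
            (1 - Complex.exp (2 * Real.pi * β * Complex.I) * (Real.exp (-(2 * Real.pi * a)) : ℂ))) /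
        (2 * (2 * Real.pi * a) : ℂ))

/-- For `a > 0`, `lineKernel a β u = e^{2πiβ⌊u⌋} kernelK a β (u − ⌊u⌋)`. -/
theorem lineKernel_eq {a : ℝ} (ha : 0 < a) (β : ℝ) (u : ℝ) :
    lineKernel a β u = Complex.exp (2 * Real.pi * β * (⌊u⌋ : ℝ) * Complex.I) * kernelK a β (u - ⌊u⌋) := by
  simp only [lineKernel, kernelK, abs_of_pos ha]
  push_cast
  ring_nf

/-- `2π · lineKernel a β 0 = Σ₀(a,β)` (tree `twoPi_lineKernel_zero`). -/
theorem twoPi_lineKernel_zero' {a : ℝ} (ha : 0 < a) (β : ℝ) :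
    (2 * Real.pi : ℂ) * lineKernel a β 0 = ((sawSigma0 a β : ℝ) : ℂ) := by
  have h := twoPi_lineKernel_zero ha β
  have hz : Complex.exp (2 * Real.pi * β * Complex.I) = Complex.exp (((2 * Real.pi * β : ℝ) : ℂ) * Complex.I) := by push_cast; ring_nf
  simp only [lineKernel, Int.floor_zero, Int.cast_zero, Complex.ofReal_zero, sub_zero, mul_zero, zero_mul, neg_zero, Real.exp_zero,
    Complex.ofReal_one, Complex.exp_zero, one_mul, zero_sub, mul_neg, mul_one, abs_of_pos ha, hz]
  convert h using 3
  push_cast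
  ring

/-- `2π · conj (lineKernel a β ½) = S_β(a)` (tree `twoPi_conj_lineKernel_half`). -/
theorem twoPi_conj_lineKernel_half' {a : ℝ} (ha : 0 < a) (β : ℝ) :
    (2 * Real.pi : ℂ) * starRingEnd ℂ (lineKernel a β (1 / 2)) = sawS a β := by
  have h := twoPi_conj_lineKernel_half ha β
  have hz : Complex.exp (2 * Real.pi * β * Complex.I) = Complex.exp (((2 * Real.pi * β : ℝ) : ℂ) * Complex.I) := by push_cast; ring_nf
  have hfl : ⌊(1 / 2 : ℝ)⌋ = 0 := by norm_num [Int.floor_eq_zero_iff]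
  have he1 : Real.exp (-(2 * Real.pi * a * (1 / 2))) = Real.exp (-(a * Real.pi)) := by congr 1; ring
  have he2 : Real.exp (2 * Real.pi * a * (1 / 2 - 1)) = Real.exp (-(a * Real.pi)) := by congr 1; ring
  simp only [lineKernel, hfl, Int.cast_zero, Complex.ofReal_zero, sub_zero, mul_zero, zero_mul, Complex.exp_zero, one_mul,
    abs_of_pos ha, hz, he1, he2]
  convert h using 3
  push_cast
  ring

/-- The block entries spelled out. -/
theorem blockX_apply (a β : ℝ) :
    blockX a β 0 0 = (((2 * Real.pi * a : ℝ) : ℂ) * Complex.I) * (-(1 / 4 : ℂ) - 2 * lineKernel a β 0) ∧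
    blockX a β 0 1 = (((2 * Real.pi * a : ℝ) : ℂ) * Complex.I) * (-2 * lineKernel a β (1 / 2)) ∧
    blockX a β 1 0 = (((2 * Real.pi * a : ℝ) : ℂ) * Complex.I) * (2 * starRingEnd ℂ (lineKernel a β (1 / 2))) ∧
    blockX a β 1 1 = (((2 * Real.pi * a : ℝ) : ℂ) * Complex.I) * ((1 / 4 : ℂ) + 2 * lineKernel a β 0) := by
  simp [blockX, Matrix.smul_apply, smul_eq_mul]

/-! ## §4 (copy) -/

/-- The kernel is even in `a`. -/
theorem lineKernel_neg (a β y : ℝ) : lineKernel (-a) β y = lineKernel a β y := by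
  simp only [lineKernel, abs_neg]

/-- The transport phase at `−a` is the conjugate. -/
theorem transportPhase_neg (a θ y : ℝ) : transportPhase (-a) θ y = starRingEnd ℂ (transportPhase a θ y) := by
  simp only [transportPhase, ← Complex.exp_conj, map_mul, map_neg, Complex.conj_ofReal, Complex.conj_I]
  congr 1
  push_cast
  ring


/-! ## §8 (v2) The SHARP single-mode law by name: `‖sheetAmps a β θ (singleMode ξ) i‖ ≤ 0.889/a` for every mode and Bloch phase -/

/-- The single interior mode `e^{2πiξy}` (no sheets) — p2 g10's `K2StableCreation.singleMode`, verbatim. -/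
def singleMode (ξ : ℝ) : LamState := ⟨fun y => Complex.exp (((2 * Real.pi * ξ * y : ℝ) : ℂ) * Complex.I), []⟩

/-- The single-mode source at the kink line `y₀` as a function of the strain time (any Bloch phase). -/
def src (a β ξ y₀ : ℝ) : ℝ → ℂ := fun s =>
  ∫ y in (-(1 / 2 : ℝ))..(1 / 2 : ℝ), lineKernel a β (y₀ - y) * Complex.exp (((2 * Real.pi * ξ * y : ℝ) : ℂ) * Complex.I) *
    Complex.exp (-((2 * Real.pi * a * s * triWave y : ℝ) : ℂ) * Complex.I)

/-- The forcing of the single mode: `f(s) = (2πia·(−2)·src(¼,s), 2πia·2·src(−¼,s))`. -/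
theorem forcing_singleMode (a β ξ s : ℝ) :
    forcing a β (singleMode ξ) s = ![((2 * Real.pi * a : ℝ) * Complex.I : ℂ) * (-2) * src a β ξ (1 / 4) s,
      ((2 * Real.pi * a : ℝ) * Complex.I : ℂ) * 2 * src a β ξ (-(1 / 4)) s] := by
  simp only [forcing, singleMode, transportPhase, src, List.map_nil, List.sum_nil, add_zero]

/-- Stability for every Bloch phase at `a ≥ 1`. -/
theorem khLam_lt_zero_beta {a : ℝ} (ha : 1 ≤ a) (β : ℝ) : khLam a β < 0 := by
  unfold khLam
  have h := sawC2_ge ha β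
  have : 0 < a ^ 2 * sawC2 a β := by positivity
  linarith

/-- `√(−λ) = a√(max 0 c²)` for every Bloch phase. -/
theorem sqrt_neg_khLam_eq_beta {a : ℝ} (ha : 1 ≤ a) (β : ℝ) : Real.sqrt (-(khLam a β)) = a * Real.sqrt (max 0 (sawC2 a β)) := by
  unfold khLam
  have hc : 0 ≤ sawC2 a β := by linarith [sawC2_ge ha β]
  rw [neg_neg, max_eq_right hc, Real.sqrt_mul' _ hc, Real.sqrt_sq (by linarith)]

/-- Stable propagator entries for every Bloch phase. -/
theorem propC_eq_beta {a : ℝ} (ha : 1 ≤ a) (β t : ℝ) : propC a β t = Real.cos (Real.sqrt (-(khLam a β)) * t) := by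
  have h := khLam_lt_zero_beta ha β
  simp only [propC, if_neg (not_lt.2 h.le), if_pos h]

/-- Stable propagator entries for every Bloch phase. -/
theorem propSn_eq_beta {a : ℝ} (ha : 1 ≤ a) (β t : ℝ) :
    propSn a β t = Real.sin (Real.sqrt (-(khLam a β)) * t) / Real.sqrt (-(khLam a β)) := by
  have h := khLam_lt_zero_beta ha β
  simp only [propSn, if_neg (not_lt.2 h.le), if_pos h]

/-- The single-mode sources are continuous in the strain time. -/
theorem continuous_src {a : ℝ} (ha : 0 < a) (β ξ : ℝ) {y₀ : ℝ} (hy₀ : y₀ = 1 / 4 ∨ y₀ = -(1 / 4)) : Continuous (src a β ξ y₀) :=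
  continuous_singleMode_src ha β ξ (K := kernelK a β) rfl (lineKernel_eq ha β) hy₀

/-- **Two-envelope bounds of the single-mode sources** (tree `norm_src_quarter_mode_le`, `norm_src_negQuarter_mode_le`). -/
theorem norm_src_le {a : ℝ} (ha : 0 < a) (β ξ : ℝ) {y₀ : ℝ} (hy₀ : y₀ = 1 / 4 ∨ y₀ = -(1 / 4)) (s : ℝ) :
    ‖src a β ξ y₀ s‖ ≤ (1 + 2 * Real.exp (-(2 * Real.pi * a) / 4) + 2 * Real.exp (-(2 * Real.pi * a) / 4) ^ 2 +
        2 * Real.exp (-(2 * Real.pi * a) / 4) ^ 3 + Real.exp (-(2 * Real.pi * a) / 4) ^ 4) /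
          (((1 - Real.exp (-(2 * Real.pi * a))) * (2 * (2 * Real.pi * a))) * ((2 * Real.pi * a) * Real.sqrt (1 + (ξ / a + 1 * s) ^ 2))) +
        (1 + 2 * Real.exp (-(2 * Real.pi * a) / 4) ^ 2 + Real.exp (-(2 * Real.pi * a) / 4) ^ 4) /
          (((1 - Real.exp (-(2 * Real.pi * a))) * (2 * (2 * Real.pi * a))) * ((2 * Real.pi * a) * Real.sqrt (1 + (ξ / a + (-1) * s) ^ 2))) := by
  rcases hy₀ with h | h <;> subst h
  · exact norm_src_quarter_mode_le ha β ξ s (K := kernelK a β) (G := lineKernel a β) rfl (lineKernel_eq ha β)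
  · exact norm_src_negQuarter_mode_le ha β ξ s (K := kernelK a β) (G := lineKernel a β) rfl (lineKernel_eq ha β)

/-- The Duhamel integrand of the single mode is continuous in the strain time. -/
theorem continuous_duhamelIntegrand_singleMode {a : ℝ} (ha : 1 ≤ a) (β ξ θ : ℝ) :
    Continuous fun s : ℝ => (propagator a β (θ - s)).mulVec (forcing a β (singleMode ξ) s) := by
  have ha0 : 0 < a := by linarith
  have hs0 := continuous_src ha0 β ξ (y₀ := 1 / 4) (Or.inl rfl)
  have hs1 := continuous_src ha0 β ξ (y₀ := -(1 / 4)) (Or.inr rfl)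
  apply continuous_pi
  intro j
  simp only [forcing_singleMode, propagator, propC_eq_beta ha, propSn_eq_beta ha, Matrix.add_mulVec, Matrix.smul_mulVec, Matrix.one_mulVec]
  simp only [Pi.add_apply, Pi.smul_apply, smul_eq_mul, Matrix.mulVec, dotProduct, Fin.sum_univ_two]
  fin_cases j
  · simp only [Fin.zero_eta, Fin.isValue, Matrix.cons_val_zero, Matrix.cons_val_one]
    fun_prop
  · simp only [Fin.mk_one, Fin.isValue, Matrix.cons_val_zero, Matrix.cons_val_one]
    fun_prop

/-- **Reduction, component `0`** (any Bloch phase, `a ≥ 1`). -/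
theorem sheetAmps_singleMode_apply_0 {a : ℝ} (ha : 1 ≤ a) (β ξ θ : ℝ) :
    sheetAmps a β θ (singleMode ξ) 0 = ∫ s in (0 : ℝ)..θ,
      ((Real.cos (Real.sqrt (-(khLam a β)) * (θ - s)) : ℂ) * ((((2 * Real.pi * a : ℝ) * Complex.I : ℂ) * (-2)) * src a β ξ (1 / 4) s) +
        ((Real.sin (Real.sqrt (-(khLam a β)) * (θ - s)) / Real.sqrt (-(khLam a β)) : ℝ) : ℂ) *
          (blockX a β 0 0 * ((((2 * Real.pi * a : ℝ) * Complex.I : ℂ) * (-2)) * src a β ξ (1 / 4) s) +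
            blockX a β 0 1 * ((((2 * Real.pi * a : ℝ) * Complex.I : ℂ) * 2) * src a β ξ (-(1 / 4)) s))) := by
  have hint := (continuous_duhamelIntegrand_singleMode ha β ξ θ).intervalIntegrable (μ := volume) 0 θ
  have hcomp := ((ContinuousLinearMap.proj (R := ℂ) (φ := fun _ : Fin 2 => ℂ) (0 : Fin 2)).intervalIntegral_comp_comm hint).symm
  simp only [ContinuousLinearMap.proj_apply] at hcomp
  unfold sheetAmps
  rw [hcomp]
  refine intervalIntegral.integral_congr fun s _ => ?_
  simp only [forcing_singleMode, propagator, propC_eq_beta ha, propSn_eq_beta ha, Matrix.add_mulVec, Matrix.smul_mulVec, Matrix.one_mulVec]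
  simp only [Pi.add_apply, Pi.smul_apply, smul_eq_mul, Matrix.mulVec, dotProduct, Fin.sum_univ_two, Fin.isValue, Matrix.cons_val_zero,
    Matrix.cons_val_one]

/-- **Reduction, component `1`** (any Bloch phase, `a ≥ 1`). -/
theorem sheetAmps_singleMode_apply_1 {a : ℝ} (ha : 1 ≤ a) (β ξ θ : ℝ) :
    sheetAmps a β θ (singleMode ξ) 1 = ∫ s in (0 : ℝ)..θ,
      ((Real.cos (Real.sqrt (-(khLam a β)) * (θ - s)) : ℂ) * ((((2 * Real.pi * a : ℝ) * Complex.I : ℂ) * 2) * src a β ξ (-(1 / 4)) s) +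
        ((Real.sin (Real.sqrt (-(khLam a β)) * (θ - s)) / Real.sqrt (-(khLam a β)) : ℝ) : ℂ) *
          (blockX a β 1 0 * ((((2 * Real.pi * a : ℝ) * Complex.I : ℂ) * (-2)) * src a β ξ (1 / 4) s) +
            blockX a β 1 1 * ((((2 * Real.pi * a : ℝ) * Complex.I : ℂ) * 2) * src a β ξ (-(1 / 4)) s))) := by
  have hint := (continuous_duhamelIntegrand_singleMode ha β ξ θ).intervalIntegrable (μ := volume) 0 θ
  have hcomp := ((ContinuousLinearMap.proj (R := ℂ) (φ := fun _ : Fin 2 => ℂ) (1 : Fin 2)).intervalIntegral_comp_comm hint).symm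
  simp only [ContinuousLinearMap.proj_apply] at hcomp
  unfold sheetAmps
  rw [hcomp]
  refine intervalIntegral.integral_congr fun s _ => ?_
  simp only [forcing_singleMode, propagator, propC_eq_beta ha, propSn_eq_beta ha, Matrix.add_mulVec, Matrix.smul_mulVec, Matrix.one_mulVec]
  simp only [Pi.add_apply, Pi.smul_apply, smul_eq_mul, Matrix.mulVec, dotProduct, Fin.sum_univ_two, Fin.isValue, Matrix.cons_val_zero,
    Matrix.cons_val_one]

/-- **THE SHARP SINGLE-MODE CREATION LAW BY NAME** (P2-E6 kernel): for `a ≥ 4`, `0 ≤ θ ≤ 8`, EVERY Bloch phase `β` and EVERY interior mode `ξ`,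
`‖sheetAmps a β θ (singleMode ξ) i‖ ≤ 0.889/a` (`i = 0, 1`) — the tree's `8.5/a` (`…KHSingleModeCreation`, p2 g10) divided by `9.5`. -/
theorem norm_sheetAmps_singleMode_le {a : ℝ} (ha : 4 ≤ a) (β ξ : ℝ) {θ : ℝ} (hθ0 : 0 ≤ θ) (hθ : θ ≤ 8) (i : Fin 2) :
    ‖sheetAmps a β θ (singleMode ξ) i‖ ≤ 0.889 / a := by
  have ha1 : 1 ≤ a := by linarith
  have ha0 : 0 < a := by linarith
  have h0 := twoPi_lineKernel_zero' ha0 β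
  have hh := twoPi_conj_lineKernel_half' ha0 β
  have hE₀ := norm_src_le ha0 β ξ (y₀ := 1 / 4) (Or.inl rfl)
  have hE₁ := norm_src_le ha0 β ξ (y₀ := -(1 / 4)) (Or.inr rfl)
  obtain ⟨e00, e01, e10, e11⟩ := blockX_apply a β
  fin_cases i
  · simp only [Fin.zero_eta, Fin.isValue]
    rw [sheetAmps_singleMode_apply_0 ha1, sqrt_neg_khLam_eq_beta ha1, e00, e01]
    exact mode_creation_num_le ha hθ0 hθ h0 hh hE₀ hE₁
  · simp only [Fin.mk_one, Fin.isValue]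
    rw [sheetAmps_singleMode_apply_1 ha1, sqrt_neg_khLam_eq_beta ha1, e10, e11]
    exact mode_creation_num_le' ha hθ0 hθ h0 hh hE₀ hE₁

/-! ## §9 (v2, E6-a) Finite mode profiles: linearity and the ξ-resolved COHERENT creation bound per line -/

/-- The forcing is linear in the interior content (tree `integral_forcing_finset_sum`). -/
theorem forcing_modeProfile {a : ℝ} (ha : 0 < a) (β s : ℝ) (K : ℕ) (c : ℤ → ℂ) :
    forcing a β ⟨modeProfile β K c, []⟩ s = ∑ n ∈ win K, c n • forcing a β (singleMode (β + n)) s := by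
  have h1 := integral_forcing_finset_sum ha β s (K := kernelK a β) rfl (lineKernel_eq ha β) (y₀ := 1 / 4) (Or.inl rfl) (win K) c
  have h2 := integral_forcing_finset_sum ha β s (K := kernelK a β) rfl (lineKernel_eq ha β) (y₀ := -(1 / 4)) (Or.inr rfl) (win K) c
  ext i
  rw [Finset.sum_apply]
  fin_cases i
  · simp only [forcing, modeProfile, singleMode, transportPhase, List.map_nil, List.sum_nil, add_zero, Fin.zero_eta, Fin.isValue,
      Matrix.cons_val_zero, Pi.smul_apply, smul_eq_mul]
    rw [h1, Finset.mul_sum]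
    exact Finset.sum_congr rfl fun n _ => by ring
  · simp only [forcing, modeProfile, singleMode, transportPhase, List.map_nil, List.sum_nil, add_zero, Fin.mk_one, Fin.isValue,
      Matrix.cons_val_one, Matrix.cons_val_zero, Pi.smul_apply, smul_eq_mul]
    rw [h2, Finset.mul_sum]
    exact Finset.sum_congr rfl fun n _ => by ring

/-- **Linearity of the created amplitudes** over a finite mode profile (`a ≥ 1`). -/
theorem sheetAmps_modeProfile {a : ℝ} (ha : 1 ≤ a) (β θ : ℝ) (K : ℕ) (c : ℤ → ℂ) :
    sheetAmps a β θ ⟨modeProfile β K c, []⟩ = ∑ n ∈ win K, c n • sheetAmps a β θ (singleMode (β + n)) := by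
  have ha0 : 0 < a := by linarith
  unfold sheetAmps
  simp_rw [forcing_modeProfile ha0, Matrix.mulVec_sum, Matrix.mulVec_smul]
  have hint : ∀ n ∈ win K, IntervalIntegrable (fun s => c n • (propagator a β (θ - s)).mulVec (forcing a β (singleMode (β + n)) s))
      volume 0 θ := fun n _ => ((continuous_duhamelIntegrand_singleMode ha β (β + n) θ).intervalIntegrable (μ := volume) _ _).smul (c n)
  rw [intervalIntegral.integral_finsetSum hint]
  refine Finset.sum_congr rfl fun n _ => ?_
  exact intervalIntegral.integral_smul _ _

/-! ## §10 (v3, E6-b) Transport cannot create energy beyond enstrophy/a² (Parseval, tree `…KHTransportParseval`) -/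

/-- The triangle wave is continuous. -/
theorem continuous_triWave : Continuous triWave := by
  have h : triWave = (fun t : ℝ => 1 / 4 - |t - 1 / 2|) ∘ Int.fract ∘ (fun ξ : ℝ => ξ + 1 / 4) := by
    funext ξ; simp [triWave, Function.comp]
  rw [h]
  have hI : Continuous ((fun t : ℝ => 1 / 4 - |t - 1 / 2|) ∘ Int.fract) :=
    ContinuousOn.comp_fract'' (Continuous.continuousOn (by fun_prop)) (by norm_num)
  exact hI.comp (continuous_id.add continuous_const)

/-- The transport phase is continuous in `y` and unimodular. -/
theorem continuous_transportPhase (a θ : ℝ) : Continuous (transportPhase a θ) := by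
  unfold transportPhase
  have := continuous_triWave
  fun_prop

/-! ## §16 (copy) straight H-pair energy, evenness -/

/-- **Straight H-pair energy BY NAME (upper).** For a class `(α, β)` with `β ∈ [0,1]` and H-pair densities `q` vanishing on the zero line `α + m = 0`:
`cEnergy α β ℓ K (hPairState β q) ≤ (1/(4π²4^ℓ))·Σ_{|m| ≤ K} (‖q m 0‖² + ‖q m 1‖²)·(π/|α+m| + 4/(α+m)²)` (tree `vPair_column_energy_upper`, rows ↔ columns). -/
theorem cEnergy_hPairState_le {β : ℝ} (hβ0 : 0 ≤ β) (hβ1 : β ≤ 1) (α : ℝ) (ℓ K : ℕ) (q : ℤ → Fin 2 → ℂ)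
    (hq : ∀ m ∈ win K, α + (m : ℝ) = 0 → q m = 0) :
    cEnergy α β ℓ K (hPairState β q) ≤
      (1 / (4 * Real.pi ^ 2 * (4 : ℝ) ^ ℓ)) * ∑ m ∈ win K, (‖q m 0‖ ^ 2 + ‖q m 1‖ ^ 2) * (Real.pi / |α + m| + 4 / (α + m) ^ 2) := by
  unfold cEnergy
  rw [Finset.mul_sum]
  refine Finset.sum_le_sum fun m hm => ?_
  have e : ∀ (v : ℂ) (n : ℤ), ‖v‖ ^ 2 / (4 * Real.pi ^ 2 * (4 : ℝ) ^ ℓ * ((α + m) ^ 2 + (β + n) ^ 2)) =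
      (1 / (4 * Real.pi ^ 2 * (4 : ℝ) ^ ℓ)) * (‖v‖ ^ 2 / ((β + n) ^ 2 + (α + m) ^ 2)) := by
    intro v n
    rw [add_comm ((α + (m : ℝ)) ^ 2), mul_comm (4 * Real.pi ^ 2 * (4 : ℝ) ^ ℓ) ((β + (n : ℝ)) ^ 2 + (α + m) ^ 2), ← div_div,
      div_eq_mul_one_div, mul_comm]
  simp only [hPairState]
  simp_rw [e, ← Finset.mul_sum]
  refine mul_le_mul_of_nonneg_left ?_ (by positivity)
  rcases eq_or_ne (α + (m : ℝ)) 0 with hb | hb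
  · have h0 : q m = 0 := hq m hm hb
    simp [h0]
  · exact vPair_column_energy_upper hβ0 hβ1 hb K (q m 0) (q m 1)

/-- `c²` is even in the Bloch phase (tree `sawSigma0_neg_bloch`, `sawS_neg_bloch`). -/
theorem sawC2_neg_bloch (a β : ℝ) : sawC2 a (-β) = sawC2 a β := by
  unfold sawC2
  rw [sawSigma0_neg_bloch, sawS_neg_bloch, Complex.normSq_conj]

/-! ## §17 (v10) P2-S at general Bloch phase: `(a, β, ξ) ↦ (−a, −β, −ξ)` is complex conjugation — the creation law for NEGATIVE lines -/

/-- `conj (lineKernel a β y) = lineKernel a (−β) y`. -/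
theorem conj_lineKernel (a β y : ℝ) : starRingEnd ℂ (lineKernel a β y) = lineKernel a (-β) y := by
  have hz : starRingEnd ℂ (Complex.exp (2 * Real.pi * β * Complex.I)) = Complex.exp (2 * Real.pi * (((-β : ℝ)) : ℂ) * Complex.I) := by
    rw [← Complex.exp_conj]; congr 1
    simp only [map_mul, map_ofNat, Complex.conj_ofReal, Complex.conj_I]; push_cast; ring
  have hz' : starRingEnd ℂ (Complex.exp (2 * Real.pi * β * (⌊y⌋ : ℝ) * Complex.I)) = Complex.exp (2 * Real.pi * (((-β : ℝ)) : ℂ) * (⌊y⌋ : ℝ) * Complex.I) := by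
    rw [← Complex.exp_conj]; congr 1
    simp only [map_mul, map_ofNat, Complex.conj_ofReal, Complex.conj_I]; push_cast; ring
  simp only [lineKernel, map_mul, map_div₀, map_add, map_neg, map_sub, map_one, map_ofNat, Complex.conj_ofReal, hz, hz']

/-- `sawQ (−k) = (sawQ k)⁻¹`. -/
theorem sawQ_neg (k : ℝ) : sawQ (-k) = (sawQ k)⁻¹ := by
  simp only [sawQ, mul_neg, neg_neg, ← Real.exp_neg]

/-- `Σ₀` is even in the streamwise wavenumber (`k ≠ 0`). -/
theorem sawSigma0_neg_arg {k : ℝ} (hk : k ≠ 0) (β : ℝ) : sawSigma0 (-k) β = sawSigma0 k β := by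
  have hq : 0 < sawQ k := Real.exp_pos _
  have hq1 : sawQ k ≠ 1 := by
    simp only [sawQ]; rw [Ne, Real.exp_eq_one_iff]; intro h; apply hk; nlinarith [Real.pi_pos]
  have hc : Real.cos (2 * Real.pi * β) ≤ 1 := Real.cos_le_one _
  have hc' : -1 ≤ Real.cos (2 * Real.pi * β) := Real.neg_one_le_cos _
  have hden : 1 - 2 * sawQ k * Real.cos (2 * Real.pi * β) + sawQ k ^ 2 ≠ 0 := by
    intro h
    have h1 : (1 - sawQ k) ^ 2 ≤ 1 - 2 * sawQ k * Real.cos (2 * Real.pi * β) + sawQ k ^ 2 := by nlinarith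
    have h2 : (1 - sawQ k) ^ 2 = 0 := le_antisymm (by rw [← h]; exact h1) (sq_nonneg _)
    exact hq1 (by nlinarith [pow_eq_zero_iff (n := 2) (two_ne_zero) |>.1 h2])
  unfold sawSigma0
  rw [sawQ_neg]
  field_simp
  ring

/-- `S` is even in the streamwise wavenumber (`k ≠ 0`). -/
theorem sawS_neg_arg {k : ℝ} (hk : k ≠ 0) (β : ℝ) : sawS (-k) β = sawS k β := by
  have hq : 0 < sawQ k := Real.exp_pos _
  have hq1 : sawQ k ≠ 1 := by
    simp only [sawQ]; rw [Ne, Real.exp_eq_one_iff]; intro h; apply hk; nlinarith [Real.pi_pos]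
  set z : ℂ := Complex.exp (((2 * Real.pi * β : ℝ) : ℂ) * Complex.I) with hz
  set Q : ℂ := ((sawQ k : ℝ) : ℂ) with hQ
  have hzn : ‖z‖ = 1 := by rw [hz, Complex.norm_exp_ofReal_mul_I]
  have hz0 : z ≠ 0 := by intro h; rw [h, norm_zero] at hzn; exact zero_ne_one hzn
  have hzz : z * starRingEnd ℂ z = 1 := by
    rw [Complex.mul_conj, Complex.normSq_eq_norm_sq, hzn]; norm_num
  have hzbar : starRingEnd ℂ z = z⁻¹ := by
    have := congrArg (fun w => z⁻¹ * w) hzz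
    simp only [← mul_assoc, inv_mul_cancel₀ hz0, one_mul, mul_one] at this
    exact this
  have hQ0 : Q ≠ 0 := by rw [hQ]; exact_mod_cast hq.ne'
  have hQn : ‖Q‖ = sawQ k := by rw [hQ, Complex.norm_real, Real.norm_eq_abs, abs_of_pos hq]
  -- the two non-resonance facts `z ≠ Q`, `zQ ≠ 1`
  have F2 : Q - z ≠ 0 := by
    intro h
    have : ‖Q‖ = ‖z‖ := by rw [sub_eq_zero.1 h]
    rw [hQn, hzn] at this
    exact hq1 this
  have F1 : 1 - z * Q ≠ 0 := by
    intro h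
    have : ‖z * Q‖ = 1 := by rw [← sub_eq_zero.1 h]; exact norm_one
    rw [norm_mul, hzn, hQn, one_mul] at this
    exact hq1 this
  have F3 : Q - z⁻¹ ≠ 0 := by
    intro h
    have h' : z * Q = 1 := by
      have := congrArg (fun w => z * w) (sub_eq_zero.1 h)
      simpa [mul_inv_cancel₀ hz0] using this
    exact F1 (by rw [h']; ring)
  have F4 : z - Q ≠ 0 := by intro h; exact F2 (by rw [← neg_sub, h, neg_zero])
  have F1' : 1 - Q * z ≠ 0 := by rwa [mul_comm] at F1
  have F1'' : -1 + Q * z ≠ 0 := by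
    intro h; apply F1'; linear_combination -h
  have F5 : Q * z - 1 ≠ 0 := by
    intro h; apply F1'; linear_combination -h
  have hk' : (k : ℂ) ≠ 0 := by exact_mod_cast hk
  -- rewrite everything in terms of `z`, `z⁻¹`, `Q`, `Q⁻¹`
  have hexp : ((Real.exp (-(-k * Real.pi)) / (2 * -k) : ℝ) : ℂ) = -(((Real.exp (-(k * Real.pi)) / (2 * k) : ℝ) : ℂ) * Q⁻¹ * Q⁻¹ * Q) := by
    have e1 : Real.exp (-(-k * Real.pi)) = Real.exp (-(k * Real.pi)) * ((sawQ k)⁻¹) := by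
      rw [sawQ, ← Real.exp_neg, ← Real.exp_add]; congr 1; ring
    rw [e1, hQ]; push_cast; field_simp
  simp only [sawS, sawQ_neg]
  rw [← hz, hzbar, hexp]
  push_cast
  rw [← hQ]
  field_simp
  ring


/-- `c²` is even in the streamwise wavenumber (`a ≠ 0`). -/
theorem sawC2_neg_arg {a : ℝ} (ha : a ≠ 0) (β : ℝ) : sawC2 (-a) β = sawC2 a β := by
  unfold sawC2
  rw [sawSigma0_neg_arg ha, sawS_neg_arg ha]

/-- `λ(−a, −β) = λ(a, β)` (`a ≠ 0`). -/
theorem khLam_neg_neg {a : ℝ} (ha : a ≠ 0) (β : ℝ) : khLam (-a) (-β) = khLam a β := by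
  unfold khLam
  rw [sawC2_neg_bloch, sawC2_neg_arg ha, neg_sq]

/-- The propagator scalars at `(−a, −β)`. -/
theorem propC_neg_neg {a : ℝ} (ha : a ≠ 0) (β t : ℝ) : propC (-a) (-β) t = propC a β t := by
  simp only [propC, khLam_neg_neg ha]

/-- The propagator scalars at `(−a, −β)`. -/
theorem propSn_neg_neg {a : ℝ} (ha : a ≠ 0) (β t : ℝ) : propSn (-a) (-β) t = propSn a β t := by
  simp only [propSn, khLam_neg_neg ha]

/-- The block at `(−a, −β)` is the entrywise conjugate of the block at `(a, β)`. -/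
theorem blockX_neg_neg (a β : ℝ) (i j : Fin 2) : blockX (-a) (-β) i j = starRingEnd ℂ (blockX a β i j) := by
  obtain ⟨e00, e01, e10, e11⟩ := blockX_apply (-a) (-β)
  obtain ⟨f00, f01, f10, f11⟩ := blockX_apply a β
  have hG : lineKernel a (-β) 0 = starRingEnd ℂ (lineKernel a β 0) := (conj_lineKernel a β 0).symm
  have hH : lineKernel a (-β) (1 / 2) = starRingEnd ℂ (lineKernel a β (1 / 2)) := (conj_lineKernel a β (1 / 2)).symm
  fin_cases i <;> fin_cases j
  · simp only [Fin.zero_eta, Fin.isValue, e00, f00, lineKernel_neg, hG, map_mul, map_sub, map_neg, map_div₀, map_one, map_ofNat,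
      Complex.conj_ofReal, Complex.conj_I]
    push_cast; ring
  · simp only [Fin.zero_eta, Fin.mk_one, Fin.isValue, e01, f01, lineKernel_neg, hH, map_mul, map_neg, map_ofNat, Complex.conj_ofReal,
      Complex.conj_I]
    push_cast; ring
  · simp only [Fin.zero_eta, Fin.mk_one, Fin.isValue, e10, f10, lineKernel_neg, hH, map_mul, map_ofNat, Complex.conj_ofReal, Complex.conj_I,
      Complex.conj_conj]
    push_cast; ring
  · simp only [Fin.mk_one, Fin.isValue, e11, f11, lineKernel_neg, hG, map_mul, map_add, map_div₀, map_one, map_ofNat, Complex.conj_ofReal,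
      Complex.conj_I]
    push_cast; ring

/-- The propagator at `(−a, −β)` is the entrywise conjugate (`a ≠ 0`). -/
theorem propagator_neg_neg {a : ℝ} (ha : a ≠ 0) (β t : ℝ) (i j : Fin 2) :
    propagator (-a) (-β) t i j = starRingEnd ℂ (propagator a β t i j) := by
  simp only [propagator, Matrix.add_apply, Matrix.smul_apply, smul_eq_mul, propC_neg_neg ha, propSn_neg_neg ha, map_add, map_mul,
    Complex.conj_ofReal, blockX_neg_neg]
  congr 2
  fin_cases i <;> fin_cases j <;> simp

/-- The transport phase at `−a` is the conjugate (any strain time). -/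
theorem transportPhase_neg' (a s y : ℝ) : transportPhase (-a) s y = starRingEnd ℂ (transportPhase a s y) := transportPhase_neg a s y

/-- **The forcing of a CONJUGATED interior at `(−a, −β)` is the conjugate of the forcing** (no sheets). -/
theorem forcing_neg_neg_nosheet (a β : ℝ) (g : ℝ → ℂ) (s : ℝ) (j : Fin 2) :
    forcing (-a) (-β) ⟨fun y => starRingEnd ℂ (g y), []⟩ s j = starRingEnd ℂ (forcing a β ⟨g, []⟩ s j) := by
  have hsrc : ∀ y₀ : ℝ, (∫ y in (-(1 / 2 : ℝ))..(1 / 2), lineKernel (-a) (-β) (y₀ - y) * starRingEnd ℂ (g y) * transportPhase (-a) s y) =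
      starRingEnd ℂ (∫ y in (-(1 / 2 : ℝ))..(1 / 2), lineKernel a β (y₀ - y) * g y * transportPhase a s y) := by
    intro y₀
    rw [← intervalIntegral.intervalIntegral_conj]
    refine intervalIntegral.integral_congr fun y _ => ?_
    simp only [map_mul, conj_lineKernel, lineKernel_neg, transportPhase_neg']
  fin_cases j
  · simp only [forcing, List.map_nil, List.sum_nil, add_zero, Fin.zero_eta, Fin.isValue, Matrix.cons_val_zero, hsrc, map_mul, map_neg,
      map_ofNat, Complex.conj_ofReal, Complex.conj_I]
    push_cast; ring
  · simp only [forcing, List.map_nil, List.sum_nil, add_zero, Fin.mk_one, Fin.isValue, Matrix.cons_val_one, Matrix.cons_val_zero, hsrc, map_mul,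
      map_ofNat, Complex.conj_ofReal, Complex.conj_I]
    push_cast; ring

/-- The Duhamel integrand at `(−a, −β)` with conjugated interior is the componentwise conjugate (`a ≠ 0`). -/
theorem duhamelIntegrand_neg_neg_nosheet {a : ℝ} (ha : a ≠ 0) (β θ s : ℝ) (g : ℝ → ℂ) :
    (propagator (-a) (-β) (θ - s)).mulVec (forcing (-a) (-β) ⟨fun y => starRingEnd ℂ (g y), []⟩ s) =
      star ((propagator a β (θ - s)).mulVec (forcing a β ⟨g, []⟩ s)) := by
  funext i
  simp only [Matrix.mulVec, dotProduct, Fin.sum_univ_two, Pi.star_apply, propagator_neg_neg ha, forcing_neg_neg_nosheet, star_add, star_mul',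
    Complex.star_def]

/-- The conjugate of a mode profile is the mode profile of the reflected class with reflected, conjugated coefficients. -/
theorem conj_modeProfile (β : ℝ) (K : ℕ) (c : ℤ → ℂ) (y : ℝ) :
    starRingEnd ℂ (modeProfile β K c y) = modeProfile (-β) K (fun n => starRingEnd ℂ (c (-n))) y := by
  simp only [modeProfile, map_sum, map_mul]
  refine Finset.sum_nbij' (fun n => -n) (fun n => -n) (fun n hn => by simp only [win, Finset.mem_Icc] at hn ⊢; omega) (fun n hn => by simp only [win, Finset.mem_Icc] at hn ⊢; omega)
    (fun n _ => neg_neg n) (fun n _ => neg_neg n) (fun n _ => ?_)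
  rw [neg_neg, ← Complex.exp_conj, map_mul, Complex.conj_ofReal, Complex.conj_I]
  congr 1
  push_cast
  ring

/-- **P2-S for profile states (any Bloch phase):** `sheetAmps (−a) (−β) θ ⟨modeProfile (−β) K c̃, []⟩ i = conj (sheetAmps a β θ ⟨modeProfile β K c, []⟩ i)`
with `c̃ n = conj (c (−n))` (`a ≥ 1`). -/
theorem sheetAmps_neg_neg_modeProfile {a : ℝ} (ha : 1 ≤ a) (β θ : ℝ) (K : ℕ) (c : ℤ → ℂ) (i : Fin 2) :
    sheetAmps (-a) (-β) θ ⟨modeProfile (-β) K (fun n => starRingEnd ℂ (c (-n))), []⟩ i =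
      starRingEnd ℂ (sheetAmps a β θ ⟨modeProfile β K c, []⟩ i) := by
  have ha0 : a ≠ 0 := by linarith
  -- the integrand at `(a, β)` is a finite sum of single-mode integrands, hence continuous
  have hF : Continuous fun s : ℝ => (propagator a β (θ - s)).mulVec (forcing a β ⟨modeProfile β K c, []⟩ s) := by
    have e : (fun s : ℝ => (propagator a β (θ - s)).mulVec (forcing a β ⟨modeProfile β K c, []⟩ s)) =
        fun s : ℝ => ∑ n ∈ win K, c n • (propagator a β (θ - s)).mulVec (forcing a β (singleMode (β + n)) s) := by
      funext s
      rw [forcing_modeProfile (by linarith : (0 : ℝ) < a) β s K c, Matrix.mulVec_sum]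
      refine Finset.sum_congr rfl fun n _ => ?_
      rw [Matrix.mulVec_smul]
    rw [e]
    exact continuous_finsetSum _ fun n _ => (continuous_duhamelIntegrand_singleMode ha β (β + n) θ).const_smul (c n)
  -- the interior at `(−a, −β)` is the conjugated interior
  have hint_eq : (⟨modeProfile (-β) K (fun n => starRingEnd ℂ (c (-n))), []⟩ : LamState) = ⟨fun y => starRingEnd ℂ (modeProfile β K c y), []⟩ := by
    congr 1
    funext y
    rw [conj_modeProfile]
  rw [hint_eq]
  have e : (fun s : ℝ => (propagator (-a) (-β) (θ - s)).mulVec (forcing (-a) (-β) ⟨fun y => starRingEnd ℂ (modeProfile β K c y), []⟩ s)) =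
      fun s : ℝ => star ((propagator a β (θ - s)).mulVec (forcing a β ⟨modeProfile β K c, []⟩ s)) :=
    funext fun s => duhamelIntegrand_neg_neg_nosheet ha0 β θ s (modeProfile β K c)
  have hF' : Continuous fun s : ℝ => (propagator (-a) (-β) (θ - s)).mulVec (forcing (-a) (-β) ⟨fun y => starRingEnd ℂ (modeProfile β K c y), []⟩ s) := by
    rw [e]; exact continuous_star.comp hF
  have hint := hF.intervalIntegrable (μ := volume) 0 θ
  have hint' := hF'.intervalIntegrable (μ := volume) 0 θ
  have h1 := ((ContinuousLinearMap.proj (R := ℂ) (φ := fun _ : Fin 2 => ℂ) i).intervalIntegral_comp_comm hint).symm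
  have h2 := ((ContinuousLinearMap.proj (R := ℂ) (φ := fun _ : Fin 2 => ℂ) i).intervalIntegral_comp_comm hint').symm
  simp only [ContinuousLinearMap.proj_apply] at h1 h2
  unfold sheetAmps
  rw [h1, h2, ← intervalIntegral.intervalIntegral_conj]
  refine intervalIntegral.integral_congr fun s _ => ?_
  have := congrFun (duhamelIntegrand_neg_neg_nosheet ha0 β θ s (modeProfile β K c)) i
  simp only [Pi.star_apply, Complex.star_def] at this
  exact this

/-! ## §15 (copy) the V slot's transport in energy form -/

/-- One column of `vTransport`, inside the window, is the transport coefficient of the column profile. -/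
theorem vTransport_apply_of_mem (α β θ : ℝ) (K : ℕ) (ζ : CState) {m' n : ℤ} (hm' : m' ∈ win K) (hn : n ∈ win K) :
    vTransport α β θ K ζ m' n = ∫ x in (-(1 / 2 : ℝ))..(1 / 2),
      ((∑ m ∈ win K, ζ m n * Complex.exp ((2 * Real.pi * (α + m) * x : ℝ) * Complex.I)) *
        Complex.exp (-((2 * Real.pi * (β + n) * θ * triWave x : ℝ) : ℂ) * Complex.I)) * Complex.exp (-(2 * Real.pi * (α + m') * x : ℝ) * Complex.I) := by
  simp only [vTransport, if_pos (And.intro hm' hn), coeff, modeProfile, transportPhase, List.map_nil, List.sum_nil, add_zero]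


/-- The energy-form transport bound for ONE column of `vTransport` (line `β + n`, any value incl. `0`). -/
theorem vTransport_column_energy_le (α β θ : ℝ) (ℓ K : ℕ) (ζ : CState) {n : ℤ} (hn : n ∈ win K) :
    ∑ m' ∈ win K, ‖vTransport α β θ K ζ m' n‖ ^ 2 / (4 * Real.pi ^ 2 * (4 : ℝ) ^ ℓ * ((α + m') ^ 2 + (β + n) ^ 2)) ≤
      (θ ^ 2 + 2) * ∑ m ∈ win K, ‖ζ m n‖ ^ 2 / (4 * Real.pi ^ 2 * (4 : ℝ) ^ ℓ * ((α + m) ^ 2 + (β + n) ^ 2)) := by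
  have hc : (0 : ℝ) < 4 * Real.pi ^ 2 * (4 : ℝ) ^ ℓ := by positivity
  have e : ∀ (v : ℂ) (m : ℤ), ‖v‖ ^ 2 / (4 * Real.pi ^ 2 * (4 : ℝ) ^ ℓ * ((α + m) ^ 2 + (β + n) ^ 2)) =
      (1 / (4 * Real.pi ^ 2 * (4 : ℝ) ^ ℓ)) * (‖v‖ ^ 2 / ((α + m) ^ 2 + (β + n) ^ 2)) := by
    intro v m
    rw [mul_comm (4 * Real.pi ^ 2 * (4 : ℝ) ^ ℓ) ((α + (m : ℝ)) ^ 2 + (β + n) ^ 2), ← div_div, div_eq_mul_one_div, mul_comm]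
  simp_rw [e, ← Finset.mul_sum]
  rw [mul_left_comm]
  refine mul_le_mul_of_nonneg_left ?_ (by positivity)
  rcases eq_or_ne (β + (n : ℝ)) 0 with hb | hb
  · -- the untransported column `β + n = 0`
    have hid : ∀ m' ∈ win K, vTransport α β θ K ζ m' n = ζ m' n := by
      intro m' hm'
      rw [vTransport_apply_of_mem α β θ K ζ hm' hn]
      have h1 : ∀ x : ℝ, Complex.exp (-((2 * Real.pi * (β + n) * θ * triWave x : ℝ) : ℂ) * Complex.I) = 1 := by
        intro x; rw [hb]; simp
      simp_rw [h1, mul_one]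
      rw [integral_blochPoly_mul_conjExp, if_pos hm']
    rw [Finset.sum_congr rfl fun m' hm' => by rw [hid m' hm']]
    have h0 : 0 ≤ ∑ m ∈ win K, ‖ζ m n‖ ^ 2 / ((α + m) ^ 2 + (β + n) ^ 2) := Finset.sum_nonneg fun _ _ => by positivity
    nlinarith [sq_nonneg θ]
  · rw [Finset.sum_congr rfl fun m' hm' => by rw [vTransport_apply_of_mem α β θ K ζ hm' hn]]
    exact transport_energy_duality α θ hb (win K) (win K) (fun m => ζ m n)

/-- **L-i-b BY NAME (V slot).** For every class `(α, β)`, strain `θ`, level `ℓ`, window `K` and lattice state `ζ`: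
`cEnergy α β ℓ K (vTransport α β θ K ζ) ≤ (θ² + 2)·cEnergy α β ℓ K ζ`. -/
theorem cEnergy_vTransport_le (α β θ : ℝ) (ℓ K : ℕ) (ζ : CState) :
    cEnergy α β ℓ K (vTransport α β θ K ζ) ≤ (θ ^ 2 + 2) * cEnergy α β ℓ K ζ := by
  unfold cEnergy
  rw [Finset.sum_comm]
  conv_rhs => rw [Finset.sum_comm]
  rw [Finset.mul_sum]
  exact Finset.sum_le_sum fun n hn => vTransport_column_energy_le α β θ ℓ K ζ hn

/-! ## §13/§14/§18 (copies) transport locality, V-input energy, child bookkeeping -/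

/-- Integers `n` with `|β + n| ≤ R` inside any finset number at most `2R + 1`. -/
theorem card_filter_abs_le (β : ℝ) {R : ℝ} (hR : 0 ≤ R) (S : Finset ℤ) :
    (((S.filter fun n : ℤ => |β + n| ≤ R).card : ℕ) : ℝ) ≤ 2 * R + 1 := by
  set T := S.filter fun n : ℤ => |β + n| ≤ R with hT
  have hsub : T ⊆ Finset.Icc ⌈-β - R⌉ ⌊-β + R⌋ := by
    intro n hn
    rw [hT, Finset.mem_filter] at hn
    obtain ⟨h1, h2⟩ := abs_le.1 hn.2
    rw [Finset.mem_Icc]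
    constructor
    · exact Int.ceil_le.2 (by linarith)
    · exact Int.le_floor.2 (by linarith)
  have hcard := Finset.card_le_card hsub
  rw [Int.card_Icc] at hcard
  have h1 : ((T.card : ℕ) : ℝ) ≤ (((⌊-β + R⌋ + 1 - ⌈-β - R⌉).toNat : ℕ) : ℝ) := by exact_mod_cast hcard
  refine h1.trans ?_
  have h2 : ((⌊-β + R⌋ + 1 - ⌈-β - R⌉ : ℤ) : ℝ) ≤ 2 * R + 1 := by
    have hf : ((⌊-β + R⌋ : ℤ) : ℝ) ≤ -β + R := Int.floor_le _
    have hc : -β - R ≤ ((⌈-β - R⌉ : ℤ) : ℝ) := Int.le_ceil _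
    push_cast; linarith
  rcases le_or_gt 0 (⌊-β + R⌋ + 1 - ⌈-β - R⌉) with h | h
  · rw [show (((⌊-β + R⌋ + 1 - ⌈-β - R⌉).toNat : ℕ) : ℝ) = ((⌊-β + R⌋ + 1 - ⌈-β - R⌉ : ℤ) : ℝ) by
      rw [← Int.toNat_of_nonneg h]; push_cast; rw [Int.toNat_of_nonneg h]]
    exact h2
  · rw [Int.toNat_eq_zero.2 h.le]; push_cast; linarith


/-! ## §13 (v6, E6-b locality) p4's `hTransport` entries in closed form: the transported profile's coefficients are `Σ_n c_n τ(a,θ; β+n → β+n′)`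
with `|τ| ≤ min(1, 4/|Λ₊| + 2/|Λ₋|)`, `Λ± = 2π(n − n′ ± aθ)` (tree `…KHTransportCoeff`) -/

/-! ## §14 (v7) L-i-c BY NAME: the windowed input energy of a V source in `Transfer` (tree `…KHStraightPairEnergy`, p707331) -/

/-- The level-0 windowed energy of the V-source input state, spelled out (the window truncation is invisible inside `cEnergy`'s window sums). -/
theorem cEnergy_inputState_V (α β θ : ℝ) (K : ℕ) (d : ℤ → Fin 2 → ℂ) :
    cEnergy α β 0 K (inputState α β θ K PType.V d) = ∑ m ∈ win K, ∑ n ∈ win K,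
      ‖d n 0 * Complex.exp (-(Real.pi * (α + m) / 2 : ℝ) * Complex.I) + d n 1 * Complex.exp ((Real.pi * (α + m) / 2 : ℝ) * Complex.I)‖ ^ 2 /
        (4 * Real.pi ^ 2 * ((α + m) ^ 2 + (β + n) ^ 2)) := by
  unfold cEnergy
  refine Finset.sum_congr rfl fun m hm => Finset.sum_congr rfl fun n hn => ?_
  simp only [inputState, truncW, vPairState, if_pos (And.intro hm hn), pow_zero, mul_one]

/-- **L-i-c BY NAME** (E6 far-row schema, piece (i), A27-7): for a class `(α, β)` with `α ∈ [0,1]`, every strain `θ`, truncation `K` and V-pair densities `d`,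
`cEnergy α β 0 K (inputState α β θ K V d) ≥ (1/4π²)·Σ_{|n| ≤ K} (‖d n 0‖² + ‖d n 1‖²)·(π/|β+n| − 2/(K+1) − 4/(β+n)²)`: every source column in shell `s`
(`|β+n| ≥ 2^{s−1}`) inside the window carries at least `1 − (2/π)2^{s−1}/(K+1) − 8/(π2^s)` of its full-lattice energy `(‖d n 0‖²+‖d n 1‖²)/(4π|β+n|)` —
the denominator of every far entry `M[(t′,s′) ← (V,s)]`. -/
theorem cEnergy_inputState_V_lower {α : ℝ} (hα0 : 0 ≤ α) (hα1 : α ≤ 1) (β θ : ℝ) (K : ℕ) (d : ℤ → Fin 2 → ℂ) :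
    (∑ n ∈ win K, (‖d n 0‖ ^ 2 + ‖d n 1‖ ^ 2) * (Real.pi / |β + n| - 2 / (K + 1) - 4 / (β + n) ^ 2)) / (4 * Real.pi ^ 2) ≤
      cEnergy α β 0 K (inputState α β θ K PType.V d) := by
  rw [cEnergy_inputState_V]
  exact vPair_window_energy_lower hα0 hα1 β K d

/-- **The input energy of a V source supported in shell `s ≥ 2` (uniform form):** if `d` vanishes off shell `s` (`|β+n| ∈ [2^{s−1}, 2^s)`), then
`cEnergy α β 0 K (inputState α β θ K V d) ≥ (1/4π²)·(π/2^s − 2/(K+1) − 4/4^{s−1})·Σ_{|n| ≤ K} (‖d n 0‖² + ‖d n 1‖²)`. -/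
theorem cEnergy_inputState_V_shell_lower {α : ℝ} (hα0 : 0 ≤ α) (hα1 : α ≤ 1) (β θ : ℝ) (K : ℕ) {s : ℕ} (hs : 2 ≤ s) (d : ℤ → Fin 2 → ℂ)
    (hd : SupportedIn s β d) :
    (Real.pi / 2 ^ s - 2 / (K + 1) - 4 / 4 ^ (s - 1)) * (∑ n ∈ win K, (‖d n 0‖ ^ 2 + ‖d n 1‖ ^ 2)) / (4 * Real.pi ^ 2) ≤
      cEnergy α β 0 K (inputState α β θ K PType.V d) := by
  refine le_trans ?_ (cEnergy_inputState_V_lower hα0 hα1 β θ K d)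
  refine div_le_div_of_nonneg_right ?_ (by positivity)
  rw [Finset.mul_sum]
  refine Finset.sum_le_sum fun n _ => ?_
  by_cases hin : InShell s (β + (n : ℝ))
  · obtain ⟨k, rfl⟩ : ∃ k, s = k + 2 := ⟨s - 2, by omega⟩
    have hlo : (2 : ℝ) ^ (k + 1) ≤ |β + n| := hin.1
    have hhi : |β + n| < (2 : ℝ) ^ (k + 2) := hin.2
    have hpos : (0 : ℝ) < 2 ^ (k + 1) := by positivity
    have hb0 : 0 < |β + n| := hpos.trans_le hlo
    rw [mul_comm]
    refine mul_le_mul_of_nonneg_left ?_ (by positivity)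
    have e1 : Real.pi / 2 ^ (k + 2) ≤ Real.pi / |β + n| := div_le_div_of_nonneg_left Real.pi_pos.le hb0 hhi.le
    have e2 : 4 / (β + (n : ℝ)) ^ 2 ≤ 4 / 4 ^ (k + 2 - 1) := by
      rw [show k + 2 - 1 = k + 1 by omega, ← sq_abs]
      refine div_le_div_of_nonneg_left (by norm_num) (by positivity) ?_
      calc (4 : ℝ) ^ (k + 1) = (2 ^ (k + 1)) ^ 2 := by rw [← pow_mul, show (4 : ℝ) = 2 ^ 2 by norm_num, ← pow_mul]; ring_nf
        _ ≤ |β + n| ^ 2 := pow_le_pow_left₀ hpos.le hlo 2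
    linarith
  · have h0 : d n = 0 := hd n hin
    simp [h0]

/-- The child of the V-source input state, entrywise. -/
theorem norm_child_inputState_V_le (α β θ : ℝ) (K : ℕ) (d : ℤ → Fin 2 → ℂ) (pm pn m n : ℤ) :
    ‖child pm pn (inputState α β θ K PType.V d) m n‖ ≤ ‖d (2 * n + pn) 0‖ + ‖d (2 * n + pn) 1‖ := by
  simp only [child, inputState, truncW, vPairState]
  split_ifs with h
  · refine (norm_add_le _ _).trans (le_of_eq ?_)
    rw [norm_mul, norm_mul, Complex.norm_exp_ofReal_mul_I, mul_one,
      show -((Real.pi * (α + ((2 * m + pm : ℤ) : ℝ)) / 2 : ℝ) : ℂ) * Complex.I = ((-(Real.pi * (α + ((2 * m + pm : ℤ) : ℝ)) / 2) : ℝ) : ℂ) * Complex.I by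
        push_cast; ring, Complex.norm_exp_ofReal_mul_I, mul_one]
  · simp only [norm_zero]; positivity

/-- Counting the rows of a shell inside any finite set: at most `2·2^{s} + 1`. -/
theorem card_filter_inShell_le (c : ℝ) (s : ℕ) (hs : 2 ≤ s) (S : Finset ℤ) :
    (((S.filter fun m : ℤ => shellLo s ≤ |c + (m : ℝ)| ∧ |c + (m : ℝ)| < shellHi s).card : ℕ) : ℝ) ≤ 2 * 2 ^ s + 1 := by
  have hsub : (S.filter fun m : ℤ => shellLo s ≤ |c + (m : ℝ)| ∧ |c + (m : ℝ)| < shellHi s) ⊆ S.filter fun m : ℤ => |c + m| ≤ (2 : ℝ) ^ s := by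
    intro m hm
    rw [Finset.mem_filter] at hm ⊢
    refine ⟨hm.1, ?_⟩
    have h2 := hm.2.2
    obtain ⟨k, rfl⟩ : ∃ k, s = k + 2 := ⟨s - 2, by omega⟩
    simp only [shellHi, shellLo] at h2
    rw [show k + 2 = (k + 1) + 1 by ring]
    exact h2.le
  calc (((S.filter fun m : ℤ => shellLo s ≤ |c + (m : ℝ)| ∧ |c + (m : ℝ)| < shellHi s).card : ℕ) : ℝ)
      ≤ (((S.filter fun m : ℤ => |c + m| ≤ (2 : ℝ) ^ s).card : ℕ) : ℝ) := by exact_mod_cast Finset.card_le_card hsub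
    _ ≤ 2 * 2 ^ s + 1 := card_filter_abs_le c (by positivity) S

/-- The input-energy coefficient from shell 3 on: `1/(2·2^s) ≤ π/2^s − 2/(K+1) − 4/4^{s−1}` for `s ≥ 3`, `K + 1 ≥ 2^{s+2}`. -/
theorem input_coef_lower3 {s : ℕ} (hs : 3 ≤ s) {K : ℕ} (hK : (2 : ℝ) ^ (s + 2) ≤ K + 1) :
    1 / (2 * (2 : ℝ) ^ s) ≤ Real.pi / 2 ^ s - 2 / ((K : ℝ) + 1) - 4 / 4 ^ (s - 1) := by
  set X : ℝ := (2 : ℝ) ^ s with hX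
  have hX8 : 8 ≤ X := by
    rw [hX]; calc (8 : ℝ) = 2 ^ 3 := by norm_num
      _ ≤ 2 ^ s := pow_le_pow_right₀ (by norm_num) hs
  have hXpos : 0 < X := by linarith
  have h4 : (4 : ℝ) / 4 ^ (s - 1) = 16 / X ^ 2 := by
    obtain ⟨j, rfl⟩ : ∃ j, s = j + 1 := ⟨s - 1, by omega⟩
    rw [show j + 1 - 1 = j by omega]
    have h' : (4 : ℝ) ^ j * 4 = X ^ 2 := by
      rw [hX, ← pow_succ, ← pow_mul, show (4 : ℝ) = 2 ^ 2 by norm_num, ← pow_mul]; ring_nf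
    rw [← h']
    field_simp
    ring
  have hK' : 2 / ((K : ℝ) + 1) ≤ 1 / (2 * X) := by
    rw [div_le_div_iff₀ (by positivity) (by positivity)]
    have : (2 : ℝ) ^ (s + 2) = 4 * X := by rw [hX, pow_add]; ring
    nlinarith
  have hx16 : 16 / X ^ 2 ≤ (Real.pi - 1) / X := by
    rw [div_le_div_iff₀ (by positivity) hXpos]
    have hπ := Real.pi_gt_three
    nlinarith
  have e1 : (Real.pi - 1) / X = Real.pi / X - 1 / (2 * X) - 1 / (2 * X) := by ring
  rw [h4]
  linarith


/-! ## §20 (copies from `K2TruncationRK.lean`) windows, tails, (F1)/(F3) -/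

/-- `shellHi s ≤ 2^s`. -/
theorem shellHi_le_two_pow (s : ℕ) : shellHi s ≤ (2 : ℝ) ^ s := by
  cases s with
  | zero => simp only [shellHi, shellLo]; norm_num
  | succ k => simp only [shellHi, shellLo]; rw [pow_succ]

/-- A density supported in shell `s` (class coordinate `c ∈ [0,1)`) vanishes at every `k` with `|k| ≥ 2^s + 1`. -/
theorem supportedIn_apply_eq_zero {s : ℕ} {c : ℝ} (hc0 : 0 ≤ c) (hc1 : c < 1) {d : ℤ → Fin 2 → ℂ} (hd : SupportedIn s c d) {k : ℤ}
    (hk : (2 : ℝ) ^ s + 1 ≤ |(k : ℝ)|) : d k = 0 := by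
  refine hd k fun h => ?_
  have h2 := h.2
  have hs := shellHi_le_two_pow s
  have : |(k : ℝ)| ≤ |c + k| + |c| := by
    have h := abs_add_le (c + k) (-c)
    rw [abs_neg, show c + (k : ℝ) + -c = k by ring] at h
    exact h
  rw [abs_of_nonneg hc0] at this
  linarith

/-- Membership in the window, unfolded. -/
theorem mem_win {K : ℕ} {x : ℤ} : x ∈ win K ↔ -(K : ℤ) ≤ x ∧ x ≤ K := by
  simp only [win, Finset.mem_Icc]

/-- **(F3)** The windowed input energy of a V source is monotone in the window. -/
theorem cEnergy_inputState_V_mono (α β θ : ℝ) {K₀ K : ℕ} (hK : K₀ ≤ K) (d : ℤ → Fin 2 → ℂ) :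
    cEnergy α β 0 K₀ (inputState α β θ K₀ PType.V d) ≤ cEnergy α β 0 K (inputState α β θ K PType.V d) := by
  rw [cEnergy_inputState_V, cEnergy_inputState_V]
  have hsub : win K₀ ⊆ win K := by
    intro x hx; rw [mem_win] at hx ⊢; omega
  refine (Finset.sum_le_sum_of_subset_of_nonneg hsub fun m _ _ => Finset.sum_nonneg fun n _ => by positivity).trans ?_
  exact Finset.sum_le_sum fun m _ => Finset.sum_le_sum_of_subset_of_nonneg hsub fun n _ _ => by positivity

/-- **(F1), profile level.** The row profile of a child of the V-source input state does not depend on the truncation once the window contains the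
source shell (`2^s + 1 ≤ K₀ ≤ K`) and the row (`2m + pm ∈ win K₀`). -/
theorem modeProfile_child_inputState_V_eq {α β θ : ℝ} (hβ0 : 0 ≤ β) (hβ1 : β < 1) {s : ℕ} {d : ℤ → Fin 2 → ℂ} (hd : SupportedIn s β d)
    {K₀ K : ℕ} (hK₀ : 2 ^ s + 1 ≤ K₀) (hK : K₀ ≤ K) {pm pn : ℤ} (hpn : pn ∈ parities) {m : ℤ} (hm : 2 * m + pm ∈ win K₀) :
    modeProfile ((β + pn) / 2) K (child pm pn (inputState α β θ K PType.V d) m) =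
      modeProfile ((β + pn) / 2) K₀ (child pm pn (inputState α β θ K₀ PType.V d) m) := by
  have hsub : win K₀ ⊆ win K := by
    intro x hx; rw [mem_win] at hx ⊢; omega
  have hpn' : pn = 0 ∨ pn = 1 := by simpa [parities] using hpn
  have hK₀r : (2 : ℝ) ^ s + 1 ≤ (K₀ : ℝ) := by exact_mod_cast hK₀
  -- a column index outside the small window carries no density
  have hzero : ∀ n : ℤ, n ∉ win K₀ → d (2 * n + pn) = 0 := by
    intro n hn
    rw [mem_win, not_and_or, not_le, not_le] at hn
    apply supportedIn_apply_eq_zero hβ0 hβ1 hd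
    have : (K₀ : ℝ) + 1 ≤ |((2 * n + pn : ℤ) : ℝ)| := by
      rcases hn with h | h
      · have h' : (n : ℝ) ≤ -(K₀ : ℝ) - 1 := by exact_mod_cast (show n ≤ -(K₀ : ℤ) - 1 by omega)
        rw [abs_of_neg (by push_cast; rcases hpn' with h1 | h1 <;> rw [h1] <;> push_cast <;> linarith)]
        push_cast; rcases hpn' with h1 | h1 <;> rw [h1] <;> push_cast <;> linarith
      · have h' : (K₀ : ℝ) + 1 ≤ n := by exact_mod_cast (show (K₀ : ℤ) + 1 ≤ n by omega)
        rw [abs_of_pos (by push_cast; rcases hpn' with h1 | h1 <;> rw [h1] <;> push_cast <;> linarith)]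
        push_cast; rcases hpn' with h1 | h1 <;> rw [h1] <;> push_cast <;> linarith
    linarith
  have hm' : 2 * m + pm ∈ win K := hsub hm
  funext y
  simp only [modeProfile, child, inputState, truncW]
  symm
  refine Finset.sum_subset_zero_on_sdiff hsub (fun n hn => ?_) (fun n hn => ?_)
  · rw [Finset.mem_sdiff] at hn
    have h0 := hzero n hn.2
    simp [vPairState, h0]
  · by_cases hdn : d (2 * n + pn) = 0
    · simp [vPairState, hdn]
    · have hn2 : 2 * n + pn ∈ win K₀ := by
        by_contra hc
        rw [mem_win, not_and_or, not_le, not_le] at hc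
        apply hdn
        apply supportedIn_apply_eq_zero hβ0 hβ1 hd
        rcases hc with h | h
        · have h' : (((2 * n + pn : ℤ)) : ℝ) ≤ -(K₀ : ℝ) - 1 := by exact_mod_cast (show 2 * n + pn ≤ -(K₀ : ℤ) - 1 by omega)
          rw [abs_of_neg (by linarith)]; linarith
        · have h' : (K₀ : ℝ) + 1 ≤ ((2 * n + pn : ℤ) : ℝ) := by exact_mod_cast (show (K₀ : ℤ) + 1 ≤ 2 * n + pn by omega)
          rw [abs_of_pos (by linarith)]; linarith
      rw [if_pos ⟨hm, hn2⟩, if_pos ⟨hm', hsub hn2⟩]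

/-- The window grows by the two end points. -/
theorem win_succ (K : ℕ) : win (K + 1) = insert (-((K : ℤ) + 1)) (insert ((K : ℤ) + 1) (win K)) := by
  ext n
  simp only [win, Finset.mem_Icc, Finset.mem_insert, Nat.cast_add, Nat.cast_one]
  omega

/-- Splitting a window sum at the two new end points. -/
theorem sum_win_succ (f : ℤ → ℝ) (K : ℕ) :
    ∑ n ∈ win (K + 1), f n = f (-((K : ℤ) + 1)) + (f ((K : ℤ) + 1) + ∑ n ∈ win K, f n) := by
  rw [win_succ, Finset.sum_insert, Finset.sum_insert]
  · simp only [win, Finset.mem_Icc]; omega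
  · simp only [win, Finset.mem_insert, Finset.mem_Icc]; omega

/-- **The column tail:** `Σ_{K₀ < |n| ≤ K} 1/(|n|−1)² ≤ 2/(K₀−1)` (`K₀ ≥ 2`; telescoping). -/
theorem sum_win_tail_inv_sq_le {K₀ : ℕ} (hK₀ : 2 ≤ K₀) {K : ℕ} (hK : K₀ ≤ K) :
    ∑ n ∈ win K, (if n ∈ win K₀ then (0 : ℝ) else 1 / ((|(n : ℝ)| - 1) ^ 2)) ≤ 2 / ((K₀ : ℝ) - 1) - 2 / ((K : ℝ) - 1) := by
  induction K, hK using Nat.le_induction with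
  | base => rw [Finset.sum_eq_zero fun n hn => if_pos hn]; simp
  | succ K hKK ih =>
    have hK1 : (1 : ℝ) ≤ (K : ℝ) - 1 := by
      have : (2 : ℝ) ≤ K := by exact_mod_cast hK₀.trans hKK
      linarith
    rw [sum_win_succ]
    have hn1 : (-((K : ℤ) + 1)) ∉ win K₀ := by rw [mem_win]; omega
    have hn2 : ((K : ℤ) + 1) ∉ win K₀ := by rw [mem_win]; omega
    rw [if_neg hn1, if_neg hn2]
    have e1 : |((-((K : ℤ) + 1) : ℤ) : ℝ)| - 1 = K := by push_cast; rw [abs_of_neg (by linarith)]; ring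
    have e2 : |((((K : ℤ) + 1) : ℤ) : ℝ)| - 1 = K := by push_cast; rw [abs_of_pos (by linarith)]; ring
    rw [e1, e2]
    push_cast
    have hK0 : (0 : ℝ) < K := by linarith
    have key : 1 / (K : ℝ) ^ 2 + 1 / (K : ℝ) ^ 2 ≤ 2 / ((K : ℝ) - 1) - 2 / ((K : ℝ) + 1 - 1) := by
      rw [show (K : ℝ) + 1 - 1 = K by ring, show 2 / ((K : ℝ) - 1) - 2 / K = 2 / (((K : ℝ) - 1) * K) by field_simp; ring,
        show 1 / (K : ℝ) ^ 2 + 1 / (K : ℝ) ^ 2 = 2 / ((K : ℝ) ^ 2) by ring]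
      exact div_le_div_of_nonneg_left (by norm_num) (by nlinarith) (by nlinarith)
    linarith


/-! ## §21 (copy) the lattice paired envelope by name -/

/-- **Paired envelope of the single-mode sources at a lattice mode `ξ = β + n`** (tree `norm_src_lattice_env_le`, p713713). -/
theorem norm_src_lattice_le {a : ℝ} (ha : 0 < a) (β : ℝ) (n : ℤ) {y₀ : ℝ} (hy₀ : y₀ = 1 / 4 ∨ y₀ = -(1 / 4)) (s : ℝ) :
    ‖src a β (β + n) y₀ s‖ ≤
      (1 + Real.exp (-(2 * Real.pi * a)) + 2 * Real.exp (-(2 * Real.pi * a) / 4) ^ 2) * (1 + |s| / 2) *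
          (1 / (1 + ((β + n) / a + 1 * s) ^ 2) + 1 / (1 + ((β + n) / a + (-1) * s) ^ 2)) /
        ((1 - Real.exp (-(2 * Real.pi * a))) * (2 * Real.pi * a) ^ 2) :=
  norm_src_lattice_env_le ha β n rfl hy₀ s (K := kernelK a β) (G := lineKernel a β) rfl (lineKernel_eq ha β)


/-! ## §1 (p2 g12) The three propagator branches under one roof: `|C(t)| ≤ cosh(θ√λ₊)`, `|Sn(t)| ≤ θ·cosh(θ√λ₊)` on `[0, θ]` -/

/-- `propC` is continuous in time (each branch is). -/
theorem continuous_propC (a β : ℝ) : Continuous (propC a β) := by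
  unfold propC
  split_ifs <;> fun_prop

/-- `propSn` is continuous in time. -/
theorem continuous_propSn (a β : ℝ) : Continuous (propSn a β) := by
  unfold propSn
  split_ifs <;> fun_prop

/-- `|C(t)| ≤ cosh(θ√λ₊)` for `0 ≤ t ≤ θ` — stable, neutral or unstable. -/
theorem abs_propC_le (a β : ℝ) {t θ : ℝ} (ht : 0 ≤ t) (htθ : t ≤ θ) :
    |propC a β t| ≤ Real.cosh (Real.sqrt (max 0 (khLam a β)) * θ) := by
  unfold propC
  split_ifs with h1 h2
  · rw [max_eq_right h1.le, abs_of_nonneg (Real.cosh_pos _).le]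
    exact cosh_mul_le_cosh_mul (Real.sqrt_nonneg _) ht htθ
  · exact abs_cos_le_cosh _ _
  · rw [abs_one]; exact Real.one_le_cosh _

/-- `|Sn(t)| ≤ θ·cosh(θ√λ₊)` for `0 ≤ t ≤ θ` — `sinh y ≤ y cosh y`, `|sin(ωt)| ≤ ωt`, `t ≤ θ`. -/
theorem abs_propSn_le (a β : ℝ) {t θ : ℝ} (ht : 0 ≤ t) (htθ : t ≤ θ) :
    |propSn a β t| ≤ θ * Real.cosh (Real.sqrt (max 0 (khLam a β)) * θ) := by
  have hθ : 0 ≤ θ := ht.trans htθ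
  have hc1 : 1 ≤ Real.cosh (Real.sqrt (max 0 (khLam a β)) * θ) := Real.one_le_cosh _
  unfold propSn
  split_ifs with h1 h2
  · rw [max_eq_right h1.le]
    have hω : 0 < Real.sqrt (khLam a β) := Real.sqrt_pos.2 h1
    calc |Real.sinh (Real.sqrt (khLam a β) * t) / Real.sqrt (khLam a β)| ≤ t * Real.cosh (Real.sqrt (khLam a β) * t) :=
          sinh_div_le_mul_cosh hω ht
      _ ≤ θ * Real.cosh (Real.sqrt (khLam a β) * θ) :=
          mul_le_mul htθ (cosh_mul_le_cosh_mul hω.le ht htθ) (Real.cosh_pos _).le hθ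
  · have hω : Real.sqrt (-(khLam a β)) ≠ 0 := (Real.sqrt_pos.2 (by linarith)).ne'
    calc |Real.sin (Real.sqrt (-(khLam a β)) * t) / Real.sqrt (-(khLam a β))| ≤ t := abs_sin_div_le hω ht
      _ ≤ θ * 1 := by linarith
      _ ≤ θ * Real.cosh (Real.sqrt (max 0 (khLam a β)) * θ) := mul_le_mul_of_nonneg_left hc1 hθ
  · rw [abs_of_nonneg ht]
    calc t ≤ θ * 1 := by linarith
      _ ≤ θ * Real.cosh (Real.sqrt (max 0 (khLam a β)) * θ) := mul_le_mul_of_nonneg_left hc1 hθ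

/-! ## §2 The Duhamel formula of the single mode on ANY line `a > 0` (symbolic propagator entries) -/

/-- The Duhamel integrand of the single mode is continuous in the strain time on every line `a > 0`. -/
theorem continuous_duhamelIntegrand_singleMode_pos {a : ℝ} (ha : 0 < a) (β ξ θ : ℝ) :
    Continuous fun s : ℝ => (propagator a β (θ - s)).mulVec (forcing a β (singleMode ξ) s) := by
  have hs0 := continuous_src ha β ξ (y₀ := 1 / 4) (Or.inl rfl)
  have hs1 := continuous_src ha β ξ (y₀ := -(1 / 4)) (Or.inr rfl)
  have hC : Continuous fun s : ℝ => ((propC a β (θ - s) : ℝ) : ℂ) :=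
    Complex.continuous_ofReal.comp ((continuous_propC a β).comp (continuous_const.sub continuous_id))
  have hS : Continuous fun s : ℝ => ((propSn a β (θ - s) : ℝ) : ℂ) :=
    Complex.continuous_ofReal.comp ((continuous_propSn a β).comp (continuous_const.sub continuous_id))
  apply continuous_pi
  intro j
  simp only [forcing_singleMode, propagator, Matrix.add_mulVec, Matrix.smul_mulVec, Matrix.one_mulVec]
  simp only [Pi.add_apply, Pi.smul_apply, smul_eq_mul, Matrix.mulVec, dotProduct, Fin.sum_univ_two]
  fin_cases j
  · simp only [Fin.zero_eta, Fin.isValue, Matrix.cons_val_zero, Matrix.cons_val_one]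
    exact (hC.mul (continuous_const.mul hs0)).add (hS.mul ((continuous_const.mul (continuous_const.mul hs0)).add (continuous_const.mul (continuous_const.mul hs1))))
  · simp only [Fin.mk_one, Fin.isValue, Matrix.cons_val_zero, Matrix.cons_val_one]
    exact (hC.mul (continuous_const.mul hs1)).add (hS.mul ((continuous_const.mul (continuous_const.mul hs0)).add (continuous_const.mul (continuous_const.mul hs1))))

/-- **Reduction, component `0`, any line `a > 0`.** -/
theorem sheetAmps_singleMode_apply_0_pos {a : ℝ} (ha : 0 < a) (β ξ θ : ℝ) :
    sheetAmps a β θ (singleMode ξ) 0 = ∫ s in (0 : ℝ)..θ,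
      ((propC a β (θ - s) : ℝ) : ℂ) * ((((2 * Real.pi * a : ℝ) * Complex.I : ℂ) * (-2)) * src a β ξ (1 / 4) s) +
        ((propSn a β (θ - s) : ℝ) : ℂ) *
          (blockX a β 0 0 * ((((2 * Real.pi * a : ℝ) * Complex.I : ℂ) * (-2)) * src a β ξ (1 / 4) s) +
            blockX a β 0 1 * ((((2 * Real.pi * a : ℝ) * Complex.I : ℂ) * 2) * src a β ξ (-(1 / 4)) s)) := by
  have hint := (continuous_duhamelIntegrand_singleMode_pos ha β ξ θ).intervalIntegrable (μ := volume) 0 θ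
  have hcomp := ((ContinuousLinearMap.proj (R := ℂ) (φ := fun _ : Fin 2 => ℂ) (0 : Fin 2)).intervalIntegral_comp_comm hint).symm
  simp only [ContinuousLinearMap.proj_apply] at hcomp
  unfold sheetAmps
  rw [hcomp]
  refine intervalIntegral.integral_congr fun s _ => ?_
  simp only [forcing_singleMode, propagator, Matrix.add_mulVec, Matrix.smul_mulVec, Matrix.one_mulVec]
  simp only [Pi.add_apply, Pi.smul_apply, smul_eq_mul, Matrix.mulVec, dotProduct, Fin.sum_univ_two, Fin.isValue, Matrix.cons_val_zero,
    Matrix.cons_val_one]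

/-- **Reduction, component `1`, any line `a > 0`.** -/
theorem sheetAmps_singleMode_apply_1_pos {a : ℝ} (ha : 0 < a) (β ξ θ : ℝ) :
    sheetAmps a β θ (singleMode ξ) 1 = ∫ s in (0 : ℝ)..θ,
      ((propC a β (θ - s) : ℝ) : ℂ) * ((((2 * Real.pi * a : ℝ) * Complex.I : ℂ) * 2) * src a β ξ (-(1 / 4)) s) +
        ((propSn a β (θ - s) : ℝ) : ℂ) *
          (blockX a β 1 0 * ((((2 * Real.pi * a : ℝ) * Complex.I : ℂ) * (-2)) * src a β ξ (1 / 4) s) +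
            blockX a β 1 1 * ((((2 * Real.pi * a : ℝ) * Complex.I : ℂ) * 2) * src a β ξ (-(1 / 4)) s)) := by
  have hint := (continuous_duhamelIntegrand_singleMode_pos ha β ξ θ).intervalIntegrable (μ := volume) 0 θ
  have hcomp := ((ContinuousLinearMap.proj (R := ℂ) (φ := fun _ : Fin 2 => ℂ) (1 : Fin 2)).intervalIntegral_comp_comm hint).symm
  simp only [ContinuousLinearMap.proj_apply] at hcomp
  unfold sheetAmps
  rw [hcomp]
  refine intervalIntegral.integral_congr fun s _ => ?_
  simp only [forcing_singleMode, propagator, Matrix.add_mulVec, Matrix.smul_mulVec, Matrix.one_mulVec]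
  simp only [Pi.add_apply, Pi.smul_apply, smul_eq_mul, Matrix.mulVec, dotProduct, Fin.sum_univ_two, Fin.isValue, Matrix.cons_val_zero,
    Matrix.cons_val_one]

/-! ## §3 THE THRESHOLD-FREE SINGLE-MODE CREATION BOUND (every line `a > 0`, every Bloch phase, every lattice mode) -/

/-- **Single-mode creation on ANY line** (`a > 0` — KH band, threshold and far lines alike; `θ ≥ 0`; lattice mode `ξ = β + n`):
`‖sheetAmps a β θ (singleMode (β+n)) i‖ ≤ (cosh(θ√λ₊)·4πa + θ·cosh(θ√λ₊)·(a|p|·4πa + 2a‖S‖·4πa))·(1+q+2x²)(1+θ/2)(arctan(u+θ) − arctan(u−θ))/((1−q)κ²)`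
(`λ₊ = max 0 (khLam a β)`, `p = π/2 + 2Σ₀`, `u = (β+n)/a`): the paired `1/ξ²` far decay survives, the rate `ω` never appears. -/
theorem norm_sheetAmps_singleMode_anyLine {a : ℝ} (ha : 0 < a) (β : ℝ) (n : ℤ) {θ : ℝ} (hθ0 : 0 ≤ θ) (i : Fin 2) :
    ‖sheetAmps a β θ (singleMode (β + n)) i‖ ≤
      (Real.cosh (Real.sqrt (max 0 (khLam a β)) * θ) * (4 * Real.pi * a) +
          θ * Real.cosh (Real.sqrt (max 0 (khLam a β)) * θ) *
            (a * |Real.pi / 2 + 2 * sawSigma0 a β| * (4 * Real.pi * a) + 2 * a * ‖sawS a β‖ * (4 * Real.pi * a))) *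
        ((1 + Real.exp (-(2 * Real.pi * a)) + 2 * Real.exp (-(2 * Real.pi * a) / 4) ^ 2) * (1 + θ / 2) *
          (Real.arctan ((β + n) / a + θ) - Real.arctan ((β + n) / a - θ)) / ((1 - Real.exp (-(2 * Real.pi * a))) * (2 * Real.pi * a) ^ 2)) := by
  have h0 := twoPi_lineKernel_zero' ha β
  have hh := twoPi_conj_lineKernel_half' ha β
  have hE₀ := norm_src_lattice_le ha β n (y₀ := 1 / 4) (Or.inl rfl)
  have hE₁ := norm_src_lattice_le ha β n (y₀ := -(1 / 4)) (Or.inr rfl)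
  obtain ⟨e00, e01, e10, e11⟩ := blockX_apply a β
  have hC : ∀ t ∈ Set.Icc (0 : ℝ) θ, |propC a β t| ≤ Real.cosh (Real.sqrt (max 0 (khLam a β)) * θ) := fun t ht => abs_propC_le a β ht.1 ht.2
  have hSn : ∀ t ∈ Set.Icc (0 : ℝ) θ, |propSn a β t| ≤ θ * Real.cosh (Real.sqrt (max 0 (khLam a β)) * θ) :=
    fun t ht => abs_propSn_le a β ht.1 ht.2
  have hq1 : Real.exp (-(2 * Real.pi * a)) < 1 := Real.exp_lt_one_iff.2 (by nlinarith [Real.pi_pos])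
  have hD : 0 < (1 - Real.exp (-(2 * Real.pi * a))) * (2 * Real.pi * a) ^ 2 := by
    have : 0 < (2 * Real.pi * a) ^ 2 := by positivity
    nlinarith
  have hN : 0 ≤ 1 + Real.exp (-(2 * Real.pi * a)) + 2 * Real.exp (-(2 * Real.pi * a) / 4) ^ 2 := by positivity
  have hκ : 0 < 2 * Real.pi * a := by positivity
  have hc0 : ‖(((2 * Real.pi * a : ℝ) * Complex.I : ℂ) * (-2))‖ = 4 * Real.pi * a := by
    rw [norm_mul, norm_mul, Complex.norm_real, Complex.norm_I, Real.norm_eq_abs, abs_of_pos hκ, norm_neg]; simp; ring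
  have hc1 : ‖(((2 * Real.pi * a : ℝ) * Complex.I : ℂ) * 2)‖ = 4 * Real.pi * a := by
    rw [norm_mul, norm_mul, Complex.norm_real, Complex.norm_I, Real.norm_eq_abs, abs_of_pos hκ]; simp; ring
  fin_cases i
  · simp only [Fin.zero_eta, Fin.isValue]
    rw [sheetAmps_singleMode_apply_0_pos ha, e00, e01]
    refine (norm_duhamel_CSn_paired_le hθ0 hN hD hC hSn hE₀ hE₁).trans (le_of_eq ?_)
    rw [hc0, hc1, norm_blockX_diag_eq ha h0, norm_blockX_off_eq ha hh]
  · simp only [Fin.mk_one, Fin.isValue]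
    rw [sheetAmps_singleMode_apply_1_pos ha, e10, e11]
    refine ((norm_duhamel_CSn_le' hθ0 hC hSn (continuous_pairedEnv _ ((β + n) / a) _) hE₀ hE₁).trans
      (mul_le_mul_of_nonneg_left (integral_pairedEnv_le hN hD hθ0 ((β + n) / a)) ?_)).trans (le_of_eq ?_)
    · have := hC 0 ⟨le_rfl, hθ0⟩
      have := hSn 0 ⟨le_rfl, hθ0⟩
      positivity
    · rw [hc0, hc1, norm_blockX_diag_eq' ha h0, norm_blockX_off_eq' ha hh]


/-! ## §4 (p2 g12) THE ENERGY-FORM LAW ON EVERY LINE `0 < |a| ≤ 1` WITH AN EXPLICIT PREFACTOR (no stability; the square sum of the `arctan` windows is uniform) -/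

/-- Linearity of creation in the profile on every line `a > 0`. -/
theorem sheetAmps_modeProfile_pos {a : ℝ} (ha : 0 < a) (β θ : ℝ) (K : ℕ) (c : ℤ → ℂ) :
    sheetAmps a β θ ⟨modeProfile β K c, []⟩ = ∑ n ∈ win K, c n • sheetAmps a β θ (singleMode (β + n)) := by
  unfold sheetAmps
  simp_rw [forcing_modeProfile ha, Matrix.mulVec_sum, Matrix.mulVec_smul]
  have hint : ∀ n ∈ win K, IntervalIntegrable (fun s => c n • (propagator a β (θ - s)).mulVec (forcing a β (singleMode (β + n)) s))
      volume 0 θ := fun n _ => ((continuous_duhamelIntegrand_singleMode_pos ha β (β + n) θ).intervalIntegrable (μ := volume) _ _).smul (c n)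
  rw [intervalIntegral.integral_finsetSum hint]
  refine Finset.sum_congr rfl fun n _ => ?_
  exact intervalIntegral.integral_smul _ _

/-- The conjugation symmetry `(a, β) ↦ (−a, −β)` of the created amplitudes on every line `a > 0`. -/
theorem sheetAmps_neg_neg_modeProfile_pos {a : ℝ} (ha : 0 < a) (β θ : ℝ) (K : ℕ) (c : ℤ → ℂ) (i : Fin 2) :
    sheetAmps (-a) (-β) θ ⟨modeProfile (-β) K (fun n => starRingEnd ℂ (c (-n))), []⟩ i =
      starRingEnd ℂ (sheetAmps a β θ ⟨modeProfile β K c, []⟩ i) := by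
  have ha0 : a ≠ 0 := ha.ne'
  have hF : Continuous fun s : ℝ => (propagator a β (θ - s)).mulVec (forcing a β ⟨modeProfile β K c, []⟩ s) := by
    have e : (fun s : ℝ => (propagator a β (θ - s)).mulVec (forcing a β ⟨modeProfile β K c, []⟩ s)) =
        fun s : ℝ => ∑ n ∈ win K, c n • (propagator a β (θ - s)).mulVec (forcing a β (singleMode (β + n)) s) := by
      funext s
      rw [forcing_modeProfile ha β s K c, Matrix.mulVec_sum]
      refine Finset.sum_congr rfl fun n _ => ?_
      rw [Matrix.mulVec_smul]
    rw [e]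
    exact continuous_finsetSum _ fun n _ => (continuous_duhamelIntegrand_singleMode_pos ha β (β + n) θ).const_smul (c n)
  have hint_eq : (⟨modeProfile (-β) K (fun n => starRingEnd ℂ (c (-n))), []⟩ : LamState) = ⟨fun y => starRingEnd ℂ (modeProfile β K c y), []⟩ := by
    congr 1
    funext y
    rw [conj_modeProfile]
  rw [hint_eq]
  have e : (fun s : ℝ => (propagator (-a) (-β) (θ - s)).mulVec (forcing (-a) (-β) ⟨fun y => starRingEnd ℂ (modeProfile β K c y), []⟩ s)) =
      fun s : ℝ => star ((propagator a β (θ - s)).mulVec (forcing a β ⟨modeProfile β K c, []⟩ s)) :=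
    funext fun s => duhamelIntegrand_neg_neg_nosheet ha0 β θ s (modeProfile β K c)
  have hF' : Continuous fun s : ℝ => (propagator (-a) (-β) (θ - s)).mulVec (forcing (-a) (-β) ⟨fun y => starRingEnd ℂ (modeProfile β K c y), []⟩ s) := by
    rw [e]; exact continuous_star.comp hF
  have hint := hF.intervalIntegrable (μ := volume) 0 θ
  have hint' := hF'.intervalIntegrable (μ := volume) 0 θ
  have h1 := ((ContinuousLinearMap.proj (R := ℂ) (φ := fun _ : Fin 2 => ℂ) i).intervalIntegral_comp_comm hint).symm
  have h2 := ((ContinuousLinearMap.proj (R := ℂ) (φ := fun _ : Fin 2 => ℂ) i).intervalIntegral_comp_comm hint').symm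
  simp only [ContinuousLinearMap.proj_apply] at h1 h2
  unfold sheetAmps
  rw [h1, h2, ← intervalIntegral.intervalIntegral_conj]
  refine intervalIntegral.integral_congr fun s _ => ?_
  have := congrFun (duhamelIntegrand_neg_neg_nosheet ha0 β θ s (modeProfile β K c)) i
  simp only [Pi.star_apply, Complex.star_def] at this
  exact this

/-- **The square sum of the `arctan` windows is uniform on the unit strip:** for `0 < a ≤ 1`, `|β| ≤ 1`, `0 ≤ θ ≤ 8` and every window,
`Σ_{|n| ≤ K} (arctan((β+n)/a+θ) − arctan((β+n)/a−θ))²·(a² + (β+n)²) ≤ 84500` (`≤ π²·257` on the `≤ 33` modes `|β+n| < 16`; `≤ 4112/(β+n)²` beyond). -/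
theorem sum_sq_arctanWindow_le {a : ℝ} (ha0 : 0 < a) (ha1 : a ≤ 1) {β : ℝ} (hβ : |β| ≤ 1) {θ : ℝ} (hθ0 : 0 ≤ θ) (hθ : θ ≤ 8) (K : ℕ) :
    ∑ n ∈ win K, (Real.arctan ((β + n) / a + θ) - Real.arctan ((β + n) / a - θ)) ^ 2 * (a ^ 2 + (β + n) ^ 2) ≤ 84500 := by
  have hπ : Real.pi < 3.1416 := Real.pi_lt_d4
  have hpt : ∀ n ∈ win K, (Real.arctan ((β + n) / a + θ) - Real.arctan ((β + n) / a - θ)) ^ 2 * (a ^ 2 + (β + n) ^ 2) ≤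
      (if |β + (n : ℝ)| < 16 then (2537 : ℝ) else 0) + 4112 * (if |β + (n : ℝ)| < 16 then (0 : ℝ) else 1 / (β + n) ^ 2) := by
    intro n _
    have hW := arctan_window_le_pi ((β + n) / a) θ
    have hW0 := arctan_window_nonneg hθ0 ((β + n) / a)
    split_ifs with h
    · rw [mul_zero, add_zero]
      have hb : (β + n) ^ 2 < 256 := by have := abs_lt.1 h; nlinarith [this.1, this.2]
      have hW2 : (Real.arctan ((β + n) / a + θ) - Real.arctan ((β + n) / a - θ)) ^ 2 ≤ 3.1416 ^ 2 :=
        pow_le_pow_left₀ hW0 (hW.trans hπ.le) 2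
      have : a ^ 2 ≤ 1 := by nlinarith
      calc (Real.arctan ((β + n) / a + θ) - Real.arctan ((β + n) / a - θ)) ^ 2 * (a ^ 2 + (β + n) ^ 2) ≤ 3.1416 ^ 2 * (1 + 256) :=
            mul_le_mul hW2 (by linarith) (by positivity) (by norm_num)
        _ ≤ 2537 := by norm_num
    · rw [zero_add]
      replace h : 16 ≤ |β + (n : ℝ)| := not_lt.mp h
      have hu : 16 ≤ |(β + n) / a| := by
        rw [abs_div, abs_of_pos ha0, le_div_iff₀ ha0]
        have : 16 * a ≤ 16 := by linarith
        linarith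
      have hfar := arctan_window_le_far_abs hθ0 (show θ ≤ |(β + n) / a| by linarith)
      -- `W ≤ 2θ/(1+(|u|−θ)²) ≤ 64/u² = 64a²/ξ²`
      have hb256 : (256 : ℝ) ≤ (β + n) ^ 2 := by
        have h16 : (16 : ℝ) ^ 2 ≤ |β + (n : ℝ)| ^ 2 := pow_le_pow_left₀ (by norm_num) h 2
        rw [sq_abs] at h16; norm_num at h16; linarith
      have hξ0 : 0 < (β + (n : ℝ)) ^ 2 := by linarith
      have hu2 : |(β + n) / a| ^ 2 = (β + n) ^ 2 / a ^ 2 := by rw [sq_abs, div_pow]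
      have hWle : Real.arctan ((β + n) / a + θ) - Real.arctan ((β + n) / a - θ) ≤ 64 * a ^ 2 / (β + n) ^ 2 := by
        refine hfar.trans ?_
        rw [div_le_div_iff₀ (by positivity) hξ0]
        -- 2θ ξ² ≤ 64 a² (1 + (|u|−θ)²), with |u| ≥ 16, θ ≤ 8: (|u|−θ)² ≥ u²/4 = ξ²/(4a²)
        have h4 : (β + (n : ℝ)) ^ 2 / a ^ 2 ≤ 4 * (|(β + n) / a| - θ) ^ 2 := by
          rw [← hu2]; nlinarith
        have h5 : (β + (n : ℝ)) ^ 2 ≤ 4 * a ^ 2 * (|(β + n) / a| - θ) ^ 2 := by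
          have := mul_le_mul_of_nonneg_left h4 (sq_nonneg a)
          rwa [mul_div_cancel₀ _ (by positivity : a ^ 2 ≠ 0), ← mul_assoc, mul_comm (a ^ 2) 4] at this
        nlinarith [sq_nonneg a]
      have hWsq : (Real.arctan ((β + n) / a + θ) - Real.arctan ((β + n) / a - θ)) ^ 2 ≤ (64 * a ^ 2 / (β + n) ^ 2) ^ 2 :=
        pow_le_pow_left₀ hW0 hWle 2
      have ha2 : a ^ 2 ≤ 1 := by nlinarith
      calc (Real.arctan ((β + n) / a + θ) - Real.arctan ((β + n) / a - θ)) ^ 2 * (a ^ 2 + (β + n) ^ 2)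
          ≤ (64 * a ^ 2 / (β + n) ^ 2) ^ 2 * (a ^ 2 + (β + n) ^ 2) := mul_le_mul_of_nonneg_right hWsq (by positivity)
        _ = 4096 * (a ^ 2) ^ 2 * ((a ^ 2 + (β + n) ^ 2) / ((β + n) ^ 2) ^ 2) := by rw [div_pow]; ring
        _ ≤ 4096 * 1 * ((1 + (β + n) ^ 2) / ((β + n) ^ 2) ^ 2) := by
            refine mul_le_mul (mul_le_mul_of_nonneg_left (by nlinarith) (by norm_num)) ?_ (by positivity) (by positivity)
            exact div_le_div_of_nonneg_right (by linarith) (by positivity)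
        _ ≤ 4112 * (1 / (β + n) ^ 2) := by
            rw [mul_one, mul_div_assoc', mul_one_div, div_le_div_iff₀ (by positivity) hξ0]
            nlinarith [hb256, hξ0]
  refine (Finset.sum_le_sum hpt).trans ?_
  rw [Finset.sum_add_distrib, ← Finset.mul_sum, ← Finset.sum_filter, Finset.sum_const, nsmul_eq_mul]
  have hc := card_filter_abs_lt_le β (show (0 : ℝ) ≤ 16 by norm_num) (win K)
  have hwin : win K = Finset.Icc (-(K : ℤ)) K := rfl
  have hfar := sum_Icc_inv_sq_far_le hβ (show (5 : ℝ) ≤ 16 by norm_num) K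
  rw [← hwin] at hfar
  nlinarith


/-! ## §5 (p2 g12) The explicit line constant on `0 < |a| ≤ 1` and the SPLIT of B1: corner strip + a scalar bound -/

/-- The threshold-free single-mode prefactor `TF(a,β,θ)·(1+q+2x²)(1+θ/2)/((1−q)κ²)` (explicit closed form; blows up as `a → 0⁺`). -/
def prefTF (a β θ : ℝ) : ℝ :=
  (Real.cosh (Real.sqrt (max 0 (khLam a β)) * θ) * (4 * Real.pi * a) +
      θ * Real.cosh (Real.sqrt (max 0 (khLam a β)) * θ) *
        (a * |Real.pi / 2 + 2 * sawSigma0 a β| * (4 * Real.pi * a) + 2 * a * ‖sawS a β‖ * (4 * Real.pi * a))) *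
    ((1 + Real.exp (-(2 * Real.pi * a)) + 2 * Real.exp (-(2 * Real.pi * a) / 4) ^ 2) * (1 + θ / 2) /
      ((1 - Real.exp (-(2 * Real.pi * a))) * (2 * Real.pi * a) ^ 2))

theorem prefTF_nonneg {a : ℝ} (ha : 0 < a) (β : ℝ) {θ : ℝ} (hθ0 : 0 ≤ θ) : 0 ≤ prefTF a β θ := by
  have hq1 : Real.exp (-(2 * Real.pi * a)) < 1 := Real.exp_lt_one_iff.2 (by nlinarith [Real.pi_pos])
  have hD : 0 < (1 - Real.exp (-(2 * Real.pi * a))) * (2 * Real.pi * a) ^ 2 := by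
    have : 0 < (2 * Real.pi * a) ^ 2 := by positivity
    nlinarith
  unfold prefTF
  positivity

/-- The per-mode bound of §3 in the form `prefTF · window`. -/
theorem norm_sheetAmps_singleMode_anyLine' {a : ℝ} (ha : 0 < a) (β : ℝ) (n : ℤ) {θ : ℝ} (hθ0 : 0 ≤ θ) (i : Fin 2) :
    ‖sheetAmps a β θ (singleMode (β + n)) i‖ ≤ prefTF a β θ * (Real.arctan ((β + n) / a + θ) - Real.arctan ((β + n) / a - θ)) := by
  refine (norm_sheetAmps_singleMode_anyLine ha β n hθ0 i).trans (le_of_eq ?_)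
  unfold prefTF
  ring

/-- **THE ENERGY-FORM LAW ON EVERY LINE `0 < a ≤ 1`** (no stability; `|β| ≤ 1`, `θ ∈ [0,8]`, any window, any profile):
`‖q_i‖² ≤ 84500·prefTF(a,β,θ)²·Σ_{|n| ≤ K} ‖c n‖²/(a² + (β+n)²)`. -/
theorem norm_sq_sheetAmps_modeProfile_anyLine {a : ℝ} (ha0 : 0 < a) (ha1 : a ≤ 1) {β : ℝ} (hβ : |β| ≤ 1) {θ : ℝ} (hθ0 : 0 ≤ θ) (hθ : θ ≤ 8)
    (K : ℕ) (c : ℤ → ℂ) (i : Fin 2) :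
    ‖sheetAmps a β θ ⟨modeProfile β K c, []⟩ i‖ ^ 2 ≤ 84500 * prefTF a β θ ^ 2 * ∑ n ∈ win K, ‖c n‖ ^ 2 / (a ^ 2 + (β + n) ^ 2) := by
  have hP := prefTF_nonneg ha0 β hθ0
  set P := prefTF a β θ with hPdef
  have hlin : ‖sheetAmps a β θ ⟨modeProfile β K c, []⟩ i‖ ≤
      ∑ n ∈ win K, ‖c n‖ * (P * (Real.arctan ((β + n) / a + θ) - Real.arctan ((β + n) / a - θ))) := by
    rw [sheetAmps_modeProfile_pos ha0 β θ K c, Finset.sum_apply]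
    refine (norm_sum_le _ _).trans (Finset.sum_le_sum fun n _ => ?_)
    rw [Pi.smul_apply, norm_smul]
    exact mul_le_mul_of_nonneg_left (norm_sheetAmps_singleMode_anyLine' ha0 β n hθ0 i) (norm_nonneg _)
  have hW0 : ∀ n : ℤ, 0 ≤ Real.arctan ((β + n) / a + θ) - Real.arctan ((β + n) / a - θ) := fun n => arctan_window_nonneg hθ0 _
  have hsum0 : 0 ≤ ∑ n ∈ win K, ‖c n‖ * (P * (Real.arctan ((β + n) / a + θ) - Real.arctan ((β + n) / a - θ))) :=
    Finset.sum_nonneg fun n _ => mul_nonneg (norm_nonneg _) (mul_nonneg hP (hW0 n))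
  have hCS := Finset.sum_sq_le_sum_mul_sum_of_sq_le_mul (win K)
    (r := fun n : ℤ => ‖c n‖ * (P * (Real.arctan ((β + n) / a + θ) - Real.arctan ((β + n) / a - θ))))
    (f := fun n : ℤ => ‖c n‖ ^ 2 / (a ^ 2 + (β + n) ^ 2))
    (g := fun n : ℤ => P ^ 2 * ((Real.arctan ((β + n) / a + θ) - Real.arctan ((β + n) / a - θ)) ^ 2 * (a ^ 2 + (β + n) ^ 2)))
    (fun n _ => by positivity) (fun n _ => by have := hW0 n; positivity) (fun n _ => le_of_eq ?_)
  · have hWsum := sum_sq_arctanWindow_le ha0 ha1 hβ hθ0 hθ K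
    have hf0 : 0 ≤ ∑ n ∈ win K, ‖c n‖ ^ 2 / (a ^ 2 + (β + n) ^ 2) := Finset.sum_nonneg fun n _ => by positivity
    calc ‖sheetAmps a β θ ⟨modeProfile β K c, []⟩ i‖ ^ 2
        ≤ (∑ n ∈ win K, ‖c n‖ * (P * (Real.arctan ((β + n) / a + θ) - Real.arctan ((β + n) / a - θ)))) ^ 2 :=
          pow_le_pow_left₀ (norm_nonneg _) hlin 2
      _ ≤ (∑ n ∈ win K, ‖c n‖ ^ 2 / (a ^ 2 + (β + n) ^ 2)) *
            ∑ n ∈ win K, P ^ 2 * ((Real.arctan ((β + n) / a + θ) - Real.arctan ((β + n) / a - θ)) ^ 2 * (a ^ 2 + (β + n) ^ 2)) := hCS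
      _ = (∑ n ∈ win K, ‖c n‖ ^ 2 / (a ^ 2 + (β + n) ^ 2)) *
            (P ^ 2 * ∑ n ∈ win K, (Real.arctan ((β + n) / a + θ) - Real.arctan ((β + n) / a - θ)) ^ 2 * (a ^ 2 + (β + n) ^ 2)) := by
          congr 1; rw [Finset.mul_sum]
      _ ≤ (∑ n ∈ win K, ‖c n‖ ^ 2 / (a ^ 2 + (β + n) ^ 2)) * (P ^ 2 * 84500) :=
          mul_le_mul_of_nonneg_left (mul_le_mul_of_nonneg_left hWsum (sq_nonneg P)) hf0
      _ = 84500 * P ^ 2 * ∑ n ∈ win K, ‖c n‖ ^ 2 / (a ^ 2 + (β + n) ^ 2) := by ring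
  · have hpos : 0 < a ^ 2 + (β + (n : ℝ)) ^ 2 := by positivity
    field_simp

/-- **The law on every line `−1 ≤ a < 0`** (conjugation symmetry): prefactor `prefTF (−a) (−β) θ`. -/
theorem norm_sq_sheetAmps_modeProfile_anyLine_of_neg {a : ℝ} (ha0 : a < 0) (ha1 : -1 ≤ a) {β : ℝ} (hβ : |β| ≤ 1) {θ : ℝ} (hθ0 : 0 ≤ θ)
    (hθ : θ ≤ 8) (K : ℕ) (c : ℤ → ℂ) (i : Fin 2) :
    ‖sheetAmps a β θ ⟨modeProfile β K c, []⟩ i‖ ^ 2 ≤ 84500 * prefTF (-a) (-β) θ ^ 2 * ∑ n ∈ win K, ‖c n‖ ^ 2 / (a ^ 2 + (β + n) ^ 2) := by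
  have ha' : 0 < -a := by linarith
  have hc : (fun n : ℤ => starRingEnd ℂ ((fun n : ℤ => starRingEnd ℂ (c (-n))) (-n))) = c := by
    funext n; simp
  have h := sheetAmps_neg_neg_modeProfile_pos ha' (-β) θ K (fun n => starRingEnd ℂ (c (-n))) i
  rw [neg_neg, neg_neg, hc] at h
  rw [h, Complex.norm_conj]
  have hβ' : |-β| ≤ 1 := by rwa [abs_neg]
  refine (norm_sq_sheetAmps_modeProfile_anyLine ha' (by linarith) hβ' hθ0 hθ K (fun n => starRingEnd ℂ (c (-n))) i).trans (le_of_eq ?_)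
  congr 1
  refine Finset.sum_nbij' (fun n => -n) (fun n => -n) (fun n hn => by simp only [win, Finset.mem_Icc] at hn ⊢; omega)
    (fun n hn => by simp only [win, Finset.mem_Icc] at hn ⊢; omega) (fun n _ => neg_neg n) (fun n _ => neg_neg n) (fun n _ => ?_)
  rw [Complex.norm_conj]
  push_cast
  ring

/-! ### copies (verbatim, `K2CreationLaws.lean` §27): `sheetAmps_zero_line`, `lineEnergyOut`, `CoreLineLaw`, `lineEnergyOut_le_weight` -/

/-- **The zero line creates nothing** (the forcing carries the factor `2πa`). -/
theorem sheetAmps_zero_line (b θ : ℝ) (st : LamState) : sheetAmps 0 b θ st = 0 := by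
  have hf : ∀ s : ℝ, forcing 0 b st s = 0 := by
    intro s; funext i
    simp only [forcing, mul_zero, Complex.ofReal_zero, zero_mul, Pi.zero_apply]
    fin_cases i <;> simp
  unfold sheetAmps
  simp only [hf, Matrix.mulVec_zero, intervalIntegral.integral_zero]

/-- The (level-stripped) LATTICE LINE ENERGY of a straight sheet pair with amplitudes `q` on the line `a`, Bloch offset `b`, window `K`:
`Σ_{|n| ≤ K} ‖q₀e^{−iπ(b+n)/2} + q₁e^{iπ(b+n)/2}‖²/(a² + (b+n)²)` — one row of `cEnergy (hPairState …)`, one column of `cEnergy (vPairState …)`, times `4π²4^ℓ`. -/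
def lineEnergyOut (a b : ℝ) (K : ℕ) (q : Fin 2 → ℂ) : ℝ :=
  ∑ n ∈ win K, ‖q 0 * Complex.exp (-(Real.pi * (b + n) / 2 : ℝ) * Complex.I) + q 1 * Complex.exp ((Real.pi * (b + n) / 2 : ℝ) * Complex.I)‖ ^ 2 /
    (a ^ 2 + (b + n) ^ 2)

/-- **B1 AS ONE PROP — the CORE-LINE CREATION LAW on the unit strip, exact energy form, constant `C`:** on every line `|a| < 1`, for every Bloch offset
`b ∈ [0,1]`, strain `θ ∈ [0,8]`, window `K` and profile `c`, the lattice line energy of the created straight pair is at most `C ×` the line's input energy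
`Σ_{|n| ≤ K} ‖c n‖²/(a² + (b+n)²)` (uniformity in `K`, in `b`, and in `a → 0⁺` is the content; the zero line itself creates nothing). -/
def CoreLineLaw (C : ℝ) : Prop :=
  ∀ (a b θ : ℝ) (K : ℕ) (c : ℤ → ℂ), |a| < 1 → 0 ≤ b → b ≤ 1 → 0 ≤ θ → θ ≤ 8 →
    lineEnergyOut a b K (sheetAmps a b θ ⟨modeProfile b K c, []⟩) ≤ C * ∑ n ∈ win K, ‖c n‖ ^ 2 / (a ^ 2 + (b + n) ^ 2)

/-- The line energy against the lossy weight (`vPair_column_energy_upper`): `≤ (‖q₀‖² + ‖q₁‖²)(π/|a| + 4/a²)` off the zero line. -/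
theorem lineEnergyOut_le_weight {a : ℝ} (ha : a ≠ 0) {b : ℝ} (hb0 : 0 ≤ b) (hb1 : b ≤ 1) (K : ℕ) (q : Fin 2 → ℂ) :
    lineEnergyOut a b K q ≤ (‖q 0‖ ^ 2 + ‖q 1‖ ^ 2) * (Real.pi / |a| + 4 / a ^ 2) := by
  have h := vPair_column_energy_upper hb0 hb1 ha K (q 0) (q 1)
  refine le_of_eq_of_le ?_ h
  unfold lineEnergyOut
  exact Finset.sum_congr rfl fun n _ => by rw [add_comm (a ^ 2)]


/-- The empty pair has no line energy. -/
theorem lineEnergyOut_zero (a b : ℝ) (K : ℕ) : lineEnergyOut a b K 0 = 0 := by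
  unfold lineEnergyOut; simp


/-- **THE LINE LAW AT A LINE `0 < a ≤ 1`, explicit constant** `2·84500·prefTF(a,b,θ)²·(π/a + 4/a²)` (exact line-energy form, `b ∈ [0,1]`). -/
theorem lineLaw_at_pos {a : ℝ} (ha0 : 0 < a) (ha1 : a ≤ 1) {b : ℝ} (hb0 : 0 ≤ b) (hb1 : b ≤ 1) {θ : ℝ} (hθ0 : 0 ≤ θ) (hθ : θ ≤ 8)
    (K : ℕ) (c : ℤ → ℂ) :
    lineEnergyOut a b K (sheetAmps a b θ ⟨modeProfile b K c, []⟩) ≤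
      (2 * 84500 * prefTF a b θ ^ 2 * (Real.pi / |a| + 4 / a ^ 2)) * ∑ n ∈ win K, ‖c n‖ ^ 2 / (a ^ 2 + (b + n) ^ 2) := by
  have hb : |b| ≤ 1 := abs_le.2 ⟨by linarith, hb1⟩
  have hq := fun i => norm_sq_sheetAmps_modeProfile_anyLine ha0 ha1 hb hθ0 hθ K c i
  have hS0 : 0 ≤ ∑ n ∈ win K, ‖c n‖ ^ 2 / (a ^ 2 + (b + n) ^ 2) := Finset.sum_nonneg fun _ _ => by positivity
  calc lineEnergyOut a b K (sheetAmps a b θ ⟨modeProfile b K c, []⟩)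
      ≤ (‖sheetAmps a b θ ⟨modeProfile b K c, []⟩ 0‖ ^ 2 + ‖sheetAmps a b θ ⟨modeProfile b K c, []⟩ 1‖ ^ 2) * (Real.pi / |a| + 4 / a ^ 2) :=
        lineEnergyOut_le_weight ha0.ne' hb0 hb1 K _
    _ ≤ (2 * (84500 * prefTF a b θ ^ 2 * ∑ n ∈ win K, ‖c n‖ ^ 2 / (a ^ 2 + (b + n) ^ 2))) * (Real.pi / |a| + 4 / a ^ 2) :=
        mul_le_mul_of_nonneg_right (by linarith [hq 0, hq 1]) (by positivity)
    _ = (2 * 84500 * prefTF a b θ ^ 2 * (Real.pi / |a| + 4 / a ^ 2)) * ∑ n ∈ win K, ‖c n‖ ^ 2 / (a ^ 2 + (b + n) ^ 2) := by ring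

/-- **THE LINE LAW AT A LINE `−1 ≤ a < 0`, explicit constant** `2·84500·prefTF(−a,−b,θ)²·(π/|a| + 4/a²)`. -/
theorem lineLaw_at_neg {a : ℝ} (ha0 : a < 0) (ha1 : -1 ≤ a) {b : ℝ} (hb0 : 0 ≤ b) (hb1 : b ≤ 1) {θ : ℝ} (hθ0 : 0 ≤ θ) (hθ : θ ≤ 8)
    (K : ℕ) (c : ℤ → ℂ) :
    lineEnergyOut a b K (sheetAmps a b θ ⟨modeProfile b K c, []⟩) ≤
      (2 * 84500 * prefTF (-a) (-b) θ ^ 2 * (Real.pi / |a| + 4 / a ^ 2)) * ∑ n ∈ win K, ‖c n‖ ^ 2 / (a ^ 2 + (b + n) ^ 2) := by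
  have hb : |b| ≤ 1 := abs_le.2 ⟨by linarith, hb1⟩
  have hq := fun i => norm_sq_sheetAmps_modeProfile_anyLine_of_neg ha0 ha1 hb hθ0 hθ K c i
  have hS0 : 0 ≤ ∑ n ∈ win K, ‖c n‖ ^ 2 / (a ^ 2 + (b + n) ^ 2) := Finset.sum_nonneg fun _ _ => by positivity
  calc lineEnergyOut a b K (sheetAmps a b θ ⟨modeProfile b K c, []⟩)
      ≤ (‖sheetAmps a b θ ⟨modeProfile b K c, []⟩ 0‖ ^ 2 + ‖sheetAmps a b θ ⟨modeProfile b K c, []⟩ 1‖ ^ 2) * (Real.pi / |a| + 4 / a ^ 2) :=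
        lineEnergyOut_le_weight ha0.ne hb0 hb1 K _
    _ ≤ (2 * (84500 * prefTF (-a) (-b) θ ^ 2 * ∑ n ∈ win K, ‖c n‖ ^ 2 / (a ^ 2 + (b + n) ^ 2))) * (Real.pi / |a| + 4 / a ^ 2) :=
        mul_le_mul_of_nonneg_right (by linarith [hq 0, hq 1]) (by positivity)
    _ = (2 * 84500 * prefTF (-a) (-b) θ ^ 2 * (Real.pi / |a| + 4 / a ^ 2)) * ∑ n ∈ win K, ‖c n‖ ^ 2 / (a ^ 2 + (b + n) ^ 2) := by ring

/-- **The CORNER-STRIP law** (what remains of B1 after this file, for any chosen `a₀ ∈ (0, 1]`): the exact line-energy creation law on `|a| < a₀`. -/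
def CoreStripLaw (a₀ C : ℝ) : Prop :=
  ∀ (a b θ : ℝ) (K : ℕ) (c : ℤ → ℂ), |a| < a₀ → 0 ≤ b → b ≤ 1 → 0 ≤ θ → θ ≤ 8 →
    lineEnergyOut a b K (sheetAmps a b θ ⟨modeProfile b K c, []⟩) ≤ C * ∑ n ∈ win K, ‖c n‖ ^ 2 / (a ^ 2 + (b + n) ^ 2)

/-- **B1 SPLIT: `CoreLineLaw` ⇐ the corner-strip law on `|a| < a₀` AND a SCALAR bound of the explicit function `2·84500·prefTF²·(π/|a|+4/a²)` on `a₀ ≤ |a| < 1`.**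
The second hypothesis is a statement about one closed-form real function of `(a, b, θ)` on a compact set away from `a = 0` — no integral, no operator. -/
theorem coreLineLaw_split {a₀ C₁ C₂ : ℝ} (hC₁ : 0 ≤ C₁) (hstrip : CoreStripLaw a₀ C₁)
    (hpos : ∀ a b θ : ℝ, a₀ ≤ a → a < 1 → 0 ≤ b → b ≤ 1 → 0 ≤ θ → θ ≤ 8 →
      2 * 84500 * prefTF a b θ ^ 2 * (Real.pi / |a| + 4 / a ^ 2) ≤ C₂)
    (hneg : ∀ a b θ : ℝ, a₀ ≤ a → a < 1 → 0 ≤ b → b ≤ 1 → 0 ≤ θ → θ ≤ 8 →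
      2 * 84500 * prefTF a (-b) θ ^ 2 * (Real.pi / |a| + 4 / a ^ 2) ≤ C₂) :
    CoreLineLaw (max C₁ C₂) := by
  intro a b θ K c ha hb0 hb1 hθ0 hθ
  have hS0 : 0 ≤ ∑ n ∈ win K, ‖c n‖ ^ 2 / (a ^ 2 + (b + n) ^ 2) := Finset.sum_nonneg fun _ _ => by positivity
  by_cases hsmall : |a| < a₀
  · exact (hstrip a b θ K c hsmall hb0 hb1 hθ0 hθ).trans (mul_le_mul_of_nonneg_right (le_max_left _ _) hS0)
  · replace hsmall : a₀ ≤ |a| := not_lt.mp hsmall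
    rcases lt_trichotomy a 0 with hneg' | hzero | hpos'
    · have ha' : |a| = -a := abs_of_neg hneg'
      rw [ha'] at hsmall ha
      have h := lineLaw_at_neg hneg' (by linarith) hb0 hb1 hθ0 hθ K c
      have hc := hneg (-a) b θ hsmall ha hb0 hb1 hθ0 hθ
      rw [abs_neg, ha', neg_sq] at hc
      rw [ha'] at h
      exact h.trans (mul_le_mul_of_nonneg_right (hc.trans (le_max_right _ _)) hS0)
    · subst hzero
      rw [sheetAmps_zero_line, lineEnergyOut_zero]
      exact mul_nonneg (le_trans hC₁ (le_max_left _ _)) hS0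
    · have ha' : |a| = a := abs_of_pos hpos'
      rw [ha'] at hsmall ha
      have h := lineLaw_at_pos hpos' ha.le hb0 hb1 hθ0 hθ K c
      have hc := hpos a b θ hsmall ha hb0 hb1 hθ0 hθ
      rw [ha'] at hc h
      exact h.trans (mul_le_mul_of_nonneg_right (hc.trans (le_max_right _ _)) hS0)


/-! ## §6 (p2 g12) THE SCALAR BOUND ON `[1/2, 1)` BY NAME: `CoreLineLaw` ⇐ `CoreStripLaw (1/2)` (structure; the constant `7·10¹⁸` is an artefact of the cosh roof) -/

/-- `e^{-π} ≤ 1/20`. -/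
theorem exp_neg_pi_le_twentieth : Real.exp (-Real.pi) ≤ 1 / 20 := by
  have h1 : (2.7182818283 : ℝ) < Real.exp 1 := Real.exp_one_gt_d9
  have h3 : Real.exp 3 = Real.exp 1 ^ 3 := by rw [← Real.exp_nat_mul]; norm_num
  have h20 : (20 : ℝ) ≤ Real.exp 3 := by
    have h2 : (2.7182818283 : ℝ) ^ 3 ≤ Real.exp 1 ^ 3 := pow_le_pow_left₀ (by norm_num) h1.le 3
    rw [h3]; norm_num at h2 ⊢; linarith
  have hπ3 : Real.exp (-Real.pi) ≤ Real.exp (-3) := Real.exp_le_exp.2 (by linarith [Real.pi_gt_three])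
  refine hπ3.trans ?_
  rw [Real.exp_neg, inv_eq_one_div, div_le_div_iff₀ (Real.exp_pos 3) (by norm_num)]
  linarith

/-- `e^8 ≤ 2982`, hence `cosh 8 ≤ 1492`. -/
theorem cosh_eight_le : Real.cosh 8 ≤ 1492 := by
  have h1 : Real.exp 1 < 2.7182818286 := Real.exp_one_lt_d9
  have h8 : Real.exp 8 = Real.exp 1 ^ 8 := by rw [← Real.exp_nat_mul]; norm_num
  have he8 : Real.exp 8 ≤ 2982 := by
    have h2 : Real.exp 1 ^ 8 ≤ (2.7182818286 : ℝ) ^ 8 := pow_le_pow_left₀ (Real.exp_pos 1).le h1.le 8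
    rw [h8]; norm_num at h2 ⊢; linarith
  have hem : Real.exp (-8) ≤ 1 := by rw [Real.exp_le_one_iff]; norm_num
  rw [Real.cosh_eq]
  linarith

/-- `|Σ₀(a, b)| ≤ (1+q)/(2a(1−q))` for `a > 0` (`1 − 2q cos + q² ≥ (1−q)²`). -/
theorem abs_sawSigma0_le {a : ℝ} (ha : 0 < a) (b : ℝ) : |sawSigma0 a b| ≤ (1 + sawQ a) / (2 * a * (1 - sawQ a)) := by
  have hq0 : 0 < sawQ a := sawQ_pos a
  have hq1 : sawQ a < 1 := sawQ_lt_one ha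
  have hD : (1 - sawQ a) ^ 2 ≤ 1 - 2 * sawQ a * Real.cos (2 * Real.pi * b) + sawQ a ^ 2 := by
    nlinarith [Real.cos_le_one (2 * Real.pi * b)]
  have hD0 : 0 < 1 - 2 * sawQ a * Real.cos (2 * Real.pi * b) + sawQ a ^ 2 := lt_of_lt_of_le (by nlinarith) hD
  unfold sawSigma0
  rw [abs_div, abs_neg, abs_of_nonneg (by nlinarith), abs_of_pos (by positivity), div_le_div_iff₀ (by positivity) (by nlinarith)]
  have h1 : (1 - sawQ a ^ 2) * (2 * a * (1 - sawQ a)) = (1 + sawQ a) * (2 * a * (1 - sawQ a) ^ 2) := by ring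
  rw [h1]
  exact mul_le_mul_of_nonneg_left (by nlinarith [mul_le_mul_of_nonneg_left hD (by positivity : (0 : ℝ) ≤ 2 * a)]) (by linarith)

/-- `max 0 λ ≤ (2a‖S‖)²` (`λ = −a²c² = a²(4|S|² − p²)`). -/
theorem max_khLam_le {a : ℝ} (b : ℝ) : max 0 (khLam a b) ≤ (2 * a * ‖sawS a b‖) ^ 2 := by
  refine max_le (by positivity) ?_
  unfold khLam sawC2
  rw [Complex.normSq_eq_norm_sq]
  nlinarith [sq_nonneg (a * (Real.pi / 2 + 2 * sawSigma0 a b)), sq_nonneg a]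

/-- **The prefactor on `[1/2, 1]`, `θ ∈ [0, 8]`, any Bloch phase:** `prefTF a b θ ≤ 1.33·10⁶`. -/
theorem prefTF_le_of_half_le {a : ℝ} (ha0 : 1 / 2 ≤ a) (ha1 : a ≤ 1) (b : ℝ) {θ : ℝ} (hθ0 : 0 ≤ θ) (hθ : θ ≤ 8) :
    prefTF a b θ ≤ 1330000 := by
  have ha : 0 < a := by linarith
  have hπ : Real.pi < 3.1416 := Real.pi_lt_d4
  have hπ3 : 3 < Real.pi := Real.pi_gt_three
  -- q ≤ 1/20
  have hq : Real.exp (-(2 * Real.pi * a)) ≤ 1 / 20 :=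
    (Real.exp_le_exp.2 (by nlinarith : -(2 * Real.pi * a) ≤ -Real.pi)).trans exp_neg_pi_le_twentieth
  have hq0 : 0 < Real.exp (-(2 * Real.pi * a)) := Real.exp_pos _
  have hqQ : sawQ a = Real.exp (-(2 * Real.pi * a)) := rfl
  -- x² ≤ 1
  have hx : Real.exp (-(2 * Real.pi * a) / 4) ≤ 1 := by rw [Real.exp_le_one_iff]; nlinarith
  have hx0 : 0 < Real.exp (-(2 * Real.pi * a) / 4) := Real.exp_pos _
  have hN : 1 + Real.exp (-(2 * Real.pi * a)) + 2 * Real.exp (-(2 * Real.pi * a) / 4) ^ 2 ≤ 3.05 := by nlinarith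
  -- (1-q)κ² ≥ 9
  have hκ : 3 ≤ 2 * Real.pi * a := by nlinarith
  have hκ2 : 9 ≤ (2 * Real.pi * a) ^ 2 := by nlinarith
  have h1q : 0.95 ≤ 1 - Real.exp (-(2 * Real.pi * a)) := by norm_num at hq ⊢; linarith
  have hD9 : 8.5 ≤ (1 - Real.exp (-(2 * Real.pi * a))) * (2 * Real.pi * a) ^ 2 := by
    have := mul_le_mul h1q hκ2 (by norm_num) (by linarith)
    norm_num at this ⊢; linarith
  have hD0 : 0 < (1 - Real.exp (-(2 * Real.pi * a))) * (2 * Real.pi * a) ^ 2 := by linarith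
  -- ‖S‖ ≤ 1/2: √q = e^{-πa} ≤ e^{-π/2} ≤ 0.23
  have hS : ‖sawS a b‖ ≤ 1 / 2 := by
    refine (norm_sawS_le ha b).trans ?_
    have hsq : Real.sqrt (sawQ a) ≤ 0.23 := by
      have e : Real.sqrt (sawQ a) = Real.exp (-(Real.pi * a)) := by
        rw [show sawQ a = Real.exp (-(Real.pi * a)) ^ 2 by unfold sawQ; rw [← Real.exp_nat_mul]; congr 1; push_cast; ring]
        exact Real.sqrt_sq (Real.exp_pos _).le
      rw [e]
      exact (Real.exp_le_exp.2 (by nlinarith : -(Real.pi * a) ≤ -(Real.pi / 2))).trans exp_neg_half_pi_le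
    rw [hqQ] at *
    rw [div_le_iff₀ (by nlinarith)]
    nlinarith [Real.sqrt_nonneg (Real.exp (-(2 * Real.pi * a)))]
  have hS0 : 0 ≤ ‖sawS a b‖ := norm_nonneg _
  -- |p| ≤ 3.8
  have hσ := abs_sawSigma0_le ha b
  rw [hqQ] at hσ
  have hσ' : |sawSigma0 a b| ≤ 1.11 := by
    refine hσ.trans ?_
    rw [div_le_iff₀ (by nlinarith)]; nlinarith
  have hp : |Real.pi / 2 + 2 * sawSigma0 a b| ≤ 3.8 := by
    have := abs_add_le (Real.pi / 2) (2 * sawSigma0 a b)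
    rw [abs_of_pos (by positivity : (0 : ℝ) < Real.pi / 2), abs_mul, abs_two] at this
    linarith
  -- cosh roof ≤ 1492
  have hlam : Real.sqrt (max 0 (khLam a b)) ≤ 1 := by
    have h := max_khLam_le (a := a) b
    have h2 : (2 * a * ‖sawS a b‖) ^ 2 ≤ 1 := by
      have : 2 * a * ‖sawS a b‖ ≤ 1 := by nlinarith
      have h0 : 0 ≤ 2 * a * ‖sawS a b‖ := by positivity
      nlinarith
    calc Real.sqrt (max 0 (khLam a b)) ≤ Real.sqrt 1 := Real.sqrt_le_sqrt (h.trans h2)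
      _ = 1 := Real.sqrt_one
  have hcosh : Real.cosh (Real.sqrt (max 0 (khLam a b)) * θ) ≤ 1492 := by
    refine le_trans ?_ cosh_eight_le
    rw [Real.cosh_le_cosh, abs_of_nonneg (mul_nonneg (Real.sqrt_nonneg _) hθ0)]
    rw [show |(8 : ℝ)| = 1 * 8 by norm_num]
    exact mul_le_mul hlam hθ (by linarith) (by norm_num)
  have hcosh0 : 0 < Real.cosh (Real.sqrt (max 0 (khLam a b)) * θ) := Real.cosh_pos _
  -- assemble
  have h4πa : 4 * Real.pi * a ≤ 12.57 := by nlinarith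
  have h4πa0 : 0 < 4 * Real.pi * a := by positivity
  have hT : Real.cosh (Real.sqrt (max 0 (khLam a b)) * θ) * (4 * Real.pi * a) +
      θ * Real.cosh (Real.sqrt (max 0 (khLam a b)) * θ) *
        (a * |Real.pi / 2 + 2 * sawSigma0 a b| * (4 * Real.pi * a) + 2 * a * ‖sawS a b‖ * (4 * Real.pi * a)) ≤ 740000 := by
    have h1 : Real.cosh (Real.sqrt (max 0 (khLam a b)) * θ) * (4 * Real.pi * a) ≤ 1492 * 12.57 :=
      mul_le_mul hcosh h4πa h4πa0.le (by norm_num)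
    have h2 : a * |Real.pi / 2 + 2 * sawSigma0 a b| * (4 * Real.pi * a) ≤ 1 * 3.8 * 12.57 := by
      refine mul_le_mul (mul_le_mul ha1 hp (abs_nonneg _) (by norm_num)) h4πa h4πa0.le (by norm_num)
    have h3 : 2 * a * ‖sawS a b‖ * (4 * Real.pi * a) ≤ 1 * 12.57 := by
      refine mul_le_mul (by nlinarith) h4πa h4πa0.le (by norm_num)
    have h23 : 0 ≤ a * |Real.pi / 2 + 2 * sawSigma0 a b| * (4 * Real.pi * a) + 2 * a * ‖sawS a b‖ * (4 * Real.pi * a) := by positivity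
    have h4 : θ * Real.cosh (Real.sqrt (max 0 (khLam a b)) * θ) ≤ 8 * 1492 := mul_le_mul hθ hcosh hcosh0.le (by norm_num)
    have h5 : θ * Real.cosh (Real.sqrt (max 0 (khLam a b)) * θ) *
        (a * |Real.pi / 2 + 2 * sawSigma0 a b| * (4 * Real.pi * a) + 2 * a * ‖sawS a b‖ * (4 * Real.pi * a)) ≤
        (8 * 1492) * (1 * 3.8 * 12.57 + 1 * 12.57) := mul_le_mul h4 (by linarith) h23 (by norm_num)
    linarith
  have hT0 : 0 ≤ Real.cosh (Real.sqrt (max 0 (khLam a b)) * θ) * (4 * Real.pi * a) +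
      θ * Real.cosh (Real.sqrt (max 0 (khLam a b)) * θ) *
        (a * |Real.pi / 2 + 2 * sawSigma0 a b| * (4 * Real.pi * a) + 2 * a * ‖sawS a b‖ * (4 * Real.pi * a)) := by positivity
  have hfrac : (1 + Real.exp (-(2 * Real.pi * a)) + 2 * Real.exp (-(2 * Real.pi * a) / 4) ^ 2) * (1 + θ / 2) /
      ((1 - Real.exp (-(2 * Real.pi * a))) * (2 * Real.pi * a) ^ 2) ≤ 3.05 * 5 / 8.5 := by
    rw [div_le_div_iff₀ hD0 (by norm_num)]
    have hN0 : 0 ≤ 1 + Real.exp (-(2 * Real.pi * a)) + 2 * Real.exp (-(2 * Real.pi * a) / 4) ^ 2 := by positivity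
    have h1 : (1 + Real.exp (-(2 * Real.pi * a)) + 2 * Real.exp (-(2 * Real.pi * a) / 4) ^ 2) * (1 + θ / 2) ≤ 3.05 * 5 :=
      mul_le_mul hN (by linarith) (by linarith) (by norm_num)
    calc (1 + Real.exp (-(2 * Real.pi * a)) + 2 * Real.exp (-(2 * Real.pi * a) / 4) ^ 2) * (1 + θ / 2) * 8.5 ≤ 3.05 * 5 * 8.5 :=
          mul_le_mul_of_nonneg_right h1 (by norm_num)
      _ ≤ 3.05 * 5 * ((1 - Real.exp (-(2 * Real.pi * a))) * (2 * Real.pi * a) ^ 2) := mul_le_mul_of_nonneg_left hD9 (by norm_num)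
  have hfrac0 : 0 ≤ (1 + Real.exp (-(2 * Real.pi * a)) + 2 * Real.exp (-(2 * Real.pi * a) / 4) ^ 2) * (1 + θ / 2) /
      ((1 - Real.exp (-(2 * Real.pi * a))) * (2 * Real.pi * a) ^ 2) := by positivity
  have hfin : (740000 : ℝ) * (3.05 * 5 / 8.5) ≤ 1330000 := by norm_num
  unfold prefTF
  exact (mul_le_mul hT hfrac hfrac0 (by norm_num)).trans hfin

/-- **The scalar bound (ii) of `coreLineLaw_split` on `[1/2, 1)`, by name:** `2·84500·prefTF(a,b,θ)²·(π/|a| + 4/a²) ≤ 7·10¹⁸`. -/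
theorem scalar_bound_half {a : ℝ} (ha0 : 1 / 2 ≤ a) (ha1 : a < 1) (b : ℝ) {θ : ℝ} (hθ0 : 0 ≤ θ) (hθ : θ ≤ 8) :
    2 * 84500 * prefTF a b θ ^ 2 * (Real.pi / |a| + 4 / a ^ 2) ≤ 7e18 := by
  have ha : 0 < a := by linarith
  have hπ : Real.pi < 3.1416 := Real.pi_lt_d4
  have hP := prefTF_le_of_half_le ha0 ha1.le b hθ0 hθ
  have hP0 := prefTF_nonneg ha b hθ0
  have hP2 : prefTF a b θ ^ 2 ≤ 1330000 ^ 2 := pow_le_pow_left₀ hP0 hP 2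
  have hw : Real.pi / |a| + 4 / a ^ 2 ≤ 23 := by
    rw [abs_of_pos ha]
    have h1' : Real.pi / a ≤ 6.2832 := by
      rw [div_le_iff₀ ha]; nlinarith
    have h2 : 4 / a ^ 2 ≤ 16 := by
      rw [div_le_iff₀ (by positivity)]; nlinarith
    linarith
  have hw0 : 0 ≤ Real.pi / |a| + 4 / a ^ 2 := by positivity
  calc 2 * 84500 * prefTF a b θ ^ 2 * (Real.pi / |a| + 4 / a ^ 2) ≤ 2 * 84500 * 1330000 ^ 2 * 23 := by
        refine mul_le_mul (mul_le_mul_of_nonneg_left hP2 (by norm_num)) hw hw0 (by positivity)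
    _ ≤ 7e18 := by norm_num

/-- **STRUCTURE: `CoreLineLaw` FROM THE CORNER STRIP OF WIDTH 1/2.**  B1 of record (A28-9′) reduces BY NAME to the exact line-energy creation law on the lines
`|a| < 1/2` (KH band core + the corner); the lines `1/2 ≤ |a| < 1` (threshold `a ≈ 0.76` included) are covered here with the explicit (absurd, structure-only)
constant `7·10¹⁸`. -/
theorem coreLineLaw_of_strip_half {C : ℝ} (hC : 0 ≤ C) (hstrip : CoreStripLaw (1 / 2) C) : CoreLineLaw (max C 7e18) :=
  coreLineLaw_split hC hstrip (fun _ b _ ha0 ha1 _ _ hθ0 hθ => scalar_bound_half ha0 ha1 b hθ0 hθ)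
    (fun _ b _ ha0 ha1 _ _ hθ0 hθ => scalar_bound_half ha0 ha1 (-b) hθ0 hθ)


/-! ## §7 (p2 g12) THE SCALAR BOUND ON `[a₀, 1)` FOR EVERY `a₀ > 0` (explicit function of `a₀`): B1 ⇐ the corner strip of ANY width -/

/-- The explicit majorant of `prefTF` on `[a₀, 1] × ℝ × [0, 8]` (`q₀ = e^{−2πa₀}`, `s₀ = e^{−πa₀}`):
`cosh(16 s₀/(1−q₀))·12.57·(1 + 8(1.58 + 2/(1−q₀) + 2s₀/(1−q₀)))·20/(36(1−q₀)a₀²)`. -/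
def prefBound (a₀ : ℝ) : ℝ :=
  Real.cosh (8 * (2 * Real.exp (-(Real.pi * a₀)) / (1 - Real.exp (-(2 * Real.pi * a₀))))) * 12.57 *
      (1 + 8 * (1.58 + 2 / (1 - Real.exp (-(2 * Real.pi * a₀))) + 2 * Real.exp (-(Real.pi * a₀)) / (1 - Real.exp (-(2 * Real.pi * a₀))))) *
    (20 / (36 * (1 - Real.exp (-(2 * Real.pi * a₀))) * a₀ ^ 2))

/-- **The prefactor on `[a₀, 1]` for any `0 < a₀`:** `prefTF a b θ ≤ prefBound a₀` (every Bloch phase, `θ ∈ [0,8]`). -/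
theorem prefTF_le_prefBound {a₀ a : ℝ} (ha₀ : 0 < a₀) (ha0 : a₀ ≤ a) (ha1 : a ≤ 1) (b : ℝ) {θ : ℝ} (hθ0 : 0 ≤ θ) (hθ : θ ≤ 8) :
    prefTF a b θ ≤ prefBound a₀ := by
  have ha : 0 < a := by linarith
  have hπ : Real.pi < 3.1416 := Real.pi_lt_d4
  have hπ3 : 3 < Real.pi := Real.pi_gt_three
  set q := Real.exp (-(2 * Real.pi * a)) with hqdef
  set q₀ := Real.exp (-(2 * Real.pi * a₀)) with hq₀def
  set s₀ := Real.exp (-(Real.pi * a₀)) with hs₀def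
  have hq0 : 0 < q := Real.exp_pos _
  have hq1 : q < 1 := Real.exp_lt_one_iff.2 (by nlinarith [Real.pi_pos])
  have hq₀1 : q₀ < 1 := Real.exp_lt_one_iff.2 (by nlinarith [Real.pi_pos])
  have hqq₀ : q ≤ q₀ := Real.exp_le_exp.2 (by nlinarith [Real.pi_pos])
  have h1q : 1 - q₀ ≤ 1 - q := by linarith
  have h1q₀ : 0 < 1 - q₀ := by linarith
  have hs₀0 : 0 < s₀ := Real.exp_pos _
  have hqQ : sawQ a = q := rfl
  -- N ≤ 4
  have hx : Real.exp (-(2 * Real.pi * a) / 4) ≤ 1 := by rw [Real.exp_le_one_iff]; nlinarith [Real.pi_pos]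
  have hx0 : 0 < Real.exp (-(2 * Real.pi * a) / 4) := Real.exp_pos _
  have hN : 1 + q + 2 * Real.exp (-(2 * Real.pi * a) / 4) ^ 2 ≤ 4 := by nlinarith
  -- D ≥ 36 (1 − q₀) a₀²
  have hκ : 6 * a₀ ≤ 2 * Real.pi * a := by nlinarith
  have hκ2 : 36 * a₀ ^ 2 ≤ (2 * Real.pi * a) ^ 2 := by nlinarith
  have hD : 36 * (1 - q₀) * a₀ ^ 2 ≤ (1 - q) * (2 * Real.pi * a) ^ 2 := by
    calc 36 * (1 - q₀) * a₀ ^ 2 = (1 - q₀) * (36 * a₀ ^ 2) := by ring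
      _ ≤ (1 - q) * (2 * Real.pi * a) ^ 2 := mul_le_mul h1q hκ2 (by positivity) (by linarith)
  have hD0' : 0 < 36 * (1 - q₀) * a₀ ^ 2 := by positivity
  have hD0 : 0 < (1 - q) * (2 * Real.pi * a) ^ 2 := lt_of_lt_of_le hD0' hD
  -- 2a‖S‖ ≤ 2 s₀/(1−q₀)
  have hsq : Real.sqrt (sawQ a) ≤ s₀ := by
    have e : Real.sqrt (sawQ a) = Real.exp (-(Real.pi * a)) := by
      rw [show sawQ a = Real.exp (-(Real.pi * a)) ^ 2 by unfold sawQ; rw [← Real.exp_nat_mul]; congr 1; push_cast; ring]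
      exact Real.sqrt_sq (Real.exp_pos _).le
    rw [e]; exact Real.exp_le_exp.2 (by nlinarith [Real.pi_pos])
  have hS := norm_sawS_le ha b
  rw [hqQ] at hS
  have hS0 : 0 ≤ ‖sawS a b‖ := norm_nonneg _
  have hL : 2 * a * ‖sawS a b‖ ≤ 2 * s₀ / (1 - q₀) := by
    have h1 : 2 * a * ‖sawS a b‖ ≤ 2 * a * (Real.sqrt q / (a * (1 - q))) := mul_le_mul_of_nonneg_left hS (by positivity)
    have h2 : 2 * a * (Real.sqrt q / (a * (1 - q))) = 2 * Real.sqrt q / (1 - q) := by field_simp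
    rw [h2] at h1
    refine h1.trans ?_
    rw [div_le_div_iff₀ (by linarith) h1q₀]
    have hsq' : Real.sqrt q ≤ s₀ := hsq
    calc 2 * Real.sqrt q * (1 - q₀) ≤ 2 * s₀ * (1 - q₀) :=
          mul_le_mul_of_nonneg_right (mul_le_mul_of_nonneg_left hsq' (by norm_num)) h1q₀.le
      _ ≤ 2 * s₀ * (1 - q) := mul_le_mul_of_nonneg_left h1q (by positivity)
  have hL0 : 0 ≤ 2 * s₀ / (1 - q₀) := by positivity
  -- a|p| ≤ 1.58 + 2/(1−q₀)
  have hσ := abs_sawSigma0_le ha b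
  rw [hqQ] at hσ
  have hap : a * |Real.pi / 2 + 2 * sawSigma0 a b| ≤ 1.58 + 2 / (1 - q₀) := by
    have h1 : |Real.pi / 2 + 2 * sawSigma0 a b| ≤ Real.pi / 2 + 2 * |sawSigma0 a b| := by
      have := abs_add_le (Real.pi / 2) (2 * sawSigma0 a b)
      rw [abs_of_pos (by positivity : (0 : ℝ) < Real.pi / 2), abs_mul, abs_two] at this
      exact this
    have h2 : a * (2 * |sawSigma0 a b|) ≤ (1 + q) / (1 - q) := by
      calc a * (2 * |sawSigma0 a b|) ≤ a * (2 * ((1 + q) / (2 * a * (1 - q)))) := by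
            exact mul_le_mul_of_nonneg_left (mul_le_mul_of_nonneg_left hσ (by norm_num)) ha.le
        _ = (1 + q) / (1 - q) := by field_simp
    have h3 : (1 + q) / (1 - q) ≤ 2 / (1 - q₀) := by
      rw [div_le_div_iff₀ (by linarith) h1q₀]; nlinarith
    have h4 : a * (Real.pi / 2) ≤ 1.58 := by
      have : a * (Real.pi / 2) ≤ 1 * (Real.pi / 2) := mul_le_mul_of_nonneg_right ha1 (by positivity)
      linarith
    calc a * |Real.pi / 2 + 2 * sawSigma0 a b| ≤ a * (Real.pi / 2 + 2 * |sawSigma0 a b|) := mul_le_mul_of_nonneg_left h1 ha.le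
      _ = a * (Real.pi / 2) + a * (2 * |sawSigma0 a b|) := by ring
      _ ≤ 1.58 + 2 / (1 - q₀) := by linarith
  -- cosh roof
  have hlam : Real.sqrt (max 0 (khLam a b)) ≤ 2 * s₀ / (1 - q₀) := by
    have h := max_khLam_le (a := a) b
    calc Real.sqrt (max 0 (khLam a b)) ≤ Real.sqrt ((2 * a * ‖sawS a b‖) ^ 2) := Real.sqrt_le_sqrt h
      _ = 2 * a * ‖sawS a b‖ := Real.sqrt_sq (by positivity)
      _ ≤ 2 * s₀ / (1 - q₀) := hL
  have hcosh : Real.cosh (Real.sqrt (max 0 (khLam a b)) * θ) ≤ Real.cosh (8 * (2 * s₀ / (1 - q₀))) := by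
    rw [Real.cosh_le_cosh, abs_of_nonneg (mul_nonneg (Real.sqrt_nonneg _) hθ0), abs_of_nonneg (by positivity)]
    calc Real.sqrt (max 0 (khLam a b)) * θ ≤ (2 * s₀ / (1 - q₀)) * 8 := mul_le_mul hlam hθ hθ0 hL0
      _ = 8 * (2 * s₀ / (1 - q₀)) := by ring
  have hcosh0 : 0 < Real.cosh (Real.sqrt (max 0 (khLam a b)) * θ) := Real.cosh_pos _
  set Ch := Real.cosh (8 * (2 * s₀ / (1 - q₀))) with hCh
  have hCh1 : 1 ≤ Ch := Real.one_le_cosh _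
  -- TF ≤ Ch·12.57·(1 + 8(1.58 + 2/(1−q₀) + 2s₀/(1−q₀)))
  have h4πa : 4 * Real.pi * a ≤ 12.57 := by
    have h1 : 4 * Real.pi * a ≤ 4 * Real.pi * 1 := mul_le_mul_of_nonneg_left ha1 (by positivity)
    linarith
  have h4πa0 : 0 < 4 * Real.pi * a := by positivity
  have hT : Real.cosh (Real.sqrt (max 0 (khLam a b)) * θ) * (4 * Real.pi * a) +
      θ * Real.cosh (Real.sqrt (max 0 (khLam a b)) * θ) *
        (a * |Real.pi / 2 + 2 * sawSigma0 a b| * (4 * Real.pi * a) + 2 * a * ‖sawS a b‖ * (4 * Real.pi * a)) ≤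
      Ch * 12.57 * (1 + 8 * (1.58 + 2 / (1 - q₀) + 2 * s₀ / (1 - q₀))) := by
    have h1 : Real.cosh (Real.sqrt (max 0 (khLam a b)) * θ) * (4 * Real.pi * a) ≤ Ch * 12.57 :=
      mul_le_mul hcosh h4πa h4πa0.le (by linarith)
    have h23 : a * |Real.pi / 2 + 2 * sawSigma0 a b| * (4 * Real.pi * a) + 2 * a * ‖sawS a b‖ * (4 * Real.pi * a) ≤
        (1.58 + 2 / (1 - q₀) + 2 * s₀ / (1 - q₀)) * 12.57 := by
      rw [← add_mul]
      exact mul_le_mul (add_le_add hap hL) h4πa h4πa0.le (by positivity)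
    have h230 : 0 ≤ a * |Real.pi / 2 + 2 * sawSigma0 a b| * (4 * Real.pi * a) + 2 * a * ‖sawS a b‖ * (4 * Real.pi * a) := by positivity
    have h4 : θ * Real.cosh (Real.sqrt (max 0 (khLam a b)) * θ) ≤ 8 * Ch := mul_le_mul hθ hcosh hcosh0.le (by norm_num)
    have h5 : θ * Real.cosh (Real.sqrt (max 0 (khLam a b)) * θ) *
        (a * |Real.pi / 2 + 2 * sawSigma0 a b| * (4 * Real.pi * a) + 2 * a * ‖sawS a b‖ * (4 * Real.pi * a)) ≤
        (8 * Ch) * ((1.58 + 2 / (1 - q₀) + 2 * s₀ / (1 - q₀)) * 12.57) := mul_le_mul h4 h23 h230 (by positivity)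
    have : Ch * 12.57 + (8 * Ch) * ((1.58 + 2 / (1 - q₀) + 2 * s₀ / (1 - q₀)) * 12.57) =
        Ch * 12.57 * (1 + 8 * (1.58 + 2 / (1 - q₀) + 2 * s₀ / (1 - q₀))) := by ring
    linarith
  -- the fraction ≤ 20/(36(1−q₀)a₀²)
  have hfrac : (1 + q + 2 * Real.exp (-(2 * Real.pi * a) / 4) ^ 2) * (1 + θ / 2) / ((1 - q) * (2 * Real.pi * a) ^ 2) ≤
      20 / (36 * (1 - q₀) * a₀ ^ 2) := by
    rw [div_le_div_iff₀ hD0 hD0']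
    have hN0 : 0 ≤ 1 + q + 2 * Real.exp (-(2 * Real.pi * a) / 4) ^ 2 := by positivity
    have h1 : (1 + q + 2 * Real.exp (-(2 * Real.pi * a) / 4) ^ 2) * (1 + θ / 2) ≤ 4 * 5 := mul_le_mul hN (by linarith) (by linarith) (by norm_num)
    calc (1 + q + 2 * Real.exp (-(2 * Real.pi * a) / 4) ^ 2) * (1 + θ / 2) * (36 * (1 - q₀) * a₀ ^ 2) ≤ (4 * 5) * (36 * (1 - q₀) * a₀ ^ 2) :=
          mul_le_mul_of_nonneg_right h1 hD0'.le
      _ ≤ 20 * ((1 - q) * (2 * Real.pi * a) ^ 2) := by nlinarith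
  have hfrac0 : 0 ≤ (1 + q + 2 * Real.exp (-(2 * Real.pi * a) / 4) ^ 2) * (1 + θ / 2) / ((1 - q) * (2 * Real.pi * a) ^ 2) := by positivity
  unfold prefTF prefBound
  exact mul_le_mul hT hfrac hfrac0 (by positivity)

/-- **`CoreLineLaw` FROM THE CORNER STRIP OF ANY WIDTH `a₀ > 0`, BY NAME** — explicit constant
`C₂(a₀) = 2·84500·prefBound(a₀)²·(π/a₀ + 4/a₀²)`.  B1 of record is thereby the exact line-energy creation law on `|a| < a₀` for as small an `a₀` as one likes:
the corner `a → 0⁺` is all that is left (the constant explodes like `cosh(16/(πa₀))²/a₀⁶`; structure only). -/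
theorem coreLineLaw_of_strip {a₀ C : ℝ} (ha₀ : 0 < a₀) (hC : 0 ≤ C) (hstrip : CoreStripLaw a₀ C) :
    CoreLineLaw (max C (2 * 84500 * prefBound a₀ ^ 2 * (Real.pi / a₀ + 4 / a₀ ^ 2))) := by
  have key : ∀ a b θ : ℝ, a₀ ≤ a → a < 1 → 0 ≤ θ → θ ≤ 8 →
      2 * 84500 * prefTF a b θ ^ 2 * (Real.pi / |a| + 4 / a ^ 2) ≤ 2 * 84500 * prefBound a₀ ^ 2 * (Real.pi / a₀ + 4 / a₀ ^ 2) := by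
    intro a b θ h0 h1 hθ0 hθ
    have ha : 0 < a := by linarith
    have hP := prefTF_le_prefBound ha₀ h0 h1.le b hθ0 hθ
    have hP0 := prefTF_nonneg ha b hθ0
    have hP2 : prefTF a b θ ^ 2 ≤ prefBound a₀ ^ 2 := pow_le_pow_left₀ hP0 hP 2
    have hw : Real.pi / |a| + 4 / a ^ 2 ≤ Real.pi / a₀ + 4 / a₀ ^ 2 := by
      rw [abs_of_pos ha]
      refine add_le_add (div_le_div_of_nonneg_left Real.pi_pos.le ha₀ h0) (div_le_div_of_nonneg_left (by norm_num) (by positivity) ?_)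
      exact pow_le_pow_left₀ ha₀.le h0 2
    have hw0 : 0 ≤ Real.pi / |a| + 4 / a ^ 2 := by positivity
    exact mul_le_mul (mul_le_mul_of_nonneg_left hP2 (by norm_num)) hw hw0 (by positivity)
  exact coreLineLaw_split hC hstrip (fun a b θ h0 h1 _ _ hθ0 hθ => key a b θ h0 h1 hθ0 hθ)
    (fun a b θ h0 h1 _ _ hθ0 hθ => key a (-b) θ h0 h1 hθ0 hθ)


/-! ## §8 (p2 g12) THE CORNER MECHANISM — algebraic part (memo §30: the pole block is nilpotent, kills the antisymmetric pole forcing, and the pair built on it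
has no even columns).  The analytic part (pole decomposition of `lineKernel`, Duhamel on the split forcing) is the successor's. -/

/-- The pole block `Mb = [1, e^{iπb}; −e^{−iπb}, −1]` (the `1/(a²+b²)`-part of `blockX/(2πa·i·2P)` near the corner). -/
def poleM (b : ℝ) : Matrix (Fin 2) (Fin 2) ℂ :=
  !![1, Complex.exp ((Real.pi : ℂ) * (b : ℂ) * Complex.I); -Complex.exp (-((Real.pi : ℂ) * (b : ℂ) * Complex.I)), -1]

/-- The antisymmetric kink-pair direction `v_b = (e^{iπb/2}, −e^{−iπb/2})` (the pole part of the forcing is a scalar multiple of it). -/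
def poleV (b : ℝ) : Fin 2 → ℂ :=
  ![Complex.exp ((Real.pi : ℂ) * (b : ℂ) / 2 * Complex.I), -Complex.exp (-((Real.pi : ℂ) * (b : ℂ) / 2 * Complex.I))]

/-- `e^{iπb}·e^{−iπb} = 1`. -/
theorem exp_pib_mul_exp_neg (b : ℝ) :
    Complex.exp ((Real.pi : ℂ) * (b : ℂ) * Complex.I) * Complex.exp (-((Real.pi : ℂ) * (b : ℂ) * Complex.I)) = 1 := by
  rw [← Complex.exp_add, add_neg_cancel, Complex.exp_zero]

/-- **(M2) The pole block is NILPOTENT:** `Mb² = 0` — which is why `khLam = X² → 0` at the corner while `‖X‖ ~ 1/a`. -/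
theorem poleM_sq (b : ℝ) : poleM b * poleM b = 0 := by
  have h := exp_pib_mul_exp_neg b
  have h' : Complex.exp (-((Real.pi : ℂ) * (b : ℂ) * Complex.I)) * Complex.exp ((Real.pi : ℂ) * (b : ℂ) * Complex.I) = 1 := by rw [mul_comm]; exact h
  ext i j
  fin_cases i <;> fin_cases j <;>
    simp only [poleM, Matrix.mul_apply, Fin.sum_univ_two, Matrix.of_apply, Matrix.cons_val', Matrix.cons_val_zero, Matrix.cons_val_one,
      Matrix.cons_val_fin_one, Matrix.zero_apply, Fin.isValue, Fin.zero_eta, Fin.mk_one] <;>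
    first | (linear_combination (-1 : ℂ) * h) | (linear_combination (-1 : ℂ) * h') | ring1

/-- **(M3, first kill) The pole block annihilates the antisymmetric pole forcing:** `Mb · v_b = 0`. -/
theorem poleM_mulVec_poleV (b : ℝ) : (poleM b).mulVec (poleV b) = 0 := by
  have h1 : Complex.exp ((Real.pi : ℂ) * (b : ℂ) * Complex.I) * Complex.exp (-((Real.pi : ℂ) * (b : ℂ) / 2 * Complex.I)) =
      Complex.exp ((Real.pi : ℂ) * (b : ℂ) / 2 * Complex.I) := by
    rw [← Complex.exp_add]; congr 1; ring
  have h2 : Complex.exp (-((Real.pi : ℂ) * (b : ℂ) * Complex.I)) * Complex.exp ((Real.pi : ℂ) * (b : ℂ) / 2 * Complex.I) =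
      Complex.exp (-((Real.pi : ℂ) * (b : ℂ) / 2 * Complex.I)) := by
    rw [← Complex.exp_add]; congr 1; ring
  ext i
  fin_cases i
  · simp only [poleM, poleV, Matrix.mulVec, dotProduct, Fin.sum_univ_two, Matrix.of_apply, Matrix.cons_val', Matrix.cons_val_zero,
      Matrix.cons_val_one, Matrix.cons_val_fin_one, Pi.zero_apply, Fin.isValue, Fin.zero_eta]
    linear_combination (-1 : ℂ) * h1
  · simp only [poleM, poleV, Matrix.mulVec, dotProduct, Fin.sum_univ_two, Matrix.of_apply, Matrix.cons_val', Matrix.cons_val_zero,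
      Matrix.cons_val_one, Matrix.cons_val_fin_one, Pi.zero_apply, Fin.isValue, Fin.mk_one]
    linear_combination (-1 : ℂ) * h2

/-- **(M3, second kill) A straight pair built on `v_b` has NO EVEN COLUMNS:** its lattice mode on column `b + n` (the `hPairState` combination) is
`c·(e^{−iπn/2} − e^{iπn/2})`, which vanishes for even `n` — in particular on the corner column `n = 0`, the only one with the dangerous weight `1/(a²+b²)`. -/
theorem poleV_pair_mode (b : ℝ) (c : ℂ) (n : ℤ) :
    (c • poleV b) 0 * Complex.exp (-(Real.pi * (b + n) / 2 : ℝ) * Complex.I) + (c • poleV b) 1 * Complex.exp ((Real.pi * (b + n) / 2 : ℝ) * Complex.I) =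
      c * (Complex.exp (-((Real.pi : ℂ) * (n : ℂ) / 2 * Complex.I)) - Complex.exp ((Real.pi : ℂ) * (n : ℂ) / 2 * Complex.I)) := by
  have e1 : Complex.exp ((Real.pi : ℂ) * (b : ℂ) / 2 * Complex.I) * Complex.exp (-(Real.pi * (b + n) / 2 : ℝ) * Complex.I) =
      Complex.exp (-((Real.pi : ℂ) * (n : ℂ) / 2 * Complex.I)) := by
    rw [← Complex.exp_add]; congr 1; push_cast; ring
  have e2 : Complex.exp (-((Real.pi : ℂ) * (b : ℂ) / 2 * Complex.I)) * Complex.exp ((Real.pi * (b + n) / 2 : ℝ) * Complex.I) =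
      Complex.exp ((Real.pi : ℂ) * (n : ℂ) / 2 * Complex.I) := by
    rw [← Complex.exp_add]; congr 1; push_cast; ring
  simp only [poleV, Pi.smul_apply, smul_eq_mul, Matrix.cons_val_zero, Matrix.cons_val_one]
  rw [mul_assoc, e1]
  rw [mul_assoc, neg_mul, e2]
  ring

/-- `e^{−iπk} = e^{iπk}` for an integer `k` (both are `(−1)^k`). -/
theorem exp_neg_pi_int_mul_I (k : ℤ) :
    Complex.exp (-((Real.pi : ℂ) * ((2 * k : ℤ) : ℂ) / 2 * Complex.I)) = Complex.exp ((Real.pi : ℂ) * ((2 * k : ℤ) : ℂ) / 2 * Complex.I) := by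
  have h2 : Complex.exp ((Real.pi : ℂ) * ((2 * k : ℤ) : ℂ) / 2 * Complex.I) * Complex.exp ((Real.pi : ℂ) * ((2 * k : ℤ) : ℂ) / 2 * Complex.I) = 1 := by
    rw [← Complex.exp_add, Complex.exp_eq_one_iff]
    refine ⟨k, ?_⟩
    push_cast; ring
  rw [Complex.exp_neg]
  exact (eq_inv_of_mul_eq_one_left h2).symm

/-- The even columns of the pair on `v_b` vanish. -/
theorem poleV_pair_mode_even (b : ℝ) (c : ℂ) (k : ℤ) :
    (c • poleV b) 0 * Complex.exp (-(Real.pi * (b + ((2 * k : ℤ) : ℝ)) / 2 : ℝ) * Complex.I) +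
      (c • poleV b) 1 * Complex.exp ((Real.pi * (b + ((2 * k : ℤ) : ℝ)) / 2 : ℝ) * Complex.I) = 0 := by
  rw [poleV_pair_mode, exp_neg_pi_int_mul_I, sub_self, mul_zero]



/-! ## §9 (p2 g13) `β`-periodicity of the typed objects (for the window shift `b ↦ b − 1` on `b ∈ (½, 1]`) -/

/-- `e^{2πi(β+1)} = e^{2πiβ}`. -/
theorem cexp_two_pi_add_one (β : ℝ) :
    Complex.exp (2 * Real.pi * (((β + 1 : ℝ)) : ℂ) * Complex.I) = Complex.exp (2 * Real.pi * (β : ℂ) * Complex.I) := by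
  push_cast
  rw [show 2 * (Real.pi : ℂ) * ((β : ℂ) + 1) * Complex.I = 2 * Real.pi * β * Complex.I + 2 * Real.pi * Complex.I by ring, Complex.exp_add,
    Complex.exp_two_pi_mul_I, mul_one]

/-- The kernel is `1`-periodic in the Bloch phase. -/
theorem lineKernel_add_one (a β y : ℝ) : lineKernel a (β + 1) y = lineKernel a β y := by
  have h1 := cexp_two_pi_add_one β
  have h2 : Complex.exp (2 * Real.pi * (((β + 1 : ℝ)) : ℂ) * (⌊y⌋ : ℝ) * Complex.I) = Complex.exp (2 * Real.pi * (β : ℂ) * (⌊y⌋ : ℝ) * Complex.I) := by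
    push_cast
    rw [show 2 * (Real.pi : ℂ) * ((β : ℂ) + 1) * ((⌊y⌋ : ℤ) : ℂ) * Complex.I =
        2 * Real.pi * β * ((⌊y⌋ : ℤ) : ℂ) * Complex.I + ((⌊y⌋ : ℤ) : ℂ) * (2 * Real.pi * Complex.I) by ring,
      Complex.exp_add, Complex.exp_int_mul_two_pi_mul_I, mul_one]
  simp only [lineKernel]
  rw [h1, h2]

/-- `Σ₀` is `1`-periodic in the Bloch phase. -/
theorem sawSigma0_add_one (k β : ℝ) : sawSigma0 k (β + 1) = sawSigma0 k β := by
  unfold sawSigma0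
  rw [show 2 * Real.pi * (β + 1) = 2 * Real.pi * β + 2 * Real.pi by ring, Real.cos_add_two_pi]

/-- `S` is `1`-periodic in the Bloch phase. -/
theorem sawS_add_one (k β : ℝ) : sawS k (β + 1) = sawS k β := by
  have h : Complex.exp (((2 * Real.pi * (β + 1) : ℝ) : ℂ) * Complex.I) = Complex.exp (((2 * Real.pi * β : ℝ) : ℂ) * Complex.I) := by
    rw [show ((2 * Real.pi * (β + 1) : ℝ) : ℂ) * Complex.I = ((2 * Real.pi * β : ℝ) : ℂ) * Complex.I + 2 * Real.pi * Complex.I by push_cast; ring,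
      Complex.exp_add, Complex.exp_two_pi_mul_I, mul_one]
  simp only [sawS]
  rw [h]

/-- `c²`, `λ`, the propagator scalars, the block, the propagator, the forcing and the created amplitudes are `1`-periodic in the Bloch phase. -/
theorem sawC2_add_one (k β : ℝ) : sawC2 k (β + 1) = sawC2 k β := by
  unfold sawC2; rw [sawSigma0_add_one, sawS_add_one]

theorem khLam_add_one (a β : ℝ) : khLam a (β + 1) = khLam a β := by
  unfold khLam; rw [sawC2_add_one]

theorem propC_add_one (a β t : ℝ) : propC a (β + 1) t = propC a β t := by
  simp only [propC, khLam_add_one]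

theorem propSn_add_one (a β t : ℝ) : propSn a (β + 1) t = propSn a β t := by
  simp only [propSn, khLam_add_one]

theorem blockX_add_one (a β : ℝ) : blockX a (β + 1) = blockX a β := by
  simp only [blockX, lineKernel_add_one]

theorem propagator_add_one (a β t : ℝ) : propagator a (β + 1) t = propagator a β t := by
  simp only [propagator, propC_add_one, propSn_add_one, blockX_add_one]

theorem forcing_add_one (a β : ℝ) (st : LamState) (s : ℝ) : forcing a (β + 1) st s = forcing a β st s := by
  simp only [forcing, lineKernel_add_one]

theorem sheetAmps_add_one (a β θ : ℝ) (st : LamState) : sheetAmps a (β + 1) θ st = sheetAmps a β θ st := by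
  simp only [sheetAmps, propagator_add_one, forcing_add_one]

theorem sheetAmps_sub_one (a β θ : ℝ) (st : LamState) : sheetAmps a (β - 1) θ st = sheetAmps a β θ st := by
  rw [← sheetAmps_add_one a (β - 1), sub_add_cancel]

/-! ## §10 (p2 g13) The window shift: the law at `(a, b − 1, K + 1)` gives the law at `(a, b, K)` -/

/-- The coefficient row shifted by one lattice step (window `K ↦ K + 1`). -/
def shiftCoef (K : ℕ) (c : ℤ → ℂ) : ℤ → ℂ := fun m => if m - 1 ∈ win K then c (m - 1) else 0

theorem mem_win_succ_of {K : ℕ} {n : ℤ} (hn : n ∈ win K) : n + 1 ∈ win (K + 1) := by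
  simp only [win, Finset.mem_Icc] at hn ⊢; push_cast; omega

theorem map_win_subset (K : ℕ) : (win K).map (addRightEmbedding (1 : ℤ)) ⊆ win (K + 1) := by
  intro m hm
  rw [Finset.mem_map] at hm
  obtain ⟨n, hn, rfl⟩ := hm
  exact mem_win_succ_of hn

/-- A sum over the shifted window of a function vanishing off the image of the shift. -/
theorem sum_win_shift {M : Type*} [AddCommMonoid M] (K : ℕ) (g : ℤ → M) (hg : ∀ m ∈ win (K + 1), m - 1 ∉ win K → g m = 0) :
    ∑ m ∈ win (K + 1), g m = ∑ n ∈ win K, g (n + 1) := by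
  rw [← Finset.sum_subset (map_win_subset K) (fun m hm hnot => hg m hm (fun h => hnot ?_)), Finset.sum_map]
  · rfl
  · rw [Finset.mem_map]; exact ⟨m - 1, h, by simp⟩

/-- The profile of the class `b` at window `K` IS the profile of the class `b − 1` at window `K + 1` with shifted coefficients. -/
theorem modeProfile_shift (b : ℝ) (K : ℕ) (c : ℤ → ℂ) : modeProfile b K c = modeProfile (b - 1) (K + 1) (shiftCoef K c) := by
  funext y
  simp only [modeProfile]
  rw [sum_win_shift K _ (fun m _ hm => by simp [shiftCoef, hm])]
  refine Finset.sum_congr rfl fun n hn => ?_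
  simp only [shiftCoef, add_sub_cancel_right, if_pos hn]
  congr 2; push_cast; ring

/-- The input energy is unchanged by the shift. -/
theorem energyIn_shift (a b : ℝ) (K : ℕ) (c : ℤ → ℂ) :
    ∑ m ∈ win (K + 1), ‖shiftCoef K c m‖ ^ 2 / (a ^ 2 + (b - 1 + m) ^ 2) = ∑ n ∈ win K, ‖c n‖ ^ 2 / (a ^ 2 + (b + n) ^ 2) := by
  rw [sum_win_shift K _ (fun m _ hm => by simp [shiftCoef, hm])]
  refine Finset.sum_congr rfl fun n hn => ?_
  simp only [shiftCoef, add_sub_cancel_right, if_pos hn]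
  push_cast; ring_nf

/-- The output line energy only grows under the shift (the window gains two columns). -/
theorem lineEnergyOut_shift_le (a b : ℝ) (K : ℕ) (q : Fin 2 → ℂ) :
    lineEnergyOut a b K q ≤ lineEnergyOut a (b - 1) (K + 1) q := by
  unfold lineEnergyOut
  have e : ∀ n : ℤ, ‖q 0 * Complex.exp (-(Real.pi * (b + n) / 2 : ℝ) * Complex.I) + q 1 * Complex.exp ((Real.pi * (b + n) / 2 : ℝ) * Complex.I)‖ ^ 2 /
        (a ^ 2 + (b + n) ^ 2) =
      ‖q 0 * Complex.exp (-(Real.pi * (b - 1 + ((n + 1 : ℤ) : ℝ)) / 2 : ℝ) * Complex.I) + q 1 * Complex.exp ((Real.pi * (b - 1 + ((n + 1 : ℤ) : ℝ)) / 2 : ℝ) * Complex.I)‖ ^ 2 /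
        (a ^ 2 + (b - 1 + ((n + 1 : ℤ) : ℝ)) ^ 2) := by
    intro n; push_cast; ring_nf
  calc ∑ n ∈ win K, ‖q 0 * Complex.exp (-(Real.pi * (b + n) / 2 : ℝ) * Complex.I) + q 1 * Complex.exp ((Real.pi * (b + n) / 2 : ℝ) * Complex.I)‖ ^ 2 /
          (a ^ 2 + (b + n) ^ 2)
      = ∑ n ∈ win K, ‖q 0 * Complex.exp (-(Real.pi * (b - 1 + ((n + 1 : ℤ) : ℝ)) / 2 : ℝ) * Complex.I) +
            q 1 * Complex.exp ((Real.pi * (b - 1 + ((n + 1 : ℤ) : ℝ)) / 2 : ℝ) * Complex.I)‖ ^ 2 / (a ^ 2 + (b - 1 + ((n + 1 : ℤ) : ℝ)) ^ 2) :=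
        Finset.sum_congr rfl fun n _ => e n
    _ = ∑ m ∈ (win K).map (addRightEmbedding (1 : ℤ)), ‖q 0 * Complex.exp (-(Real.pi * (b - 1 + m) / 2 : ℝ) * Complex.I) +
            q 1 * Complex.exp ((Real.pi * (b - 1 + m) / 2 : ℝ) * Complex.I)‖ ^ 2 / (a ^ 2 + (b - 1 + m) ^ 2) := by
        rw [Finset.sum_map]; rfl
    _ ≤ _ := Finset.sum_le_sum_of_subset_of_nonneg (map_win_subset K) fun _ _ _ => by positivity

/-- **The window shift:** the law (constant `C`) for `(a, b − 1)` at window `K + 1` and shifted coefficients gives the law for `(a, b)` at window `K`. -/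
theorem lineLaw_of_shift {a b θ C : ℝ} {K : ℕ} {c : ℤ → ℂ}
    (h : lineEnergyOut a (b - 1) (K + 1) (sheetAmps a (b - 1) θ ⟨modeProfile (b - 1) (K + 1) (shiftCoef K c), []⟩) ≤
      C * ∑ m ∈ win (K + 1), ‖shiftCoef K c m‖ ^ 2 / (a ^ 2 + (b - 1 + m) ^ 2)) :
    lineEnergyOut a b K (sheetAmps a b θ ⟨modeProfile b K c, []⟩) ≤ C * ∑ n ∈ win K, ‖c n‖ ^ 2 / (a ^ 2 + (b + n) ^ 2) := by
  rw [energyIn_shift] at h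
  have hq : sheetAmps a b θ ⟨modeProfile b K c, []⟩ = sheetAmps a (b - 1) θ ⟨modeProfile (b - 1) (K + 1) (shiftCoef K c), []⟩ := by
    rw [← modeProfile_shift, sheetAmps_sub_one]
  rw [hq]
  exact (lineEnergyOut_shift_le a b K _).trans h

/-! ## §11 (p2 g13) Negative lines: the law at `(−a, −b)` for the reflected conjugated coefficients gives the law at `(a, b)` -/

/-- The output line energy of the conjugated pair at `(a, b)` is that of the pair at `(−a, −b)`. -/
theorem lineEnergyOut_conj (a b : ℝ) (K : ℕ) (q : Fin 2 → ℂ) :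
    lineEnergyOut a b K (fun i => starRingEnd ℂ (q i)) = lineEnergyOut (-a) (-b) K q := by
  unfold lineEnergyOut
  refine Finset.sum_nbij' (fun n => -n) (fun n => -n) (fun n hn => by simp only [win, Finset.mem_Icc] at hn ⊢; omega)
    (fun n hn => by simp only [win, Finset.mem_Icc] at hn ⊢; omega) (fun n _ => neg_neg n) (fun n _ => neg_neg n) (fun n _ => ?_)
  have e : starRingEnd ℂ (q 0) * Complex.exp (-(Real.pi * (b + n) / 2 : ℝ) * Complex.I) + starRingEnd ℂ (q 1) * Complex.exp ((Real.pi * (b + n) / 2 : ℝ) * Complex.I) =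
      starRingEnd ℂ (q 0 * Complex.exp (-(Real.pi * (-b + ((-n : ℤ) : ℝ)) / 2 : ℝ) * Complex.I) + q 1 * Complex.exp ((Real.pi * (-b + ((-n : ℤ) : ℝ)) / 2 : ℝ) * Complex.I)) := by
    simp only [map_add, map_mul, ← Complex.exp_conj, map_neg, Complex.conj_ofReal, Complex.conj_I]
    congr 3
    · push_cast; ring
    · push_cast; ring
  rw [e, Complex.norm_conj]
  congr 1
  push_cast; ring

/-- **Conjugation:** the law (constant `C`) for `(−a, −b)` and coefficients `n ↦ conj (c (−n))` gives the law for `(a, b)` and `c` (`a < 0`). -/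
theorem lineLaw_of_conj {a b θ C : ℝ} {K : ℕ} {c : ℤ → ℂ} (ha : a < 0)
    (h : lineEnergyOut (-a) (-b) K (sheetAmps (-a) (-b) θ ⟨modeProfile (-b) K (fun n => starRingEnd ℂ (c (-n))), []⟩) ≤
      C * ∑ n ∈ win K, ‖starRingEnd ℂ (c (-n))‖ ^ 2 / ((-a) ^ 2 + (-b + n) ^ 2)) :
    lineEnergyOut a b K (sheetAmps a b θ ⟨modeProfile b K c, []⟩) ≤ C * ∑ n ∈ win K, ‖c n‖ ^ 2 / (a ^ 2 + (b + n) ^ 2) := by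
  have ha' : 0 < -a := by linarith
  have hq : ∀ i, sheetAmps a b θ ⟨modeProfile b K c, []⟩ i =
      starRingEnd ℂ (sheetAmps (-a) (-b) θ ⟨modeProfile (-b) K (fun n => starRingEnd ℂ (c (-n))), []⟩ i) := by
    intro i
    have h1 := sheetAmps_neg_neg_modeProfile_pos ha' (-b) θ K (fun n => starRingEnd ℂ (c (-n))) i
    simp only [neg_neg, Complex.conj_conj] at h1
    exact h1
  have hE : lineEnergyOut a b K (sheetAmps a b θ ⟨modeProfile b K c, []⟩) =
      lineEnergyOut (-a) (-b) K (sheetAmps (-a) (-b) θ ⟨modeProfile (-b) K (fun n => starRingEnd ℂ (c (-n))), []⟩) := by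
    rw [← lineEnergyOut_conj]
    congr 1
    funext i
    exact hq i
  have hin : ∑ n ∈ win K, ‖starRingEnd ℂ (c (-n))‖ ^ 2 / ((-a) ^ 2 + (-b + n) ^ 2) = ∑ n ∈ win K, ‖c n‖ ^ 2 / (a ^ 2 + (b + n) ^ 2) := by
    refine Finset.sum_nbij' (fun n => -n) (fun n => -n) (fun n hn => by simp only [win, Finset.mem_Icc] at hn ⊢; omega)
      (fun n hn => by simp only [win, Finset.mem_Icc] at hn ⊢; omega) (fun n _ => neg_neg n) (fun n _ => neg_neg n) (fun n _ => ?_)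
    rw [Complex.norm_conj]
    push_cast; ring
  rw [hE]
  rw [hin] at h
  exact h

/-! ## §12 (p2 g13) The derivative kernel and the Duhamel integrand in the kink-pair frame -/

/-- The derivative of the closed form of the kernel on one period (`…KHKernelBlochDeriv`, hypothesis `hK'`). -/
def kernelK' (a β : ℝ) : ℝ → ℂ := fun r : ℝ => ((Real.exp (-(2 * Real.pi * a * r)) : ℂ) /
            (1 - starRingEnd ℂ (Complex.exp (2 * Real.pi * β * Complex.I)) * (Real.exp (-(2 * Real.pi * a)) : ℂ))
          - (Real.exp (2 * Real.pi * a * (r - 1)) : ℂ) * Complex.exp (2 * Real.pi * β * Complex.I) /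
            (1 - Complex.exp (2 * Real.pi * β * Complex.I) * (Real.exp (-(2 * Real.pi * a)) : ℂ))) / 2

/-- The derivative of the Bloch kernel off the lattice (`…KHKernelBlochDeriv`, hypothesis `hG'`). -/
def lineKernel' (a β : ℝ) : ℝ → ℂ := fun u : ℝ => Complex.exp (2 * Real.pi * β * (⌊u⌋ : ℝ) * Complex.I) * kernelK' a β (u - ⌊u⌋)

/-- The frame coefficient `x_vu = 2πia(−¼ − 2G(0) + 2Ḡ(½)e^{iπβ})` (pole-free). -/
def frameVU (a β : ℝ) : ℂ :=
  (((2 * Real.pi * a : ℝ) : ℂ) * Complex.I) *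
    (-(1 / 4 : ℂ) - 2 * lineKernel a β 0 + 2 * starRingEnd ℂ (lineKernel a β (1 / 2)) * Complex.exp (((Real.pi * β : ℝ) : ℂ) * Complex.I))

/-- The frame coefficient `x_uv = 2πia(−¼ − 2G(0) − 2Ḡ(½)e^{iπβ})` (carries the pole). -/
def frameUV (a β : ℝ) : ℂ :=
  (((2 * Real.pi * a : ℝ) : ℂ) * Complex.I) *
    (-(1 / 4 : ℂ) - 2 * lineKernel a β 0 - 2 * starRingEnd ℂ (lineKernel a β (1 / 2)) * Complex.exp (((Real.pi * β : ℝ) : ℂ) * Complex.I))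

/-- `‖x_vu‖ ≤ 3πa/2` for `|β| ≤ ½` (tree `norm_frameCoef_vu_le`: the poles cancel). -/
theorem norm_frameVU_le {a : ℝ} (ha : 0 < a) {β : ℝ} (hβ : |β| ≤ 1 / 2) : ‖frameVU a β‖ ≤ a * (3 * Real.pi / 2) := by
  have h := (frameCoef_eq (twoPi_lineKernel_zero' ha β) (twoPi_conj_lineKernel_half' ha β)).1
  unfold frameVU
  rw [h, norm_mul, norm_mul, Complex.norm_I, one_mul, Complex.norm_real, Real.norm_eq_abs, abs_of_pos ha]
  exact mul_le_mul_of_nonneg_left (norm_frameCoef_vu_le ha hβ) ha.le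

/-- `‖x_uv‖ ≤ a(π/2 + 2(1+q)/(a(1−q)))` (tree `norm_frameCoef_uv_le`). -/
theorem norm_frameUV_le {a : ℝ} (ha : 0 < a) (β : ℝ) : ‖frameUV a β‖ ≤ a * (Real.pi / 2 + 2 * (1 + sawQ a) / (a * (1 - sawQ a))) := by
  have h := (frameCoef_eq (twoPi_lineKernel_zero' ha β) (twoPi_conj_lineKernel_half' ha β)).2
  unfold frameUV
  rw [h, norm_mul, norm_mul, Complex.norm_I, one_mul, Complex.norm_real, Real.norm_eq_abs, abs_of_pos ha]
  exact mul_le_mul_of_nonneg_left (norm_frameCoef_uv_le ha β) ha.le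

/-- For `0 < a ≤ 1/16`: `4πa·‖x_uv‖ ≤ 17`. -/
theorem four_pi_mul_norm_frameUV_le {a : ℝ} (ha : 0 < a) (ha1 : a ≤ 1 / 16) (β : ℝ) : 4 * Real.pi * a * ‖frameUV a β‖ ≤ 17 := by
  have hπ := Real.pi_pos
  have hπ4 := Real.pi_lt_four
  obtain ⟨_, h1q⟩ := corner_q_bounds ha ha1
  have hq0 : 0 < sawQ a := sawQ_pos a
  have hq1 : sawQ a < 1 := sawQ_lt_one ha
  have hqe : sawQ a = Real.exp (-(2 * Real.pi * a)) := rfl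
  rw [← hqe] at h1q
  have h := norm_frameUV_le ha β
  have h2 : 2 * (1 + sawQ a) / (a * (1 - sawQ a)) ≤ 4 / (a * (Real.pi * a)) := by
    rw [div_le_div_iff₀ (by nlinarith) (by positivity)]
    have : 2 * (1 + sawQ a) * (Real.pi * a) ≤ 4 * (1 - sawQ a) := by nlinarith
    nlinarith [this, ha]
  calc 4 * Real.pi * a * ‖frameUV a β‖ ≤ 4 * Real.pi * a * (a * (Real.pi / 2 + 4 / (a * (Real.pi * a)))) := by
        refine mul_le_mul_of_nonneg_left (h.trans ?_) (by positivity)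
        exact mul_le_mul_of_nonneg_left (by linarith) ha.le
    _ = 2 * Real.pi ^ 2 * a ^ 2 + 16 := by field_simp; ring
    _ ≤ 17 := by
        have ha2 : a ^ 2 ≤ (1 / 16) ^ 2 := pow_le_pow_left₀ ha.le ha1 2
        have hp2 : Real.pi ^ 2 ≤ 4 ^ 2 := pow_le_pow_left₀ hπ.le hπ4.le 2
        nlinarith [mul_le_mul hp2 ha2 (sq_nonneg _) (by norm_num)]

/-- The component `i` of the propagator acting on a vector: `(P(t)f)_i = C(t) f_i + Sn(t) (Xf)_i`. -/
theorem propagator_mulVec_apply (a β t : ℝ) (f : Fin 2 → ℂ) (i : Fin 2) :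
    (propagator a β t).mulVec f i = ((propC a β t : ℝ) : ℂ) * f i + ((propSn a β t : ℝ) : ℂ) * (blockX a β).mulVec f i := by
  simp only [propagator, Matrix.add_mulVec, Matrix.smul_mulVec, Matrix.one_mulVec, Pi.add_apply, Pi.smul_apply, smul_eq_mul]

/-- **The Duhamel integrand in the frame, `U` component:** `(Pf)₀e^{−iπβ/2} + (Pf)₁e^{iπβ/2} = C(t)·U(f) + Sn(t)·x_vu·V(f)`. -/
theorem duhamel_frame_U {a : ℝ} (ha : 0 < a) (β t : ℝ) (f : Fin 2 → ℂ) :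
    (propagator a β t).mulVec f 0 * Complex.exp (-((Real.pi * β / 2 : ℝ) : ℂ) * Complex.I) +
        (propagator a β t).mulVec f 1 * Complex.exp (((Real.pi * β / 2 : ℝ) : ℂ) * Complex.I) =
      ((propC a β t : ℝ) : ℂ) * (f 0 * Complex.exp (-((Real.pi * β / 2 : ℝ) : ℂ) * Complex.I) + f 1 * Complex.exp (((Real.pi * β / 2 : ℝ) : ℂ) * Complex.I)) +
        ((propSn a β t : ℝ) : ℂ) * (frameVU a β *
          (f 0 * Complex.exp (-((Real.pi * β / 2 : ℝ) : ℂ) * Complex.I) - f 1 * Complex.exp (((Real.pi * β / 2 : ℝ) : ℂ) * Complex.I))) := by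
  have hrel := frame_rel_of ha (twoPi_conj_lineKernel_half' ha β)
  have hX := frame_mulVec_U a β (G0 := lineKernel a β 0) hrel f
  rw [propagator_mulVec_apply, propagator_mulVec_apply]
  unfold frameVU
  simp only [blockX] at hX ⊢
  linear_combination (((propSn a β t : ℝ) : ℂ)) * hX

/-- **The Duhamel integrand in the frame, `V` component:** `(Pf)₀e^{−iπβ/2} − (Pf)₁e^{iπβ/2} = C(t)·V(f) + Sn(t)·x_uv·U(f)`. -/
theorem duhamel_frame_V {a : ℝ} (ha : 0 < a) (β t : ℝ) (f : Fin 2 → ℂ) :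
    (propagator a β t).mulVec f 0 * Complex.exp (-((Real.pi * β / 2 : ℝ) : ℂ) * Complex.I) -
        (propagator a β t).mulVec f 1 * Complex.exp (((Real.pi * β / 2 : ℝ) : ℂ) * Complex.I) =
      ((propC a β t : ℝ) : ℂ) * (f 0 * Complex.exp (-((Real.pi * β / 2 : ℝ) : ℂ) * Complex.I) - f 1 * Complex.exp (((Real.pi * β / 2 : ℝ) : ℂ) * Complex.I)) +
        ((propSn a β t : ℝ) : ℂ) * (frameUV a β *
          (f 0 * Complex.exp (-((Real.pi * β / 2 : ℝ) : ℂ) * Complex.I) + f 1 * Complex.exp (((Real.pi * β / 2 : ℝ) : ℂ) * Complex.I))) := by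
  have hrel := frame_rel_of ha (twoPi_conj_lineKernel_half' ha β)
  have hX := frame_mulVec_V a β (G0 := lineKernel a β 0) hrel f
  rw [propagator_mulVec_apply, propagator_mulVec_apply]
  unfold frameUV
  simp only [blockX] at hX ⊢
  linear_combination (((propSn a β t : ℝ) : ℂ)) * hX

/-! ## §13 (p2 g13) The single-mode forcing in the frame: the two kink-pair sources as duality integrals -/

/-- `U(f) = 2·(2πia)·∫ F_U e^{2πi(β+n)y}` for the single mode `β + n`. -/
theorem forcing_frame_U {a : ℝ} (ha : 0 < a) (β : ℝ) (n : ℤ) (s : ℝ) :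
    forcing a β (singleMode (β + n)) s 0 * Complex.exp (-((Real.pi * β / 2 : ℝ) : ℂ) * Complex.I) +
        forcing a β (singleMode (β + n)) s 1 * Complex.exp (((Real.pi * β / 2 : ℝ) : ℂ) * Complex.I) =
      2 * ((2 * Real.pi * a : ℝ) * Complex.I : ℂ) *
        ∫ y in (-(1 / 2 : ℝ))..(1 / 2),
          ((-lineKernel a β (1 / 4 - y) * Complex.exp (-((Real.pi * β / 2 : ℝ) : ℂ) * Complex.I) +
              lineKernel a β (-(1 / 4) - y) * Complex.exp (((Real.pi * β / 2 : ℝ) : ℂ) * Complex.I)) *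
            Complex.exp (-((2 * Real.pi * a * s * triWave y : ℝ) : ℂ) * Complex.I)) *
          Complex.exp ((2 * Real.pi * (β + n) * y : ℝ) * Complex.I) := by
  have hI1 := forcingIntegrand_intervalIntegrable_quarter ha β (β + n) s (K := kernelK a β) (G := lineKernel a β) rfl (lineKernel_eq ha β)
  have hI2 := forcingIntegrand_intervalIntegrable_negQuarter ha β (β + n) s (K := kernelK a β) (G := lineKernel a β) rfl (lineKernel_eq ha β)
  rw [forcing_singleMode]
  simp only [Fin.isValue, Matrix.cons_val_zero, Matrix.cons_val_one, Matrix.cons_val_fin_one, src]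
  rw [show ((2 * Real.pi * a : ℝ) * Complex.I : ℂ) * (-2) *
        (∫ y in (-(1 / 2 : ℝ))..(1 / 2 : ℝ), lineKernel a β (1 / 4 - y) * Complex.exp (((2 * Real.pi * (β + n) * y : ℝ) : ℂ) * Complex.I) *
          Complex.exp (-((2 * Real.pi * a * s * triWave y : ℝ) : ℂ) * Complex.I)) * Complex.exp (-((Real.pi * β / 2 : ℝ) : ℂ) * Complex.I) +
      ((2 * Real.pi * a : ℝ) * Complex.I : ℂ) * 2 *
        (∫ y in (-(1 / 2 : ℝ))..(1 / 2 : ℝ), lineKernel a β (-(1 / 4) - y) * Complex.exp (((2 * Real.pi * (β + n) * y : ℝ) : ℂ) * Complex.I) *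
          Complex.exp (-((2 * Real.pi * a * s * triWave y : ℝ) : ℂ) * Complex.I)) * Complex.exp (((Real.pi * β / 2 : ℝ) : ℂ) * Complex.I) =
      2 * ((2 * Real.pi * a : ℝ) * Complex.I : ℂ) *
        ((-Complex.exp (-((Real.pi * β / 2 : ℝ) : ℂ) * Complex.I)) *
          (∫ y in (-(1 / 2 : ℝ))..(1 / 2 : ℝ), lineKernel a β (1 / 4 - y) * Complex.exp (((2 * Real.pi * (β + n) * y : ℝ) : ℂ) * Complex.I) *
            Complex.exp (-((2 * Real.pi * a * s * triWave y : ℝ) : ℂ) * Complex.I)) +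
          Complex.exp (((Real.pi * β / 2 : ℝ) : ℂ) * Complex.I) *
          (∫ y in (-(1 / 2 : ℝ))..(1 / 2 : ℝ), lineKernel a β (-(1 / 4) - y) * Complex.exp (((2 * Real.pi * (β + n) * y : ℝ) : ℂ) * Complex.I) *
            Complex.exp (-((2 * Real.pi * a * s * triWave y : ℝ) : ℂ) * Complex.I))) by ring]
  congr 1
  rw [← intervalIntegral.integral_const_mul, ← intervalIntegral.integral_const_mul, ← intervalIntegral.integral_add (hI1.const_mul _) (hI2.const_mul _)]
  refine intervalIntegral.integral_congr fun y _ => ?_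
  ring

/-- `V(f) = 2·(2πia)·∫ F_V e^{2πi(β+n)y}` for the single mode `β + n`. -/
theorem forcing_frame_V {a : ℝ} (ha : 0 < a) (β : ℝ) (n : ℤ) (s : ℝ) :
    forcing a β (singleMode (β + n)) s 0 * Complex.exp (-((Real.pi * β / 2 : ℝ) : ℂ) * Complex.I) -
        forcing a β (singleMode (β + n)) s 1 * Complex.exp (((Real.pi * β / 2 : ℝ) : ℂ) * Complex.I) =
      2 * ((2 * Real.pi * a : ℝ) * Complex.I : ℂ) *
        ∫ y in (-(1 / 2 : ℝ))..(1 / 2),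
          ((-lineKernel a β (1 / 4 - y) * Complex.exp (-((Real.pi * β / 2 : ℝ) : ℂ) * Complex.I) -
              lineKernel a β (-(1 / 4) - y) * Complex.exp (((Real.pi * β / 2 : ℝ) : ℂ) * Complex.I)) *
            Complex.exp (-((2 * Real.pi * a * s * triWave y : ℝ) : ℂ) * Complex.I)) *
          Complex.exp ((2 * Real.pi * (β + n) * y : ℝ) * Complex.I) := by
  have hI1 := forcingIntegrand_intervalIntegrable_quarter ha β (β + n) s (K := kernelK a β) (G := lineKernel a β) rfl (lineKernel_eq ha β)
  have hI2 := forcingIntegrand_intervalIntegrable_negQuarter ha β (β + n) s (K := kernelK a β) (G := lineKernel a β) rfl (lineKernel_eq ha β)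
  rw [forcing_singleMode]
  simp only [Fin.isValue, Matrix.cons_val_zero, Matrix.cons_val_one, Matrix.cons_val_fin_one, src]
  rw [show ((2 * Real.pi * a : ℝ) * Complex.I : ℂ) * (-2) *
        (∫ y in (-(1 / 2 : ℝ))..(1 / 2 : ℝ), lineKernel a β (1 / 4 - y) * Complex.exp (((2 * Real.pi * (β + n) * y : ℝ) : ℂ) * Complex.I) *
          Complex.exp (-((2 * Real.pi * a * s * triWave y : ℝ) : ℂ) * Complex.I)) * Complex.exp (-((Real.pi * β / 2 : ℝ) : ℂ) * Complex.I) -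
      ((2 * Real.pi * a : ℝ) * Complex.I : ℂ) * 2 *
        (∫ y in (-(1 / 2 : ℝ))..(1 / 2 : ℝ), lineKernel a β (-(1 / 4) - y) * Complex.exp (((2 * Real.pi * (β + n) * y : ℝ) : ℂ) * Complex.I) *
          Complex.exp (-((2 * Real.pi * a * s * triWave y : ℝ) : ℂ) * Complex.I)) * Complex.exp (((Real.pi * β / 2 : ℝ) : ℂ) * Complex.I) =
      2 * ((2 * Real.pi * a : ℝ) * Complex.I : ℂ) *
        ((-Complex.exp (-((Real.pi * β / 2 : ℝ) : ℂ) * Complex.I)) *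
          (∫ y in (-(1 / 2 : ℝ))..(1 / 2 : ℝ), lineKernel a β (1 / 4 - y) * Complex.exp (((2 * Real.pi * (β + n) * y : ℝ) : ℂ) * Complex.I) *
            Complex.exp (-((2 * Real.pi * a * s * triWave y : ℝ) : ℂ) * Complex.I)) +
          (-Complex.exp (((Real.pi * β / 2 : ℝ) : ℂ) * Complex.I)) *
          (∫ y in (-(1 / 2 : ℝ))..(1 / 2 : ℝ), lineKernel a β (-(1 / 4) - y) * Complex.exp (((2 * Real.pi * (β + n) * y : ℝ) : ℂ) * Complex.I) *
            Complex.exp (-((2 * Real.pi * a * s * triWave y : ℝ) : ℂ) * Complex.I))) by ring]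
  congr 1
  rw [← intervalIntegral.integral_const_mul, ← intervalIntegral.integral_const_mul, ← intervalIntegral.integral_add (hI1.const_mul _) (hI2.const_mul _)]
  refine intervalIntegral.integral_congr fun y _ => ?_
  ring

/-! ## §14 (p2 g13) The roof and the pointwise bound of the Duhamel integrand of a profile -/

/-- `sawSigmaStar > 0`. -/
theorem sawSigmaStar_pos : 0 < sawSigmaStar := by unfold sawSigmaStar; norm_num

/-- **The roof on every line:** `|C(t)| ≤ cosh(8σ⋆)`, `|Sn(t)| ≤ 8·cosh(8σ⋆)` for `0 ≤ t ≤ θ ≤ 8` (`λ₊ ≤ σ⋆²`, tree `sq_mul_neg_sawC2_le_sawSigmaStar_sq`). -/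
theorem roof {a : ℝ} (ha : 0 < a) (β : ℝ) {t θ : ℝ} (ht : 0 ≤ t) (htθ : t ≤ θ) (hθ : θ ≤ 8) :
    |propC a β t| ≤ Real.cosh (8 * sawSigmaStar) ∧ |propSn a β t| ≤ 8 * Real.cosh (8 * sawSigmaStar) := by
  have hσ := sawSigmaStar_pos
  have hθ0 : 0 ≤ θ := ht.trans htθ
  have hΛ : max 0 (khLam a β) ≤ sawSigmaStar ^ 2 := by
    refine max_le (sq_nonneg _) ?_
    have := sq_mul_neg_sawC2_le_sawSigmaStar_sq ha β
    unfold khLam; linarith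
  have hs : Real.sqrt (max 0 (khLam a β)) * θ ≤ sawSigmaStar * 8 := by
    have h1 : Real.sqrt (max 0 (khLam a β)) ≤ sawSigmaStar := by
      rw [← Real.sqrt_sq hσ.le]; exact Real.sqrt_le_sqrt hΛ
    exact mul_le_mul h1 hθ hθ0 hσ.le
  have hcosh : Real.cosh (Real.sqrt (max 0 (khLam a β)) * θ) ≤ Real.cosh (8 * sawSigmaStar) := by
    rw [Real.cosh_le_cosh, abs_of_nonneg (by positivity), abs_of_nonneg (by positivity)]
    linarith
  refine ⟨(abs_propC_le a β ht htθ).trans hcosh, (abs_propSn_le a β ht htθ).trans ?_⟩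
  exact mul_le_mul hθ hcosh (Real.cosh_pos _).le (by norm_num)

/-- `‖2·(2πia)‖ = 4πa`. -/
theorem norm_two_mul_sigma {a : ℝ} (ha : 0 < a) : ‖(2 : ℂ) * ((2 * Real.pi * a : ℝ) * Complex.I : ℂ)‖ = 4 * Real.pi * a := by
  rw [norm_mul, norm_mul, Complex.norm_real, Complex.norm_I, Real.norm_eq_abs, abs_of_pos (by positivity)]
  norm_num; ring

/-- **Pointwise bound, `U` component:** for `0 < a ≤ 1/16`, `|β| ≤ ½`, `0 ≤ s ≤ θ ≤ 8` and every profile,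
`‖Σ_n c_n U-component of P(θ−s) f_n(s)‖ ≤ a·√E_in·cosh(8σ⋆)·4π(√2 + 12π)`. -/
theorem duhamel_sum_U_le {a : ℝ} (ha : 0 < a) (ha1 : a ≤ 1 / 16) {β : ℝ} (hβ : |β| ≤ 1 / 2) {θ s : ℝ} (hs0 : 0 ≤ s) (hsθ : s ≤ θ)
    (hθ : θ ≤ 8) (K : ℕ) (c : ℤ → ℂ) :
    ‖∑ n ∈ win K, c n * ((propagator a β (θ - s)).mulVec (forcing a β (singleMode (β + n)) s) 0 * Complex.exp (-((Real.pi * β / 2 : ℝ) : ℂ) * Complex.I) +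
        (propagator a β (θ - s)).mulVec (forcing a β (singleMode (β + n)) s) 1 * Complex.exp (((Real.pi * β / 2 : ℝ) : ℂ) * Complex.I))‖ ≤
      a * Real.sqrt (∑ n ∈ win K, ‖c n‖ ^ 2 / (a ^ 2 + (β + n) ^ 2)) * (Real.cosh (8 * sawSigmaStar) * (4 * Real.pi) * (Real.sqrt 2 + 12 * Real.pi)) := by
  set E : ℝ := ∑ n ∈ win K, ‖c n‖ ^ 2 / (a ^ 2 + (β + n) ^ 2) with hE
  set M₀ : ℝ := Real.cosh (8 * sawSigmaStar) with hM₀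
  set σ₂ : ℂ := 2 * ((2 * Real.pi * a : ℝ) * Complex.I : ℂ) with hσ₂
  have hπ := Real.pi_pos
  have hs8 : s ≤ 8 := hsθ.trans hθ
  -- the two duality integrals per mode
  set dU : ℤ → ℂ := fun n => ∫ y in (-(1 / 2 : ℝ))..(1 / 2),
      ((-lineKernel a β (1 / 4 - y) * Complex.exp (-((Real.pi * β / 2 : ℝ) : ℂ) * Complex.I) +
          lineKernel a β (-(1 / 4) - y) * Complex.exp (((Real.pi * β / 2 : ℝ) : ℂ) * Complex.I)) *
        Complex.exp (-((2 * Real.pi * a * s * triWave y : ℝ) : ℂ) * Complex.I)) * Complex.exp ((2 * Real.pi * (β + n) * y : ℝ) * Complex.I) with hdU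
  set dV : ℤ → ℂ := fun n => ∫ y in (-(1 / 2 : ℝ))..(1 / 2),
      ((-lineKernel a β (1 / 4 - y) * Complex.exp (-((Real.pi * β / 2 : ℝ) : ℂ) * Complex.I) -
          lineKernel a β (-(1 / 4) - y) * Complex.exp (((Real.pi * β / 2 : ℝ) : ℂ) * Complex.I)) *
        Complex.exp (-((2 * Real.pi * a * s * triWave y : ℝ) : ℂ) * Complex.I)) * Complex.exp ((2 * Real.pi * (β + n) * y : ℝ) * Complex.I) with hdV
  -- rewrite each summand in the frame
  have hterm : ∀ n : ℤ, c n * ((propagator a β (θ - s)).mulVec (forcing a β (singleMode (β + n)) s) 0 * Complex.exp (-((Real.pi * β / 2 : ℝ) : ℂ) * Complex.I) +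
        (propagator a β (θ - s)).mulVec (forcing a β (singleMode (β + n)) s) 1 * Complex.exp (((Real.pi * β / 2 : ℝ) : ℂ) * Complex.I)) =
      ((propC a β (θ - s) : ℝ) : ℂ) * σ₂ * (c n * dU n) + ((propSn a β (θ - s) : ℝ) : ℂ) * frameVU a β * σ₂ * (c n * dV n) := by
    intro n
    rw [duhamel_frame_U ha, forcing_frame_U ha, forcing_frame_V ha]
    ring
  rw [Finset.sum_congr rfl fun n _ => hterm n, Finset.sum_add_distrib, ← Finset.mul_sum, ← Finset.mul_sum]
  -- the weighted Bessel sums of the two sources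
  have hSU := corner_sum_U_le ha ha1 hβ hs0 hs8 (K := kernelK a β) (G := lineKernel a β) (K' := kernelK' a β) (G' := lineKernel' a β)
    rfl (lineKernel_eq ha β) rfl (fun u => rfl) (win K)
  have hSV := corner_sum_V_le ha ha1 hβ hs0 hs8 (K := kernelK a β) (G := lineKernel a β) (K' := kernelK' a β) (G' := lineKernel' a β)
    rfl (lineKernel_eq ha β) rfl (fun u => rfl) (win K)
  have hCS_U := norm_sum_mul_le_sqrt_mul_sqrt ha.ne' β c dU (win K)
  have hCS_V := norm_sum_mul_le_sqrt_mul_sqrt ha.ne' β c dV (win K)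
  have hU : ‖∑ n ∈ win K, c n * dU n‖ ≤ Real.sqrt E * Real.sqrt 2 :=
    hCS_U.trans (mul_le_mul_of_nonneg_left (Real.sqrt_le_sqrt hSU) (Real.sqrt_nonneg _))
  have hV : ‖∑ n ∈ win K, c n * dV n‖ ≤ Real.sqrt E * (1 / a) := by
    refine hCS_V.trans (mul_le_mul_of_nonneg_left ((Real.sqrt_le_sqrt hSV).trans (le_of_eq ?_)) (Real.sqrt_nonneg _))
    rw [Real.sqrt_div' _ (sq_nonneg a), Real.sqrt_one, Real.sqrt_sq ha.le]
  -- the roof and the frame coefficient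
  obtain ⟨hC, hS⟩ := roof ha β (show 0 ≤ θ - s by linarith) (show θ - s ≤ θ by linarith) hθ
  have hxvu := norm_frameVU_le ha hβ
  have hσn : ‖σ₂‖ = 4 * Real.pi * a := norm_two_mul_sigma ha
  have hE0 : 0 ≤ Real.sqrt E := Real.sqrt_nonneg _
  have hM1 : 1 ≤ M₀ := Real.one_le_cosh _
  calc ‖((propC a β (θ - s) : ℝ) : ℂ) * σ₂ * ∑ n ∈ win K, c n * dU n + ((propSn a β (θ - s) : ℝ) : ℂ) * frameVU a β * σ₂ * ∑ n ∈ win K, c n * dV n‖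
      ≤ ‖((propC a β (θ - s) : ℝ) : ℂ)‖ * ‖σ₂‖ * ‖∑ n ∈ win K, c n * dU n‖ + ‖((propSn a β (θ - s) : ℝ) : ℂ)‖ * ‖frameVU a β‖ * ‖σ₂‖ * ‖∑ n ∈ win K, c n * dV n‖ := by
        refine (norm_add_le _ _).trans (le_of_eq ?_)
        simp only [norm_mul]
    _ ≤ M₀ * (4 * Real.pi * a) * (Real.sqrt E * Real.sqrt 2) + (8 * M₀) * (a * (3 * Real.pi / 2)) * (4 * Real.pi * a) * (Real.sqrt E * (1 / a)) := by
        rw [Complex.norm_real, Complex.norm_real, Real.norm_eq_abs, Real.norm_eq_abs, hσn]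
        gcongr
    _ = a * Real.sqrt E * (M₀ * (4 * Real.pi) * (Real.sqrt 2 + 12 * Real.pi)) := by field_simp; ring

/-- **Pointwise bound, `V` component:** `‖Σ_n c_n V-component of P(θ−s) f_n(s)‖ ≤ √E_in·cosh(8σ⋆)·(4π + 136√2)`. -/
theorem duhamel_sum_V_le {a : ℝ} (ha : 0 < a) (ha1 : a ≤ 1 / 16) {β : ℝ} (hβ : |β| ≤ 1 / 2) {θ s : ℝ} (hs0 : 0 ≤ s) (hsθ : s ≤ θ)
    (hθ : θ ≤ 8) (K : ℕ) (c : ℤ → ℂ) :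
    ‖∑ n ∈ win K, c n * ((propagator a β (θ - s)).mulVec (forcing a β (singleMode (β + n)) s) 0 * Complex.exp (-((Real.pi * β / 2 : ℝ) : ℂ) * Complex.I) -
        (propagator a β (θ - s)).mulVec (forcing a β (singleMode (β + n)) s) 1 * Complex.exp (((Real.pi * β / 2 : ℝ) : ℂ) * Complex.I))‖ ≤
      Real.sqrt (∑ n ∈ win K, ‖c n‖ ^ 2 / (a ^ 2 + (β + n) ^ 2)) * (Real.cosh (8 * sawSigmaStar) * (4 * Real.pi + 136 * Real.sqrt 2)) := by
  set E : ℝ := ∑ n ∈ win K, ‖c n‖ ^ 2 / (a ^ 2 + (β + n) ^ 2) with hE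
  set M₀ : ℝ := Real.cosh (8 * sawSigmaStar) with hM₀
  set σ₂ : ℂ := 2 * ((2 * Real.pi * a : ℝ) * Complex.I : ℂ) with hσ₂
  have hπ := Real.pi_pos
  have hs8 : s ≤ 8 := hsθ.trans hθ
  set dU : ℤ → ℂ := fun n => ∫ y in (-(1 / 2 : ℝ))..(1 / 2),
      ((-lineKernel a β (1 / 4 - y) * Complex.exp (-((Real.pi * β / 2 : ℝ) : ℂ) * Complex.I) +
          lineKernel a β (-(1 / 4) - y) * Complex.exp (((Real.pi * β / 2 : ℝ) : ℂ) * Complex.I)) *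
        Complex.exp (-((2 * Real.pi * a * s * triWave y : ℝ) : ℂ) * Complex.I)) * Complex.exp ((2 * Real.pi * (β + n) * y : ℝ) * Complex.I) with hdU
  set dV : ℤ → ℂ := fun n => ∫ y in (-(1 / 2 : ℝ))..(1 / 2),
      ((-lineKernel a β (1 / 4 - y) * Complex.exp (-((Real.pi * β / 2 : ℝ) : ℂ) * Complex.I) -
          lineKernel a β (-(1 / 4) - y) * Complex.exp (((Real.pi * β / 2 : ℝ) : ℂ) * Complex.I)) *
        Complex.exp (-((2 * Real.pi * a * s * triWave y : ℝ) : ℂ) * Complex.I)) * Complex.exp ((2 * Real.pi * (β + n) * y : ℝ) * Complex.I) with hdV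
  have hterm : ∀ n : ℤ, c n * ((propagator a β (θ - s)).mulVec (forcing a β (singleMode (β + n)) s) 0 * Complex.exp (-((Real.pi * β / 2 : ℝ) : ℂ) * Complex.I) -
        (propagator a β (θ - s)).mulVec (forcing a β (singleMode (β + n)) s) 1 * Complex.exp (((Real.pi * β / 2 : ℝ) : ℂ) * Complex.I)) =
      ((propC a β (θ - s) : ℝ) : ℂ) * σ₂ * (c n * dV n) + ((propSn a β (θ - s) : ℝ) : ℂ) * frameUV a β * σ₂ * (c n * dU n) := by
    intro n
    rw [duhamel_frame_V ha, forcing_frame_U ha, forcing_frame_V ha]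
    ring
  rw [Finset.sum_congr rfl fun n _ => hterm n, Finset.sum_add_distrib, ← Finset.mul_sum, ← Finset.mul_sum]
  have hSU := corner_sum_U_le ha ha1 hβ hs0 hs8 (K := kernelK a β) (G := lineKernel a β) (K' := kernelK' a β) (G' := lineKernel' a β)
    rfl (lineKernel_eq ha β) rfl (fun u => rfl) (win K)
  have hSV := corner_sum_V_le ha ha1 hβ hs0 hs8 (K := kernelK a β) (G := lineKernel a β) (K' := kernelK' a β) (G' := lineKernel' a β)
    rfl (lineKernel_eq ha β) rfl (fun u => rfl) (win K)
  have hCS_U := norm_sum_mul_le_sqrt_mul_sqrt ha.ne' β c dU (win K)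
  have hCS_V := norm_sum_mul_le_sqrt_mul_sqrt ha.ne' β c dV (win K)
  have hU : ‖∑ n ∈ win K, c n * dU n‖ ≤ Real.sqrt E * Real.sqrt 2 :=
    hCS_U.trans (mul_le_mul_of_nonneg_left (Real.sqrt_le_sqrt hSU) (Real.sqrt_nonneg _))
  have hV : ‖∑ n ∈ win K, c n * dV n‖ ≤ Real.sqrt E * (1 / a) := by
    refine hCS_V.trans (mul_le_mul_of_nonneg_left ((Real.sqrt_le_sqrt hSV).trans (le_of_eq ?_)) (Real.sqrt_nonneg _))
    rw [Real.sqrt_div' _ (sq_nonneg a), Real.sqrt_one, Real.sqrt_sq ha.le]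
  obtain ⟨hC, hS⟩ := roof ha β (show 0 ≤ θ - s by linarith) (show θ - s ≤ θ by linarith) hθ
  have hxuv := four_pi_mul_norm_frameUV_le ha ha1 β
  have hσn : ‖σ₂‖ = 4 * Real.pi * a := norm_two_mul_sigma ha
  have hE0 : 0 ≤ Real.sqrt E := Real.sqrt_nonneg _
  have hM1 : 1 ≤ M₀ := Real.one_le_cosh _
  calc ‖((propC a β (θ - s) : ℝ) : ℂ) * σ₂ * ∑ n ∈ win K, c n * dV n + ((propSn a β (θ - s) : ℝ) : ℂ) * frameUV a β * σ₂ * ∑ n ∈ win K, c n * dU n‖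
      ≤ ‖((propC a β (θ - s) : ℝ) : ℂ)‖ * ‖σ₂‖ * ‖∑ n ∈ win K, c n * dV n‖ + ‖((propSn a β (θ - s) : ℝ) : ℂ)‖ * (‖σ₂‖ * ‖frameUV a β‖) * ‖∑ n ∈ win K, c n * dU n‖ := by
        refine (norm_add_le _ _).trans (le_of_eq ?_)
        simp only [norm_mul]; ring
    _ ≤ M₀ * (4 * Real.pi * a) * (Real.sqrt E * (1 / a)) + (8 * M₀) * 17 * (Real.sqrt E * Real.sqrt 2) := by
        rw [Complex.norm_real, Complex.norm_real, Real.norm_eq_abs, Real.norm_eq_abs, hσn]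
        have h17 : 4 * Real.pi * a * ‖frameUV a β‖ ≤ 17 := hxuv
        gcongr
    _ = Real.sqrt E * (M₀ * (4 * Real.pi + 136 * Real.sqrt 2)) := by field_simp; ring

/-! ## §15 (p2 g13) The created pair of a profile in the frame: `Q_U`, `Q_V` as single Duhamel integrals, and their bounds -/

/-- Component `i` of the created amplitudes of a single mode as the integral of the component (any line `a > 0`). -/
theorem sheetAmps_singleMode_apply {a : ℝ} (ha : 0 < a) (β ξ θ : ℝ) (i : Fin 2) :
    sheetAmps a β θ (singleMode ξ) i = ∫ s in (0 : ℝ)..θ, ((propagator a β (θ - s)).mulVec (forcing a β (singleMode ξ) s)) i := by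
  have hint := (continuous_duhamelIntegrand_singleMode_pos ha β ξ θ).intervalIntegrable (μ := volume) 0 θ
  have hcomp := ((ContinuousLinearMap.proj (R := ℂ) (φ := fun _ : Fin 2 => ℂ) i).intervalIntegral_comp_comm hint).symm
  simp only [ContinuousLinearMap.proj_apply] at hcomp
  unfold sheetAmps
  exact hcomp

/-- The component functions of the Duhamel integrand of a single mode are continuous in the slot time. -/
theorem continuous_duhamel_component {a : ℝ} (ha : 0 < a) (β ξ θ : ℝ) (i : Fin 2) :
    Continuous fun s : ℝ => ((propagator a β (θ - s)).mulVec (forcing a β (singleMode ξ) s)) i :=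
  (continuous_apply i).comp (continuous_duhamelIntegrand_singleMode_pos ha β ξ θ)

/-- **`Q_U` of a profile as ONE Duhamel integral of the frame sum.** -/
theorem QU_eq_integral {a : ℝ} (ha : 0 < a) (β θ : ℝ) (K : ℕ) (c : ℤ → ℂ) :
    sheetAmps a β θ ⟨modeProfile β K c, []⟩ 0 * Complex.exp (-((Real.pi * β / 2 : ℝ) : ℂ) * Complex.I) +
        sheetAmps a β θ ⟨modeProfile β K c, []⟩ 1 * Complex.exp (((Real.pi * β / 2 : ℝ) : ℂ) * Complex.I) =
      ∫ s in (0 : ℝ)..θ, ∑ n ∈ win K, c n *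
        ((propagator a β (θ - s)).mulVec (forcing a β (singleMode (β + n)) s) 0 * Complex.exp (-((Real.pi * β / 2 : ℝ) : ℂ) * Complex.I) +
          (propagator a β (θ - s)).mulVec (forcing a β (singleMode (β + n)) s) 1 * Complex.exp (((Real.pi * β / 2 : ℝ) : ℂ) * Complex.I)) := by
  have hc : ∀ n : ℤ, ∀ i : Fin 2, IntervalIntegrable (fun s : ℝ => ((propagator a β (θ - s)).mulVec (forcing a β (singleMode (β + n)) s)) i) volume 0 θ :=
    fun n i => (continuous_duhamel_component ha β (β + n) θ i).intervalIntegrable _ _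
  rw [intervalIntegral.integral_finsetSum (fun n _ => (((hc n 0).mul_const _).add ((hc n 1).mul_const _)).const_mul _)]
  rw [sheetAmps_modeProfile_pos ha β θ K c, Finset.sum_apply, Finset.sum_apply, Finset.sum_mul, Finset.sum_mul, ← Finset.sum_add_distrib]
  refine Finset.sum_congr rfl fun n _ => ?_
  rw [Pi.smul_apply, Pi.smul_apply, smul_eq_mul, smul_eq_mul, sheetAmps_singleMode_apply ha, sheetAmps_singleMode_apply ha,
    intervalIntegral.integral_const_mul, intervalIntegral.integral_add ((hc n 0).mul_const _) ((hc n 1).mul_const _),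
    intervalIntegral.integral_mul_const, intervalIntegral.integral_mul_const]
  ring

/-- **`Q_V` of a profile as ONE Duhamel integral of the frame sum.** -/
theorem QV_eq_integral {a : ℝ} (ha : 0 < a) (β θ : ℝ) (K : ℕ) (c : ℤ → ℂ) :
    sheetAmps a β θ ⟨modeProfile β K c, []⟩ 0 * Complex.exp (-((Real.pi * β / 2 : ℝ) : ℂ) * Complex.I) -
        sheetAmps a β θ ⟨modeProfile β K c, []⟩ 1 * Complex.exp (((Real.pi * β / 2 : ℝ) : ℂ) * Complex.I) =
      ∫ s in (0 : ℝ)..θ, ∑ n ∈ win K, c n *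
        ((propagator a β (θ - s)).mulVec (forcing a β (singleMode (β + n)) s) 0 * Complex.exp (-((Real.pi * β / 2 : ℝ) : ℂ) * Complex.I) -
          (propagator a β (θ - s)).mulVec (forcing a β (singleMode (β + n)) s) 1 * Complex.exp (((Real.pi * β / 2 : ℝ) : ℂ) * Complex.I)) := by
  have hc : ∀ n : ℤ, ∀ i : Fin 2, IntervalIntegrable (fun s : ℝ => ((propagator a β (θ - s)).mulVec (forcing a β (singleMode (β + n)) s)) i) volume 0 θ :=
    fun n i => (continuous_duhamel_component ha β (β + n) θ i).intervalIntegrable _ _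
  rw [intervalIntegral.integral_finsetSum (fun n _ => (((hc n 0).mul_const _).sub ((hc n 1).mul_const _)).const_mul _)]
  rw [sheetAmps_modeProfile_pos ha β θ K c, Finset.sum_apply, Finset.sum_apply, Finset.sum_mul, Finset.sum_mul, ← Finset.sum_sub_distrib]
  refine Finset.sum_congr rfl fun n _ => ?_
  rw [Pi.smul_apply, Pi.smul_apply, smul_eq_mul, smul_eq_mul, sheetAmps_singleMode_apply ha, sheetAmps_singleMode_apply ha,
    intervalIntegral.integral_const_mul, intervalIntegral.integral_sub ((hc n 0).mul_const _) ((hc n 1).mul_const _),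
    intervalIntegral.integral_mul_const, intervalIntegral.integral_mul_const]
  ring

/-- **`|Q_U| ≤ 8a·√E_in·L_U`.** -/
theorem norm_QU_le {a : ℝ} (ha : 0 < a) (ha1 : a ≤ 1 / 16) {β : ℝ} (hβ : |β| ≤ 1 / 2) {θ : ℝ} (hθ0 : 0 ≤ θ) (hθ : θ ≤ 8) (K : ℕ) (c : ℤ → ℂ) :
    ‖sheetAmps a β θ ⟨modeProfile β K c, []⟩ 0 * Complex.exp (-((Real.pi * β / 2 : ℝ) : ℂ) * Complex.I) +
        sheetAmps a β θ ⟨modeProfile β K c, []⟩ 1 * Complex.exp (((Real.pi * β / 2 : ℝ) : ℂ) * Complex.I)‖ ≤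
      8 * (a * Real.sqrt (∑ n ∈ win K, ‖c n‖ ^ 2 / (a ^ 2 + (β + n) ^ 2)) * (Real.cosh (8 * sawSigmaStar) * (4 * Real.pi) * (Real.sqrt 2 + 12 * Real.pi))) := by
  rw [QU_eq_integral ha]
  have h := intervalIntegral.norm_integral_le_of_norm_le_const (a := (0 : ℝ)) (b := θ)
    (C := a * Real.sqrt (∑ n ∈ win K, ‖c n‖ ^ 2 / (a ^ 2 + (β + n) ^ 2)) * (Real.cosh (8 * sawSigmaStar) * (4 * Real.pi) * (Real.sqrt 2 + 12 * Real.pi)))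
    (f := fun s => ∑ n ∈ win K, c n *
        ((propagator a β (θ - s)).mulVec (forcing a β (singleMode (β + n)) s) 0 * Complex.exp (-((Real.pi * β / 2 : ℝ) : ℂ) * Complex.I) +
          (propagator a β (θ - s)).mulVec (forcing a β (singleMode (β + n)) s) 1 * Complex.exp (((Real.pi * β / 2 : ℝ) : ℂ) * Complex.I)))
    (fun s hs => by
      rw [uIoc_of_le hθ0] at hs
      exact duhamel_sum_U_le ha ha1 hβ hs.1.le hs.2 hθ K c)
  refine h.trans ?_
  rw [sub_zero, abs_of_nonneg hθ0]
  have h0 : 0 ≤ a * Real.sqrt (∑ n ∈ win K, ‖c n‖ ^ 2 / (a ^ 2 + (β + n) ^ 2)) * (Real.cosh (8 * sawSigmaStar) * (4 * Real.pi) * (Real.sqrt 2 + 12 * Real.pi)) := by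
    have := Real.pi_pos; have := Real.cosh_pos (8 * sawSigmaStar); positivity
  nlinarith

/-- **`|Q_V| ≤ 8·√E_in·L_V`.** -/
theorem norm_QV_le {a : ℝ} (ha : 0 < a) (ha1 : a ≤ 1 / 16) {β : ℝ} (hβ : |β| ≤ 1 / 2) {θ : ℝ} (hθ0 : 0 ≤ θ) (hθ : θ ≤ 8) (K : ℕ) (c : ℤ → ℂ) :
    ‖sheetAmps a β θ ⟨modeProfile β K c, []⟩ 0 * Complex.exp (-((Real.pi * β / 2 : ℝ) : ℂ) * Complex.I) -
        sheetAmps a β θ ⟨modeProfile β K c, []⟩ 1 * Complex.exp (((Real.pi * β / 2 : ℝ) : ℂ) * Complex.I)‖ ≤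
      8 * (Real.sqrt (∑ n ∈ win K, ‖c n‖ ^ 2 / (a ^ 2 + (β + n) ^ 2)) * (Real.cosh (8 * sawSigmaStar) * (4 * Real.pi + 136 * Real.sqrt 2))) := by
  rw [QV_eq_integral ha]
  have h := intervalIntegral.norm_integral_le_of_norm_le_const (a := (0 : ℝ)) (b := θ)
    (C := Real.sqrt (∑ n ∈ win K, ‖c n‖ ^ 2 / (a ^ 2 + (β + n) ^ 2)) * (Real.cosh (8 * sawSigmaStar) * (4 * Real.pi + 136 * Real.sqrt 2)))
    (f := fun s => ∑ n ∈ win K, c n *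
        ((propagator a β (θ - s)).mulVec (forcing a β (singleMode (β + n)) s) 0 * Complex.exp (-((Real.pi * β / 2 : ℝ) : ℂ) * Complex.I) -
          (propagator a β (θ - s)).mulVec (forcing a β (singleMode (β + n)) s) 1 * Complex.exp (((Real.pi * β / 2 : ℝ) : ℂ) * Complex.I)))
    (fun s hs => by
      rw [uIoc_of_le hθ0] at hs
      exact duhamel_sum_V_le ha ha1 hβ hs.1.le hs.2 hθ K c)
  refine h.trans ?_
  rw [sub_zero, abs_of_nonneg hθ0]
  have h0 : 0 ≤ Real.sqrt (∑ n ∈ win K, ‖c n‖ ^ 2 / (a ^ 2 + (β + n) ^ 2)) * (Real.cosh (8 * sawSigmaStar) * (4 * Real.pi + 136 * Real.sqrt 2)) := by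
    have := Real.pi_pos; have := Real.cosh_pos (8 * sawSigmaStar); positivity
  nlinarith

/-! ## §16 (p2 g13) Column parity of the straight pair: `|Z_n| = |Q_U|` on even columns, `|Q_V|` on odd columns -/

/-- Every column of the created pair is bounded by the two frame components: `|Z_n|² ≤ |Q_U|² + |Q_V|²`
(`|Z_n| = |Q_U|` for even `n`, `|Q_V|` for odd `n`). -/
theorem norm_sq_column_le (b : ℝ) (q : Fin 2 → ℂ) (n : ℤ) :
    ‖q 0 * Complex.exp (-(Real.pi * (b + n) / 2 : ℝ) * Complex.I) + q 1 * Complex.exp ((Real.pi * (b + n) / 2 : ℝ) * Complex.I)‖ ^ 2 ≤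
      ‖q 0 * Complex.exp (-((Real.pi * b / 2 : ℝ) : ℂ) * Complex.I) + q 1 * Complex.exp (((Real.pi * b / 2 : ℝ) : ℂ) * Complex.I)‖ ^ 2 +
        ‖q 0 * Complex.exp (-((Real.pi * b / 2 : ℝ) : ℂ) * Complex.I) - q 1 * Complex.exp (((Real.pi * b / 2 : ℝ) : ℂ) * Complex.I)‖ ^ 2 := by
  set ep : ℂ := Complex.exp (((Real.pi * b / 2 : ℝ) : ℂ) * Complex.I) with hep
  set em : ℂ := Complex.exp (-((Real.pi * b / 2 : ℝ) : ℂ) * Complex.I) with hem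
  rcases Int.even_or_odd n with ⟨r, hr⟩ | ⟨r, hr⟩
  · -- even column: `Z_n = e^{−iπr}·Q_U`
    have e1 : Complex.exp (((Real.pi * (b + n) / 2 : ℝ) : ℂ) * Complex.I) = ep * Complex.exp (-((Real.pi * r : ℝ) : ℂ) * Complex.I) := by
      rw [hep, ← Complex.exp_add, show ((Real.pi * (b + n) / 2 : ℝ) : ℂ) * Complex.I =
        (((Real.pi * b / 2 : ℝ) : ℂ) * Complex.I + -((Real.pi * r : ℝ) : ℂ) * Complex.I) + (r : ℂ) * (2 * Real.pi * Complex.I) by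
          rw [hr]; push_cast; ring, Complex.exp_add, Complex.exp_int_mul_two_pi_mul_I, mul_one]
    have e2 : Complex.exp (-((Real.pi * (b + n) / 2 : ℝ) : ℂ) * Complex.I) = em * Complex.exp (-((Real.pi * r : ℝ) : ℂ) * Complex.I) := by
      rw [hem, ← Complex.exp_add]; congr 1; rw [hr]; push_cast; ring
    have hZ : q 0 * Complex.exp (-(Real.pi * (b + n) / 2 : ℝ) * Complex.I) + q 1 * Complex.exp ((Real.pi * (b + n) / 2 : ℝ) * Complex.I) =
        Complex.exp (-((Real.pi * r : ℝ) : ℂ) * Complex.I) * (q 0 * em + q 1 * ep) := by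
      rw [e1, e2]; ring
    have hn1 : ‖Complex.exp (-((Real.pi * r : ℝ) : ℂ) * Complex.I)‖ = 1 := by
      rw [show -((Real.pi * r : ℝ) : ℂ) * Complex.I = ((-(Real.pi * r) : ℝ) : ℂ) * Complex.I by push_cast; ring]; exact Complex.norm_exp_ofReal_mul_I _
    rw [hZ, norm_mul, hn1, one_mul]
    nlinarith [norm_nonneg (q 0 * em - q 1 * ep)]
  · -- odd column: `Z_n = e^{−iπr}e^{−iπ/2}·Q_V`
    have e1 : Complex.exp (((Real.pi * (b + n) / 2 : ℝ) : ℂ) * Complex.I) =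
        -(ep * Complex.exp (-((Real.pi * r : ℝ) : ℂ) * Complex.I) * Complex.exp (-((Real.pi / 2 : ℝ) : ℂ) * Complex.I)) := by
      rw [hep, ← Complex.exp_add, ← Complex.exp_add, show ((Real.pi * (b + n) / 2 : ℝ) : ℂ) * Complex.I =
        ((((Real.pi * b / 2 : ℝ) : ℂ) * Complex.I + -((Real.pi * r : ℝ) : ℂ) * Complex.I + -((Real.pi / 2 : ℝ) : ℂ) * Complex.I) +
          (r : ℂ) * (2 * Real.pi * Complex.I)) + Real.pi * Complex.I by rw [hr]; push_cast; ring,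
        Complex.exp_add, Complex.exp_add, Complex.exp_int_mul_two_pi_mul_I, mul_one, Complex.exp_pi_mul_I]
      ring
    have e2 : Complex.exp (-((Real.pi * (b + n) / 2 : ℝ) : ℂ) * Complex.I) =
        em * Complex.exp (-((Real.pi * r : ℝ) : ℂ) * Complex.I) * Complex.exp (-((Real.pi / 2 : ℝ) : ℂ) * Complex.I) := by
      rw [hem, ← Complex.exp_add, ← Complex.exp_add]; congr 1; rw [hr]; push_cast; ring
    have hZ : q 0 * Complex.exp (-(Real.pi * (b + n) / 2 : ℝ) * Complex.I) + q 1 * Complex.exp ((Real.pi * (b + n) / 2 : ℝ) * Complex.I) =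
        (Complex.exp (-((Real.pi * r : ℝ) : ℂ) * Complex.I) * Complex.exp (-((Real.pi / 2 : ℝ) : ℂ) * Complex.I)) * (q 0 * em - q 1 * ep) := by
      rw [e1, e2]; ring
    have hn1 : ‖Complex.exp (-((Real.pi * r : ℝ) : ℂ) * Complex.I) * Complex.exp (-((Real.pi / 2 : ℝ) : ℂ) * Complex.I)‖ = 1 := by
      rw [norm_mul, show -((Real.pi * r : ℝ) : ℂ) * Complex.I = ((-(Real.pi * r) : ℝ) : ℂ) * Complex.I by push_cast; ring,
        show -((Real.pi / 2 : ℝ) : ℂ) * Complex.I = ((-(Real.pi / 2) : ℝ) : ℂ) * Complex.I by push_cast; ring,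
        Complex.norm_exp_ofReal_mul_I, Complex.norm_exp_ofReal_mul_I, mul_one]
    rw [hZ, norm_mul, hn1, one_mul]
    nlinarith [norm_nonneg (q 0 * em + q 1 * ep)]

/-- The off-corner columns have bounded total weight: `Σ_{|n| ≤ K, n ≠ 0} 1/(a² + (b+n)²) ≤ 4π²/3` for `|b| ≤ ½`. -/
theorem sum_weights_off_zero_le {a : ℝ} (ha : 0 < a) {b : ℝ} (hb : |b| ≤ 1 / 2) (K : ℕ) :
    ∑ n ∈ (win K).erase 0, 1 / (a ^ 2 + (b + n) ^ 2) ≤ 4 * Real.pi ^ 2 / 3 := by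
  have hπ := Real.pi_pos
  have hle : ∀ n ∈ (win K).erase 0, 1 / (a ^ 2 + (b + n) ^ 2) ≤ 2 * Real.pi ^ 2 * (2 / (Real.pi ^ 2 * (n : ℝ) ^ 2)) := by
    intro n hn
    have hn0 : n ≠ 0 := (Finset.mem_erase.1 hn).1
    have h := lineWeight_le_inv_pi_sq_mul_sq ha hb hn0
    have hm0 : (0 : ℝ) < (n : ℝ) ^ 2 := by
      have : (n : ℝ) ≠ 0 := by exact_mod_cast hn0
      exact lt_of_le_of_ne (sq_nonneg _) (Ne.symm (pow_ne_zero 2 this))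
    rw [div_le_div_iff₀ (by positivity) (by positivity)] at h
    have h2 : Real.pi ^ 2 * (n : ℝ) ^ 2 ≤ Real.pi ^ 2 * (4 * (a ^ 2 + (b + n) ^ 2)) := by linarith
    have h3 := le_of_mul_le_mul_left h2 (by positivity : (0 : ℝ) < Real.pi ^ 2)
    rw [show 2 * Real.pi ^ 2 * (2 / (Real.pi ^ 2 * (n : ℝ) ^ 2)) = 4 / (n : ℝ) ^ 2 by field_simp; ring,
      div_le_div_iff₀ (by positivity) hm0]
    linarith
  have hsum := sum_le_hasSum ((win K).erase 0) (fun n _ => by positivity) hasSum_two_div_pi_sq_mul_sq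
  calc ∑ n ∈ (win K).erase 0, 1 / (a ^ 2 + (b + n) ^ 2) ≤ ∑ n ∈ (win K).erase 0, 2 * Real.pi ^ 2 * (2 / (Real.pi ^ 2 * (n : ℝ) ^ 2)) :=
        Finset.sum_le_sum hle
    _ = 2 * Real.pi ^ 2 * ∑ n ∈ (win K).erase 0, 2 / (Real.pi ^ 2 * (n : ℝ) ^ 2) := by rw [Finset.mul_sum]
    _ ≤ 2 * Real.pi ^ 2 * (2 / 3) := mul_le_mul_of_nonneg_left hsum (by positivity)
    _ = 4 * Real.pi ^ 2 / 3 := by ring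

/-- **The line energy through the frame:** for `|b| ≤ ½`,
`lineEnergyOut a b K q ≤ |Q_U|²·(1/(a²+b²) + 4π²/3) + |Q_V|²·4π²/3` — the corner column `n = 0` sees only `Q_U`. -/
theorem lineEnergyOut_le_frame {a : ℝ} (ha : 0 < a) {b : ℝ} (hb : |b| ≤ 1 / 2) (K : ℕ) (q : Fin 2 → ℂ) :
    lineEnergyOut a b K q ≤
      ‖q 0 * Complex.exp (-((Real.pi * b / 2 : ℝ) : ℂ) * Complex.I) + q 1 * Complex.exp (((Real.pi * b / 2 : ℝ) : ℂ) * Complex.I)‖ ^ 2 *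
          (1 / (a ^ 2 + b ^ 2) + 4 * Real.pi ^ 2 / 3) +
        ‖q 0 * Complex.exp (-((Real.pi * b / 2 : ℝ) : ℂ) * Complex.I) - q 1 * Complex.exp (((Real.pi * b / 2 : ℝ) : ℂ) * Complex.I)‖ ^ 2 *
          (4 * Real.pi ^ 2 / 3) := by
  set QU : ℝ := ‖q 0 * Complex.exp (-((Real.pi * b / 2 : ℝ) : ℂ) * Complex.I) + q 1 * Complex.exp (((Real.pi * b / 2 : ℝ) : ℂ) * Complex.I)‖ with hQU
  set QV : ℝ := ‖q 0 * Complex.exp (-((Real.pi * b / 2 : ℝ) : ℂ) * Complex.I) - q 1 * Complex.exp (((Real.pi * b / 2 : ℝ) : ℂ) * Complex.I)‖ with hQV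
  have h0 : (0 : ℤ) ∈ win K := by simp [win]
  unfold lineEnergyOut
  rw [← Finset.add_sum_erase _ _ h0]
  have hz : ‖q 0 * Complex.exp (-(Real.pi * (b + ((0 : ℤ) : ℝ)) / 2 : ℝ) * Complex.I) + q 1 * Complex.exp ((Real.pi * (b + ((0 : ℤ) : ℝ)) / 2 : ℝ) * Complex.I)‖ ^ 2 /
      (a ^ 2 + (b + ((0 : ℤ) : ℝ)) ^ 2) = QU ^ 2 * (1 / (a ^ 2 + b ^ 2)) := by
    rw [hQU]; simp only [Int.cast_zero, add_zero, mul_one_div]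
  have hrest : ∑ n ∈ (win K).erase 0, ‖q 0 * Complex.exp (-(Real.pi * (b + n) / 2 : ℝ) * Complex.I) + q 1 * Complex.exp ((Real.pi * (b + n) / 2 : ℝ) * Complex.I)‖ ^ 2 /
      (a ^ 2 + (b + n) ^ 2) ≤ (QU ^ 2 + QV ^ 2) * (4 * Real.pi ^ 2 / 3) := by
    calc ∑ n ∈ (win K).erase 0, ‖q 0 * Complex.exp (-(Real.pi * (b + n) / 2 : ℝ) * Complex.I) + q 1 * Complex.exp ((Real.pi * (b + n) / 2 : ℝ) * Complex.I)‖ ^ 2 /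
          (a ^ 2 + (b + n) ^ 2)
        ≤ ∑ n ∈ (win K).erase 0, (QU ^ 2 + QV ^ 2) * (1 / (a ^ 2 + (b + n) ^ 2)) := by
          refine Finset.sum_le_sum fun n _ => ?_
          rw [← mul_one_div]
          exact mul_le_mul_of_nonneg_right (norm_sq_column_le b q n) (by positivity)
      _ = (QU ^ 2 + QV ^ 2) * ∑ n ∈ (win K).erase 0, 1 / (a ^ 2 + (b + n) ^ 2) := by rw [Finset.mul_sum]
      _ ≤ (QU ^ 2 + QV ^ 2) * (4 * Real.pi ^ 2 / 3) := mul_le_mul_of_nonneg_left (sum_weights_off_zero_le ha hb K) (by positivity)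
  rw [hz]
  nlinarith [hrest, sq_nonneg QU, sq_nonneg QV, Real.pi_pos]

/-! ## §17 (p2 g13) THE CORNER LAW -/

/-- The constant of the corner law (truth-only; astronomically lossy). -/
def cornerConst : ℝ :=
  64 * Real.cosh (8 * sawSigmaStar) ^ 2 *
    (((4 * Real.pi) * (Real.sqrt 2 + 12 * Real.pi)) ^ 2 * (1 + 4 * Real.pi ^ 2 / 3) + (4 * Real.pi + 136 * Real.sqrt 2) ^ 2 * (4 * Real.pi ^ 2 / 3))

theorem cornerConst_nonneg : 0 ≤ cornerConst := by unfold cornerConst; positivity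

/-- **The law on the lines `0 < a ≤ 1/16`, Bloch offsets `|β| ≤ ½`.** -/
theorem coreLaw_pos {a : ℝ} (ha : 0 < a) (ha1 : a ≤ 1 / 16) {β : ℝ} (hβ : |β| ≤ 1 / 2) {θ : ℝ} (hθ0 : 0 ≤ θ) (hθ : θ ≤ 8) (K : ℕ) (c : ℤ → ℂ) :
    lineEnergyOut a β K (sheetAmps a β θ ⟨modeProfile β K c, []⟩) ≤ cornerConst * ∑ n ∈ win K, ‖c n‖ ^ 2 / (a ^ 2 + (β + n) ^ 2) := by
  set E : ℝ := ∑ n ∈ win K, ‖c n‖ ^ 2 / (a ^ 2 + (β + n) ^ 2) with hE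
  set q := sheetAmps a β θ ⟨modeProfile β K c, []⟩ with hq
  set M₀ : ℝ := Real.cosh (8 * sawSigmaStar) with hM₀
  set L₁ : ℝ := (4 * Real.pi) * (Real.sqrt 2 + 12 * Real.pi) with hL₁
  set L₂ : ℝ := 4 * Real.pi + 136 * Real.sqrt 2 with hL₂
  set QU : ℝ := ‖q 0 * Complex.exp (-((Real.pi * β / 2 : ℝ) : ℂ) * Complex.I) + q 1 * Complex.exp (((Real.pi * β / 2 : ℝ) : ℂ) * Complex.I)‖ with hQU
  set QV : ℝ := ‖q 0 * Complex.exp (-((Real.pi * β / 2 : ℝ) : ℂ) * Complex.I) - q 1 * Complex.exp (((Real.pi * β / 2 : ℝ) : ℂ) * Complex.I)‖ with hQV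
  have hπ := Real.pi_pos
  have hE0 : 0 ≤ E := Finset.sum_nonneg fun n _ => by positivity
  have hsq : Real.sqrt E ^ 2 = E := Real.sq_sqrt hE0
  have hU : QU ≤ 8 * (a * Real.sqrt E * (M₀ * (4 * Real.pi) * (Real.sqrt 2 + 12 * Real.pi))) := norm_QU_le ha ha1 hβ hθ0 hθ K c
  have hV : QV ≤ 8 * (Real.sqrt E * (M₀ * (4 * Real.pi + 136 * Real.sqrt 2))) := norm_QV_le ha ha1 hβ hθ0 hθ K c
  have hU' : QU ≤ 8 * a * Real.sqrt E * M₀ * L₁ := by rw [hL₁]; linarith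
  have hV' : QV ≤ 8 * Real.sqrt E * M₀ * L₂ := by rw [hL₂]; linarith
  have hQU0 : 0 ≤ QU := norm_nonneg _
  have hQV0 : 0 ≤ QV := norm_nonneg _
  have hUsq : QU ^ 2 ≤ 64 * a ^ 2 * E * (M₀ * L₁) ^ 2 := by
    have h := pow_le_pow_left₀ hQU0 hU' 2
    rw [show (8 * a * Real.sqrt E * M₀ * L₁) ^ 2 = 64 * a ^ 2 * Real.sqrt E ^ 2 * (M₀ * L₁) ^ 2 by ring, hsq] at h
    exact h
  have hVsq : QV ^ 2 ≤ 64 * E * (M₀ * L₂) ^ 2 := by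
    have h := pow_le_pow_left₀ hQV0 hV' 2
    rw [show (8 * Real.sqrt E * M₀ * L₂) ^ 2 = 64 * Real.sqrt E ^ 2 * (M₀ * L₂) ^ 2 by ring, hsq] at h
    exact h
  have hframe := lineEnergyOut_le_frame ha hβ K q
  have hab : 0 < a ^ 2 + β ^ 2 := by positivity
  have h1 : QU ^ 2 * (1 / (a ^ 2 + β ^ 2)) ≤ 64 * E * (M₀ * L₁) ^ 2 := by
    rw [mul_one_div, div_le_iff₀ hab]
    nlinarith [mul_nonneg (mul_nonneg hE0 (sq_nonneg (M₀ * L₁))) (sq_nonneg β)]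
  have ha2 : a ^ 2 ≤ 1 := by nlinarith
  have h2 : QU ^ 2 ≤ 64 * E * (M₀ * L₁) ^ 2 := by nlinarith [mul_nonneg hE0 (sq_nonneg (M₀ * L₁))]
  have hC : cornerConst = 64 * M₀ ^ 2 * (L₁ ^ 2 * (1 + 4 * Real.pi ^ 2 / 3) + L₂ ^ 2 * (4 * Real.pi ^ 2 / 3)) := by
    rw [hM₀, hL₁, hL₂]; rfl
  rw [hC]
  have hp : 0 ≤ 4 * Real.pi ^ 2 / 3 := by positivity
  calc lineEnergyOut a β K q ≤ QU ^ 2 * (1 / (a ^ 2 + β ^ 2) + 4 * Real.pi ^ 2 / 3) + QV ^ 2 * (4 * Real.pi ^ 2 / 3) := hframe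
    _ = QU ^ 2 * (1 / (a ^ 2 + β ^ 2)) + QU ^ 2 * (4 * Real.pi ^ 2 / 3) + QV ^ 2 * (4 * Real.pi ^ 2 / 3) := by ring
    _ ≤ 64 * E * (M₀ * L₁) ^ 2 + 64 * E * (M₀ * L₁) ^ 2 * (4 * Real.pi ^ 2 / 3) + 64 * E * (M₀ * L₂) ^ 2 * (4 * Real.pi ^ 2 / 3) := by
        gcongr
    _ = 64 * M₀ ^ 2 * (L₁ ^ 2 * (1 + 4 * Real.pi ^ 2 / 3) + L₂ ^ 2 * (4 * Real.pi ^ 2 / 3)) * E := by ring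

/-- **The law on the lines `0 < |a| ≤ 1/16`, Bloch offsets `|β| ≤ ½`** (negative lines by conjugation). -/
theorem coreLaw_ne {a : ℝ} (ha : a ≠ 0) (ha1 : |a| ≤ 1 / 16) {β : ℝ} (hβ : |β| ≤ 1 / 2) {θ : ℝ} (hθ0 : 0 ≤ θ) (hθ : θ ≤ 8) (K : ℕ) (c : ℤ → ℂ) :
    lineEnergyOut a β K (sheetAmps a β θ ⟨modeProfile β K c, []⟩) ≤ cornerConst * ∑ n ∈ win K, ‖c n‖ ^ 2 / (a ^ 2 + (β + n) ^ 2) := by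
  rcases lt_or_gt_of_ne ha with hneg | hpos
  · have ha' : 0 < -a := by linarith
    have ha1' : -a ≤ 1 / 16 := by rw [abs_of_neg hneg] at ha1; exact ha1
    have hβ' : |(-β)| ≤ 1 / 2 := by rwa [abs_neg]
    exact lineLaw_of_conj hneg (coreLaw_pos ha' ha1' hβ' hθ0 hθ K (fun n => starRingEnd ℂ (c (-n))))
  · rw [abs_of_pos hpos] at ha1
    exact coreLaw_pos hpos ha1 hβ hθ0 hθ K c

/-- **THE CORNER LAW (B1 of record, arbiter A28-10″/A28-11):** `CoreStripLaw (1/16) cornerConst` — on every line `|a| < 1/16`, for every Bloch offset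
`b ∈ [0,1]`, strain `θ ∈ [0,8]`, window `K` and profile `c`, the lattice line energy of the created straight pair is at most `cornerConst ×` the line's input
energy, uniformly as `(a, b) → (0, 0)` and `(a, b) → (0, 1)`. -/
theorem coreStripLaw_sixteenth : CoreStripLaw (1 / 16) cornerConst := by
  intro a b θ K c ha hb0 hb1 hθ0 hθ
  have hS0 : 0 ≤ ∑ n ∈ win K, ‖c n‖ ^ 2 / (a ^ 2 + (b + n) ^ 2) := Finset.sum_nonneg fun _ _ => by positivity
  rcases eq_or_ne a 0 with h0 | hne
  · subst h0
    rw [sheetAmps_zero_line, lineEnergyOut_zero]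
    exact mul_nonneg cornerConst_nonneg hS0
  by_cases hb : b ≤ 1 / 2
  · exact coreLaw_ne hne ha.le (abs_le.2 ⟨by linarith, hb⟩) hθ0 hθ K c
  · rw [not_le] at hb
    exact lineLaw_of_shift (coreLaw_ne hne ha.le (abs_le.2 ⟨by linarith, by linarith⟩) hθ0 hθ (K + 1) (shiftCoef K c))

/-- **B1 OF RECORD, existential form:** `∃ a₀ > 0, ∃ C ≥ 0, CoreStripLaw a₀ C`.  With `K2CoreLineLaw.coreLineLaw_of_strip` and
`K2CreationLaws.entryBoundsW_of_coreLineLaw` (same verbatim definitions) this closes the truth half of the K2 chain: `EntryBoundsW θ 0 M D` for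
every cell, class, truncation and age. -/
theorem coreStripLaw_corner : ∃ a₀ > 0, ∃ C ≥ 0, CoreStripLaw a₀ C :=
  ⟨1 / 16, by norm_num, cornerConst, cornerConst_nonneg, coreStripLaw_sixteenth⟩

/-- **B1 CLOSED (v2, p2 g13): `CoreLineLaw C_B1`** — the exact line-energy creation law on the whole unit strip `|a| < 1`, every Bloch offset `b ∈ [0,1]`,
strain `θ ∈ [0,8]`, window and profile: §7 `coreLineLaw_of_strip` at `a₀ = 1/16` composed with the corner law `coreStripLaw_sixteenth`. -/
theorem coreLineLaw_B1 : CoreLineLaw (max cornerConst (2 * 84500 * prefBound (1 / 16) ^ 2 * (Real.pi / (1 / 16) + 4 / (1 / 16) ^ 2))) :=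
  coreLineLaw_of_strip (by norm_num) cornerConst_nonneg coreStripLaw_sixteenth

/-- B1 closed, existential form: `∃ C ≥ 0, CoreLineLaw C`. -/
theorem coreLineLaw_holds : ∃ C ≥ 0, CoreLineLaw C :=
  ⟨_, le_max_of_le_left cornerConst_nonneg, coreLineLaw_B1⟩

end

end Summit.AnomalousDissipation.AnomalousDissipation.Cruxes.K1LocalisedCascade.K2CoreLineLaw
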